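import Literature.Probability.RandomPlanarGeometry.YangBaxterSAWTheoremsHolds
import HarnessLib

/-!
# Barrier (SAWScalingLimit): spin rigidity of exact vertex relations for plaquette walks on `ℤ²`

Barrier catalogue `Literature/Barriers/CriticalPhenomena/` (D-0021), sub-problem `SAWScalingLimit`;
companion of `NienhuisWeightsExcludeVertexSAW` (the uniform square-lattice SAW admits no exact
vertex relation), `NoExactVertexRelationZ2Stiffness` (nor does its stiffness deformation) and of the
positive family `Literature.Probability.RandomPlanarGeometry.YangBaxterSAWSquareLattice` (the printed
Yang–Baxter weights DO satisfy an exact vertex relation on `ℤ²`, with `θ`-dressed coefficients, at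
spin `σ = 5/8`). This file answers, for the whole five-parameter family of plaquette walks at once,
the question "at which SPINS can an exact vertex relation exist at all?".

## What the sources print

* Glazman 2015 (ECP 20 no. 86), Lemma 3.1: the plaquette weights `(u₁, u₂, v, w₁, w₂)` for which the
  parafermionic observable with spin `σ` satisfies the (half-)discrete Cauchy–Riemann relation
  around a rhombus of angle `θ` exist and are unique for `σ = ℓ/8`, `ℓ` odd (Nienhuis' integrable
  weights); for `σ = 1` they form a degenerate family with `v = 0`; "for all other values of `σ`
  the weights … exist only for some specific values of `θ`". [cite: Glazman2015WeightedSAW, Lemma 3.1]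
* Glazman 2015, proof of Lemma 3.1: "Solving this linear system, we obtain that either `v = 0` or
  `σ = ℓ/8` where `ℓ` is some odd number" — the printed `n = 0` dichotomy whose `v ≠ 0` branch is
  the conclusion below. [cite: Glazman2015WeightedSAW, Lemma 3.1 (proof: "either v = 0 or σ = ℓ/8")]
* Ikhlef–Cardy 2009, §3 ("The `O(n)` loop model on the square lattice"): the one-plaquette
  discrete-holomorphicity system (3.1)–(3.4) for the vertex weights `t, u₁, u₂, v, w₁, w₂` reduces to
  a `6 × 6` real system "with determinant `(n² − 1) sin φ sin(φ − πs) (2cos 4πs − 3n + n³)`.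
  Non-trivial solutions exist if the spin satisfies `cos 4πs = cos 6η`"; the other solution classes
  printed there have `v = 0`. At `n = 0` the generic-branch condition is `cos 4πs = 0`, i.e.
  `s ∈ (2ℤ+1)/8`, i.e. `t¹⁶ = e^{−8πis} = −1` for the quarter-turn phase `t = e^{−isπ/2}`.
  [cite: IkhlefCardy2009, §3 (determinant (n²−1) sin φ sin(φ−πs)(2cos 4πs − 3n + n³); the v = 0 classes)]
* Alam–Batchelor 2014, §3.2: "the system has non-trivial solutions when the determinant of the
  reduced system vanishes … which results in `φ(4π) + φ(−4π) = 3n − n³`, so that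
  `1 − σ = 3η/π + ½ℓ`". [cite: AlamBatchelor2014, §3.2]
* Glazman–Manolescu 2019, §1 (the walk model: arcs in plaquettes, weights eq. (1)) and Lemma 2.1
  (the shape of the relation, one per rhombus). [cite: GlazmanManolescu2019, §1 and Lemma 2.1]
* Duminil-Copin–Smirnov 2012, Lemma 1 (the shape `Σ c_z F(z) = 0` over the mid-edges at a
  vertex, and the value `σ = 5/8`). [cite: DuminilCopinSmirnov2012, Lemma 1]

## What is formalised (namespace `Literature.Barriers.CriticalPhenomena.PlaquetteWalk`)

* A kernel-computable, CERTIFIED ENUMERATION of the Glazman–Manolescu walks (`YBWalk`, tree) of a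
  finite face list: `dfs` (depth-first extension by one mid-edge under the test `extOK`) with
  completeness and soundness against the `YBWalk` axioms (`dfs_complete`, `dfs_sound`, private) and
  the conversion of the sum over `YBWalk (dom Dl) a z` into a list sum (`sum_walks_eq`).
* The FREE-WEIGHT square-lattice observable `gmObservable W t Dl a z = Σ_γ w_W(γ) t^{q(γ)}`
  (complex weights `W = (u₁,u₂,v,w₁,w₂)`, `q` = signed quarter turns, `t` the phase per left quarter
  turn — `t = e^{−iσπ/2}` for spin `σ`), the vertex functional `Σ_{s ∈ (E,N,W,S)} c_s F(z_s)` at a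
  face, and the technique class **`ExactPlaquetteVertexRelation W t c`**: the relation holds at every
  face of every finite domain for every boundary root (Glazman–Manolescu's Lemma 2.1 shape).
* `vertexFunctional_mul_pow_eq_rowSumN`: the functional is a kernel-computable row
  `Σ_τ c_{slot} u₁^{n₁} u₂^{n₂} v^{n_v} w₁^{n_{w₁}} w₂^{n_{w₂}} t^{q+m₀}` over the enumerated terms.
* Fourteen instances on domains of one, four and six faces around the face `(0,0)` (rooted at a free
  side of `(0,0)`, relation at `(0,0)`), evaluated by `decide`, give the four one-visit ("group one")
  rows and isolate six excursion ("group two") forms of Ikhlef–Cardy/Glazman type with free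
  weights: `[E;NW] = (0, v, u₂t⁵, w₂t⁴)`, `[W;ES]`, `[E;WS] = (0, w₁t, u₁, vt⁵)`, `[W;EN]`,
  `[N;EW] = (u₁t⁷, 0, u₂t, w₂ + w₁t⁸)`, `[S;EW]` (slot order `(E,N,W,S)`).
* **`PlaquetteWalkSpinRigidity`** (named statement) and `PlaquetteWalkSpinRigidity_holds`:
  for all complex weights with `u₁ u₂ v ≠ 0` (any `w₁, w₂`), all `t ≠ 0` and all `c ≠ 0`,
  `ExactPlaquetteVertexRelation W t c → t¹⁶ = −1`; i.e. an exact vertex relation can exist only at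
  the spins `σ ∈ (2ℤ+1)/8` — the formal, coefficient-free counterpart of the "`σ = ℓ/8`, `ℓ` odd"
  clause of Glazman's Lemma 3.1 (there for the Cauchy–Riemann-shaped relation; here for every
  coefficient vector, from finitely many domains, by elimination: after symmetrising under the
  half-turn, the forms `[E;NW]±[W;ES]`, `[W;EN]±[E;WS]`, `[N;EW]±[S;EW]` combine to
  `v · (c_N ± c_S) · (t¹⁶ + 1) = 0`).
* `eq_zero_of_exactPlaquetteVertexRelation_of_w₂_eq_zero`: on the face `w₂ = 0` (no self-touching
  at co-corners; any `w₁`), off the quadric `v² = u₂²`, the class is EMPTY (`c = 0`) at every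
  `t ≠ 0` — the plaquette-frame form of the no-touching no-go; the positive Yang–Baxter member
  `θ = π/3` (`w₂ = 0`, `v = u₂ = x_c²`) lies exactly on the excluded quadric.

* (Appended, same file) the INTERIOR-faces class `ExactPlaquetteVertexRelationInt` (relation demanded
  only at faces whose four neighbours are in the domain — Duminil-Copin–Smirnov's / the catalogue's
  `ExactVertexRelationZ2` quantifier), fourteen interior instances (the same domains with the four
  neighbours of `(0,0)` added, rooted at the far side of a neighbour; each row is `v ×` the boundary
  one), the stronger barrier statement **`PlaquetteWalkSpinRigidityInt`** (`…Int → t¹⁶ = −1`) with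
  `PlaquetteWalkSpinRigidityInt_holds`, the mirror face `w₁ = 0` and the no-touching classification
  `sq_eq_and_sq_eq_of_exactPlaquetteVertexRelation_noTouch` (`w₁ = w₂ = 0 ⇒ v² = u₁² = u₂²`, the
  uniform walk up to signs, `∧ t¹⁶ = −1`).
* (Appended) c-FREE WEIGHT RELATIONS by adjugate certificates on three four-walk quadruples:
  `oneVisit_det_eq_zero` (the one-visit determinant vanishes — for ALL complex weights, no division),
  `coCorner_weight_relation` / `corner_weight_relation` (`t⁸(u² − v² − w²)² = (t⁸+1)² v² w²` for each
  corner type, `u₁u₂v ≠ 0`), and at the forced spins **`nienhuis_weight_relations`**: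
  `(u₂² − v² − w₂²)² = 2v²w₂²` and `(u₁² − v² − w₁²)² = 2v²w₁²`, i.e. `u² = v² + w² ± √2·vw` — Nienhuis'
  relations between corner, straight and self-touching weights as NECESSARY conditions for any exact
  vertex identity on `ℤ²` (the printed weights satisfy them with `+√2` at `θ = π/2`, and at `θ = π/3`
  with `(u₁,u₂,v,w₁,w₂) = (x_c, x_c², x_c², x_c², 0)` they reduce to `2x_c⁴ − 4x_c² + 1 = 0`);
  `opposite_weight_relation(_forced)` (two further instances, opposite excursions `[E;NS]`, `[W;NS]`):
  `t¹²(u₁² + u₂² − w₁² − w₂²)² = (t¹²+1)² u₁²u₂²`, i.e. `u₁² + u₂² − w₁² − w₂² = ±(t⁶+t⁻⁶)u₁u₂`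
  (`t⁶ + t⁻⁶ = 2cos(π/8) = 1/x_c` at `σ = 5/8`). With the spin these are four independent c-free
  conditions on the five weights.

## Status in print

The CONCLUSION is printed in substance: `t¹⁶ = −1 ⇔ σ ∈ (2ℤ+1)/8` is the `v ≠ 0` branch of Glazman's
"either `v = 0` or `σ = ℓ/8`, `ℓ` odd" (2015, proof of Lemma 3.1) and the `n = 0` case of the printed
one-plaquette spin condition `2cos 4πs = 3n − n³` (Ikhlef–Cardy 2009 §3; Alam–Batchelor 2014 §3.2),
derived there by solving the LOCAL linear system for Cauchy–Riemann-shaped coefficients, inside the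
`O(n)`/Yang–Baxter ansatz. New here: NECESSITY for an arbitrary coefficient vector and arbitrary complex
weights with `u₁ u₂ v ≠ 0`, derived from the all-finite-domains hypothesis through explicit finite
domains with a kernel-certified enumeration, in the square frame (a rigour upgrade / consolidation,
not a new phenomenon). The hypothesis `v ≠ 0` is exactly print's dichotomy. Which weights occur AT an
allowed spin is Glazman's Lemma 3.1 / the Yang–Baxter curve of the companion file, not treated here.

## References

* A. Glazman, ECP 20 (2015) no. 86, Lemma 3.1 and its proof. [Glazman2015WeightedSAW]
* Y. Ikhlef, J. Cardy, J. Phys. A 42 (2009) 102001 = arXiv:0810.5037, §3. [IkhlefCardy2009]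
* I. T. Alam, M. T. Batchelor, J. Phys. A 47 (2014) 215201 = arXiv:1402.0937, §3.2. [AlamBatchelor2014]
* A. Glazman, I. Manolescu, AIHP 56 (2020) = arXiv:1708.00395, §1, §2.1, Lemma 2.1. [GlazmanManolescu2019]
* H. Duminil-Copin, S. Smirnov, Ann. of Math. 175 (2012), Lemma 1. [DuminilCopinSmirnov2012]
* N. R. Beaton, A. J. Guttmann, I. Jensen, J. Phys. A 45 (2012) 035201, p. 2. [BeatonGuttmannJensen2012]

Nothing here uses numerics; the enumeration is checked in the kernel against the `YBWalk` axioms.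
Written for the venture lane «pcv-sawmu» (Tier B, `ℤ²` search; HOME/FINDING-Z2-YANGBAXTER-FAMILY.md
§3: the sixteen local group forms, first derived there from the lane's tables).
-/

noncomputable section

open Real

namespace Literature.Barriers.CriticalPhenomena

open Literature.Probability.RandomPlanarGeometry.SAW.YangBaxter
open Literature.Probability.RandomPlanarGeometry.SAW.YangBaxter.MidEdge

namespace PlaquetteWalk

/-! ### Finite domains given as lists of faces -/

/-- The domain of a face list. [folklore] -/
def dom (Dl : List Face) : Set Face := {f | f ∈ Dl}

/-- A face list is a finite domain. [folklore] -/
instance (Dl : List Face) : Finite (dom Dl) :=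
  ((List.finite_toSet Dl).subset (fun _ h => h)).to_subtype

/-- Walks of a face list form a finite type (noncomputably; the computable enumeration is `dfs`).
[cite: GlazmanManolescu2019, §2.1 ("the sum in the definition of F is finite")] -/
noncomputable instance (Dl : List Face) (a z : MidEdge) : Fintype (YBWalk (dom Dl) a z) :=
  Fintype.ofFinite _

/-- `IsWE` is decidable. [folklore] -/
instance (f : Face) (p : MidEdge × MidEdge) : Decidable (IsWE f p) := by unfold IsWE; infer_instance
/-- `IsSN` is decidable. [folklore] -/
instance (f : Face) (p : MidEdge × MidEdge) : Decidable (IsSN f p) := by unfold IsSN; infer_instance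

/-- The four sides of a face, listed. [folklore] -/
def sidesL (f : Face) : List MidEdge := [f.side .W, f.side .E, f.side .S, f.side .N]

/-- Candidate mid-edges of a face list (all sides, without repetition). [folklore] -/
def candL (Dl : List Face) : List MidEdge := (Dl.flatMap sidesL).dedup

/-- One-step extension test: may the mid-edge list `l`, currently ending at `z`, be continued by the
mid-edge `e` (new edge, arc `z → e` in a face of the domain, different from the face of the previous
arc, and not the second crossing straight arc of that face)? [folklore] -/
private def extOK (Dl : List Face) (l : List MidEdge) (z e : MidEdge) : Prop :=
  e ∉ l ∧
    match arcFace (z, e) with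
    | none => False
    | some f => f ∈ Dl ∧ (∀ y ∈ l.dropLast.getLast?, arcFace (y, z) ≠ some f) ∧
        (IsWE f (z, e) → ∀ p ∈ arcsOf l, ¬IsSN f p) ∧ (IsSN f (z, e) → ∀ p ∈ arcsOf l, ¬IsWE f p)

/-- The extension test is decidable. [folklore] -/
private instance (Dl : List Face) (l : List MidEdge) (z e : MidEdge) : Decidable (extOK Dl l z e) := by
  unfold extOK
  cases h : arcFace (z, e) <;> simp only <;> infer_instance

/-- Depth-first enumeration of the continuations of a mid-edge list by at most `n` further arcs.
[folklore] -/
def dfs (Dl : List Face) : ℕ → List MidEdge → List (List MidEdge)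
  | 0, l => [l]
  | n + 1, l => l ::
      match l.getLast? with
      | none => []
      | some z => ((candL Dl).filter fun e => decide (extOK Dl l z e)).flatMap fun e => dfs Dl n (l ++ [e])

/-! ### Local configuration counts and the quarter-turn count of a mid-edge list -/

/-- Signed number of quarter turns of the arc `s → t` of a square face: `+1` for a left turn
(`W→N`, `E→S`, `S→W`, `N→E`), `−1` for a right turn, `0` straight (= `arcTurn (π/2) s t / (π/2)`).
[folklore] -/
def qTurn : Side → Side → ℤ
  | .W, .N => 1
  | .N, .W => -1
  | .S, .E => -1
  | .E, .S => 1
  | .W, .S => -1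
  | .S, .W => 1
  | .N, .E => 1
  | .E, .N => -1
  | _, _ => 0

/-- The signed quarter-turn count of an arc (in its face). [folklore] -/
def qTurnOf (p : MidEdge × MidEdge) : ℤ :=
  match arcFace p with
  | some f =>
    match f.sideOf p.1, f.sideOf p.2 with
    | some s, some t => qTurn s t
    | _, _ => 0
  | none => 0

/-- Total signed quarter turns of a mid-edge list. [folklore] -/
def quarterTurnsL (l : List MidEdge) : ℤ := ((arcsOf l).map qTurnOf).sum

/-- The faces visited by a mid-edge list (those containing one of its arcs), without repetition.
[folklore] -/
def facesL (l : List MidEdge) : List Face := ((arcsOf l).filterMap arcFace).dedup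

/-- The kinds of the arcs of `l` inside the face `f` (cf. `YBWalk.kindsIn`). [folklore] -/
def kindsL (l : List MidEdge) (f : Face) : List ArcKind :=
  (arcsOf l).filterMap fun p => if arcFace p = some f then arcKindOf p else none

/-- Number of visited faces of `l` carrying the local configuration `κ`. [folklore] -/
def cfgCount (l : List MidEdge) (κ : List ArcKind) : ℕ := (facesL l).countP fun f => kindsL l f = κ

/-- A term of a vertex functional: slot `(E, N, W, S) ↦ (0, 1, 2, 3)` and exponent vector
`(n_{u₁}, n_{u₂}, n_v, n_{w₁}, n_{w₂}, q)` — the numbers of plaquettes in each of the five weighted local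
configurations of eq. (1) and the signed quarter-turn count. [cite: GlazmanManolescu2019, §1, Fig. 1 and eq. (1) (the five local configurations)] -/
structure Term where
  /-- slot index, `(E, N, W, S) ↦ (0, 1, 2, 3)` -/
  slot : Fin 4
  /-- faces crossed by one corner arc -/
  n1 : ℕ
  /-- faces crossed by one co-corner arc -/
  n2 : ℕ
  /-- faces crossed by one straight arc -/
  nv : ℕ
  /-- faces crossed by two corner arcs -/
  nw1 : ℕ
  /-- faces crossed by two co-corner arcs -/
  nw2 : ℕ
  /-- signed quarter turns -/
  q : ℤ
  deriving DecidableEq, Repr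

/-- The exponent data of a mid-edge list ending in slot `s`: numbers of visited faces crossed by one
corner arc / one co-corner arc / one straight arc / two corner arcs / two co-corner arcs, and the
signed quarter-turn count. [folklore] -/
def expo (s : Fin 4) (l : List MidEdge) : Term :=
  ⟨s, cfgCount l [.corner], cfgCount l [.coCorner], cfgCount l [.straight],
    cfgCount l [.corner, .corner], cfgCount l [.coCorner, .coCorner], quarterTurnsL l⟩

/-- The slot index of a mid-edge among the four sides of the face `f₀`, in the order
`(E, N, W, S) ↦ (0, 1, 2, 3)` of the lane's tables (`none` if not a side of `f₀`). [folklore] -/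
def slotOf (f₀ : Face) (e : MidEdge) : Option (Fin 4) :=
  match f₀.sideOf e with
  | some .E => some 0
  | some .N => some 1
  | some .W => some 2
  | some .S => some 3
  | none => none

/-- The term list of the vertex functional at `f₀`: for every enumerated walk ending on a side of
`f₀`, its slot and exponent vector. [folklore] -/
def terms (Dl : List Face) (a : MidEdge) (f₀ : Face) (n : ℕ) : List Term :=
  ((dfs Dl n [a]).dedup).filterMap fun l =>
    match l.getLast? with
    | none => none
    | some e =>
      match slotOf f₀ e with
      | none => none
      | some s => some (expo s l)




/-! ### Validity of a mid-edge list as a walk, and correctness of the enumeration -/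

/-- The arcs of a list extended by one mid-edge. [folklore] -/
private theorem arcsOf_concat {l : List MidEdge} {z : MidEdge} (hz : l.getLast? = some z) (e : MidEdge) :
    arcsOf (l ++ [e]) = arcsOf l ++ [(z, e)] := by
  obtain ⟨l₀, rfl⟩ := List.getLast?_eq_some_iff.1 hz
  rw [List.append_assoc, List.singleton_append, arcsOf_append_cons]
  rfl

/-- The fields of `YBWalk` (except the endpoint) for a raw mid-edge list. [folklore] -/
private structure ValidL (Dl : List Face) (a : MidEdge) (l : List MidEdge) : Prop where
  head_eq : l.head? = some a
  nodup : l.Nodup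
  arc_mem : ∀ p ∈ arcsOf l, ∃ f ∈ dom Dl, arcFace p = some f
  isChain : (arcsOf l).IsChain fun p q => arcFace p ≠ arcFace q
  noncross : ∀ f : Face,
    ((f.side .W, f.side .E) ∈ arcsOf l ∨ (f.side .E, f.side .W) ∈ arcsOf l) →
      ¬((f.side .S, f.side .N) ∈ arcsOf l ∨ (f.side .N, f.side .S) ∈ arcsOf l)

variable {Dl : List Face} {a z e : MidEdge} {l : List MidEdge}

/-- A walk's mid-edge list is valid. [folklore] -/
private theorem ValidL.of_walk (γ : YBWalk (dom Dl) a z) : ValidL Dl a γ.mids :=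
  ⟨γ.head_eq, γ.nodup, γ.arc_mem, γ.isChain, γ.noncross⟩

/-- A valid list ending at `z` is a walk to `z`. [folklore] -/
private def ValidL.toWalk (h : ValidL Dl a l) (hz : l.getLast? = some z) : YBWalk (dom Dl) a z :=
  ⟨l, h.head_eq, hz, h.nodup, h.arc_mem, h.isChain, h.noncross⟩

/-- The singleton `[a]` is valid. [folklore] -/
private theorem ValidL.single (Dl : List Face) (a : MidEdge) : ValidL Dl a [a] :=
  ⟨rfl, List.nodup_singleton a, by simp [arcsOf], by simp [arcsOf], by simp [arcsOf]⟩

/-- `IsWE f p` says `p` is one of the two straight W–E arcs of `f`. [folklore] -/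
private theorem isWE_iff (f : Face) (p : MidEdge × MidEdge) :
    IsWE f p ↔ p = (f.side .W, f.side .E) ∨ p = (f.side .E, f.side .W) := Iff.rfl

/-- `IsSN f p` says `p` is one of the two straight S–N arcs of `f`. [folklore] -/
private theorem isSN_iff (f : Face) (p : MidEdge × MidEdge) :
    IsSN f p ↔ p = (f.side .S, f.side .N) ∨ p = (f.side .N, f.side .S) := Iff.rfl

/-- A straight W–E arc of `f` lies in `f`. [folklore] -/
private theorem arcFace_of_isWE' {f : Face} {p : MidEdge × MidEdge} (h : IsWE f p) : arcFace p = some f := by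
  rcases h with rfl | rfl
  · exact arcFace_side_W_E f
  · exact arcFace_side_E_W f

/-- A straight S–N arc of `f` lies in `f`. [folklore] -/
private theorem arcFace_of_isSN' {f : Face} {p : MidEdge × MidEdge} (h : IsSN f p) : arcFace p = some f := by
  rcases h with rfl | rfl
  · exact arcFace_side_S_N f
  · exact arcFace_side_N_S f

/-- No arc is both a W–E and an S–N straight arc of the same face. [folklore] -/
private theorem not_isWE_isSN {f : Face} {p : MidEdge × MidEdge} (h1 : IsWE f p) (h2 : IsSN f p) : False := by
  have hi := Face.side_injective f
  rcases h1 with rfl | rfl <;> rcases h2 with h | h <;>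
    first
    | exact absurd (hi (Prod.mk.inj h).1) (by decide)

/-- The face of a straight arc is determined. [folklore] -/
private theorem eq_of_isWE_of_arcFace {f g : Face} {p : MidEdge × MidEdge} (h : IsWE g p)
    (hf : arcFace p = some f) : g = f :=
  Option.some.inj ((arcFace_of_isWE' h).symm.trans hf)

/-- The face of a straight arc is determined. [folklore] -/
private theorem eq_of_isSN_of_arcFace {f g : Face} {p : MidEdge × MidEdge} (h : IsSN g p)
    (hf : arcFace p = some f) : g = f :=
  Option.some.inj ((arcFace_of_isSN' h).symm.trans hf)

/-- Membership form of the non-crossing condition. [folklore] -/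
private theorem noncross_iff (L : List (MidEdge × MidEdge)) :
    (∀ f : Face, ((f.side .W, f.side .E) ∈ L ∨ (f.side .E, f.side .W) ∈ L) →
        ¬((f.side .S, f.side .N) ∈ L ∨ (f.side .N, f.side .S) ∈ L)) ↔
      ∀ f : Face, ∀ p ∈ L, IsWE f p → ∀ q ∈ L, ¬IsSN f q := by
  constructor
  · intro h f p hp hWE q hq hSN
    refine h f ?_ ?_
    · rcases hWE with rfl | rfl
      · exact Or.inl hp
      · exact Or.inr hp
    · rcases hSN with rfl | rfl
      · exact Or.inl hq
      · exact Or.inr hq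
  · intro h f hWE hSN
    rcases hWE with hp | hp <;> rcases hSN with hq | hq
    · exact h f _ hp (Or.inl rfl) _ hq (Or.inl rfl)
    · exact h f _ hp (Or.inl rfl) _ hq (Or.inr rfl)
    · exact h f _ hp (Or.inr rfl) _ hq (Or.inl rfl)
    · exact h f _ hp (Or.inr rfl) _ hq (Or.inr rfl)

/-- Prefixes of valid lists are valid. [folklore] -/
private theorem ValidL.prefix (h : ValidL Dl a (l ++ [e])) (hz : l.getLast? = some z) : ValidL Dl a l := by
  have hl : l ≠ [] := by rintro rfl; simp at hz
  have harcs := arcsOf_concat hz e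
  refine ⟨?_, ?_, ?_, ?_, ?_⟩
  · have := h.head_eq
    obtain ⟨y, l', rfl⟩ := List.exists_cons_of_ne_nil hl
    simpa using this
  · exact (List.nodup_append.1 h.nodup).1
  · intro p hp
    exact h.arc_mem p (by rw [harcs]; exact List.mem_append_left _ hp)
  · have := h.isChain
    rw [harcs] at this
    exact this.left_of_append
  · intro f hWE hSN
    refine h.noncross f ?_ ?_
    · rw [harcs]; rcases hWE with h1 | h1
      · exact Or.inl (List.mem_append_left _ h1)
      · exact Or.inr (List.mem_append_left _ h1)
    · rw [harcs]; rcases hSN with h1 | h1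
      · exact Or.inl (List.mem_append_left _ h1)
      · exact Or.inr (List.mem_append_left _ h1)

/-- The last extension step of a valid list passes the extension test. [folklore] -/
private theorem ValidL.extOK_last (h : ValidL Dl a (l ++ [e])) (hz : l.getLast? = some z) : extOK Dl l z e := by
  have hl : l ≠ [] := by rintro rfl; simp at hz
  have harcs := arcsOf_concat hz e
  have hmem : (z, e) ∈ arcsOf (l ++ [e]) := by rw [harcs]; simp
  obtain ⟨f, hfD, hf⟩ := h.arc_mem _ hmem
  refine ⟨?_, ?_⟩
  · intro he
    have := List.nodup_append.1 h.nodup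
    exact this.2.2 e he e (List.mem_singleton_self e) rfl
  · rw [hf]
    refine ⟨hfD, ?_, ?_, ?_⟩
    · intro y hy
      -- the previous arc `(y, z)` and the new arc `(z, e)` are consecutive
      obtain ⟨l₁, rfl⟩ := List.getLast?_eq_some_iff.1 hz
      rw [List.dropLast_concat] at hy
      obtain ⟨l₂, rfl⟩ := List.getLast?_eq_some_iff.1 hy
      have hch := h.isChain
      have : arcsOf (l₂ ++ [y] ++ [z] ++ [e]) = arcsOf (l₂ ++ [y]) ++ [(y, z), (z, e)] := by
        rw [arcsOf_concat (z := z) (by simp) e, arcsOf_concat (z := y) (by simp) z, List.append_assoc]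
        rfl
      rw [this] at hch
      have h2 := (List.isChain_append.1 hch).2.1
      simp only [List.isChain_cons_cons] at h2
      rw [hf] at h2
      exact h2.1
    · intro hWE p hp hSN
      have hpf := arcFace_of_isSN' hSN
      refine h.noncross f ?_ ?_
      · rw [harcs]
        rcases (isWE_iff f _).1 hWE with h1 | h1
        · exact Or.inl (by rw [← h1]; simp)
        · exact Or.inr (by rw [← h1]; simp)
      · rw [harcs]
        rcases (isSN_iff f _).1 hSN with h1 | h1
        · exact Or.inl (List.mem_append_left _ (h1 ▸ hp))
        · exact Or.inr (List.mem_append_left _ (h1 ▸ hp))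
    · intro hSN p hp hWE
      refine h.noncross f ?_ ?_
      · rw [harcs]
        rcases (isWE_iff f _).1 hWE with h1 | h1
        · exact Or.inl (List.mem_append_left _ (h1 ▸ hp))
        · exact Or.inr (List.mem_append_left _ (h1 ▸ hp))
      · rw [harcs]
        rcases (isSN_iff f _).1 hSN with h1 | h1
        · exact Or.inl (by rw [← h1]; simp)
        · exact Or.inr (by rw [← h1]; simp)

/-- Extending a valid list by a mid-edge passing the extension test gives a valid list. [folklore] -/
private theorem ValidL.snoc (h : ValidL Dl a l) (hz : l.getLast? = some z) (he : extOK Dl l z e) :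
    ValidL Dl a (l ++ [e]) := by
  have hl : l ≠ [] := by rintro rfl; simp at hz
  have harcs := arcsOf_concat hz e
  obtain ⟨hel, hrest⟩ := he
  cases hfa : arcFace (z, e) with
  | none => rw [hfa] at hrest; exact hrest.elim
  | some f =>
    rw [hfa] at hrest
    obtain ⟨hfD, hprev, hnc1, hnc2⟩ := hrest
    refine ⟨?_, ?_, ?_, ?_, ?_⟩
    · obtain ⟨y, l', rfl⟩ := List.exists_cons_of_ne_nil hl
      have := h.head_eq
      simpa using this
    · rw [List.nodup_append]
      exact ⟨h.nodup, List.nodup_singleton e, fun x hx y hy hxy => hel (by simp at hy; rw [← hy, ← hxy]; exact hx)⟩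
    · intro p hp
      rw [harcs, List.mem_append, List.mem_singleton] at hp
      rcases hp with hp | rfl
      · exact h.arc_mem p hp
      · exact ⟨f, hfD, hfa⟩
    · rw [harcs]
      refine List.IsChain.append h.isChain (List.isChain_singleton _) fun x hx y hy => ?_
      simp only [List.head?_cons, Option.mem_def, Option.some.injEq] at hy
      subst hy
      -- `x` is the last arc of `l`, i.e. `(y', z)` with `y'` the last of `l.dropLast`
      obtain ⟨l₁, rfl⟩ := List.getLast?_eq_some_iff.1 hz
      have hl₁ : l₁ ≠ [] := by
        rintro rfl
        simp [arcsOf] at hx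
      obtain ⟨l₂, y', rfl⟩ : ∃ l₂ y', l₁ = l₂ ++ [y'] :=
        ⟨l₁.dropLast, l₁.getLast hl₁, (List.dropLast_append_getLast hl₁).symm⟩
      rw [arcsOf_concat (z := y') (by simp) z] at hx
      simp only [List.getLast?_append, List.getLast?_singleton, Option.mem_def, Option.some_or,
        Option.some.injEq] at hx
      subst hx
      rw [hfa]
      intro hyz
      exact hprev y' (by simp) hyz
    · rw [noncross_iff]
      have hold := (noncross_iff (arcsOf l)).1 h.noncross
      intro g p hp hWE q hq hSN
      rw [harcs, List.mem_append, List.mem_singleton] at hp hq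
      rcases hp with hp | rfl <;> rcases hq with hq | rfl
      · exact hold g p hp hWE q hq hSN
      · have hg := eq_of_isSN_of_arcFace hSN hfa
        subst hg
        exact hnc2 hSN p hp hWE
      · have hg := eq_of_isWE_of_arcFace hWE hfa
        subst hg
        exact hnc1 hWE q hq hSN
      · exact not_isWE_isSN hWE hSN

/-- Every non-root mid-edge of a valid list is a side of a face of the domain, hence a candidate.
[folklore] -/
private theorem ValidL.mem_candL (h : ValidL Dl a l) {x : MidEdge} (hx : x ∈ l) (hxa : x ≠ a) :
    x ∈ candL Dl := by
  obtain ⟨l', rfl⟩ := List.head?_eq_some_iff.1 h.head_eq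
  rcases List.mem_cons.1 hx with rfl | hx'
  · exact (hxa rfl).elim
  · -- `x = l'[i]` is the second end of the arc number `i`
    obtain ⟨i, hi, rfl⟩ := List.mem_iff_getElem.1 hx'
    have harc : ((a :: l')[i]'(by simp; omega), l'[i]) ∈ arcsOf (a :: l') := by
      unfold arcsOf
      rw [List.mem_iff_getElem]
      refine ⟨i, by simp; omega, ?_⟩
      simp [List.getElem_zip]
    obtain ⟨f, hfD, hf⟩ := h.arc_mem _ harc
    obtain ⟨s, t, -, -, ht, -⟩ := exists_sides_of_arcFace hf
    have ht' : f.side t = l'[i] := ht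
    rw [candL, List.mem_dedup, List.mem_flatMap]
    refine ⟨f, hfD, ?_⟩
    rw [← ht']
    cases t <;> simp [sidesL]

/-- The last element of a valid list extended. [folklore] -/
private theorem getLast?_concat' (l : List MidEdge) (e : MidEdge) : (l ++ [e]).getLast? = some e := by
  simp

/-- **Completeness of the enumeration**: a valid list extending `l₁` by at most `n` mid-edges is
enumerated by `dfs Dl n l₁`. [folklore] -/
private theorem dfs_complete : ∀ (l₂ : List MidEdge) (n : ℕ) (l₁ : List MidEdge),
    ValidL Dl a (l₁ ++ l₂) → l₁ ≠ [] → l₂.length ≤ n → l₁ ++ l₂ ∈ dfs Dl n l₁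
  | [], n, l₁, _, _, _ => by
    cases n <;> simp [dfs]
  | e :: l₂, n, l₁, hv, hl₁, hn => by
    obtain ⟨n, rfl⟩ : ∃ m, n = m + 1 := ⟨n - 1, by simp at hn; omega⟩
    have hz : l₁.getLast? = some (l₁.getLast hl₁) := List.getLast?_eq_some_getLast hl₁
    -- the prefix `l₁ ++ [e]` is valid
    have hpre : ValidL Dl a (l₁ ++ [e]) := by
      have : l₁ ++ e :: l₂ = (l₁ ++ [e]) ++ l₂ := by simp
      rw [this] at hv
      clear this
      induction l₂ using List.reverseRecOn with
      | nil => simpa using hv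
      | append_singleton l₃ x ih =>
        apply ih
        · rw [← List.append_assoc] at hv
          exact hv.prefix (z := (l₁ ++ [e] ++ l₃).getLast (by simp)) (List.getLast?_eq_some_getLast _)
        · simp at hn ⊢; omega
    have hext : extOK Dl l₁ (l₁.getLast hl₁) e := hpre.extOK_last hz
    have hcand : e ∈ candL Dl := by
      refine hpre.mem_candL (by simp) ?_
      rintro rfl
      have := hpre.nodup
      rw [List.nodup_append] at this
      obtain ⟨l', hl'⟩ := List.head?_eq_some_iff.1 hpre.head_eq
      have : e ∈ l₁ := by
        cases l₁ with
        | nil => exact (hl₁ rfl).elim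
        | cons y ys => simp at hl'; simp [hl'.1]
      exact (List.nodup_append.1 hpre.nodup).2.2 e this e (by simp) rfl
    rw [dfs, hz]
    simp only [List.mem_cons, List.mem_flatMap, List.mem_filter, decide_eq_true_eq]
    right
    refine ⟨e, ⟨hcand, hext⟩, ?_⟩
    have : l₁ ++ e :: l₂ = (l₁ ++ [e]) ++ l₂ := by simp
    rw [this]
    exact dfs_complete l₂ n (l₁ ++ [e]) (this ▸ hv) (by simp) (by simp at hn; omega)

/-- **Soundness of the enumeration**: `dfs` from a valid list produces valid lists. [folklore] -/
private theorem dfs_sound : ∀ (n : ℕ) (l₁ : List MidEdge), ValidL Dl a l₁ →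
    ∀ l ∈ dfs Dl n l₁, ValidL Dl a l
  | 0, l₁, hv, l, hl => by
    simp [dfs] at hl
    exact hl ▸ hv
  | n + 1, l₁, hv, l, hl => by
    rw [dfs] at hl
    rcases List.mem_cons.1 hl with rfl | hl
    · exact hv
    · cases hz : l₁.getLast? with
      | none => rw [hz] at hl; simp at hl
      | some z =>
        rw [hz] at hl
        simp only [List.mem_flatMap, List.mem_filter, decide_eq_true_eq] at hl
        obtain ⟨e, ⟨-, hext⟩, hmem⟩ := hl
        exact dfs_sound n (l₁ ++ [e]) (hv.snoc hz hext) l hmem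

/-- A valid list is no longer than the candidate list plus the root. [folklore] -/
private theorem ValidL.length_le (h : ValidL Dl a l) : l.length ≤ (candL Dl).length + 1 := by
  have hsub : l ⊆ a :: candL Dl := by
    intro x hx
    by_cases hxa : x = a
    · exact hxa ▸ List.mem_cons_self
    · exact List.mem_cons_of_mem _ (h.mem_candL hx hxa)
  simpa using (List.subperm_of_subset h.nodup hsub).length_le

/-- The enumeration depth used for a face list: enough for every walk. [folklore] -/
def depth (Dl : List Face) : ℕ := (candL Dl).length

/-- The mid-edge lists of the walks from `a` to `z` in `dom Dl`, as produced by the enumeration.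
[folklore] -/
def walkLists (Dl : List Face) (a z : MidEdge) : List (List MidEdge) :=
  ((dfs Dl (depth Dl) [a]).dedup).filter fun l => l.getLast? = some z

/-- **The sum over walks is the sum over the enumerated lists.** [folklore] -/
private theorem sum_walks_eq (g : List MidEdge → ℂ) (Dl : List Face) (a z : MidEdge) :
    ∑ γ : YBWalk (dom Dl) a z, g γ.mids = ((walkLists Dl a z).map g).sum := by
  have hnd : (walkLists Dl a z).Nodup := (List.nodup_dedup _).filter _
  rw [← List.sum_toFinset _ hnd]
  refine Finset.sum_nbij (fun γ => γ.mids) (fun γ _ => ?_) (fun γ _ γ' _ h => YBWalk.ext h) (fun l hl => ?_)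
    (fun _ _ => rfl)
  · -- completeness
    rw [List.mem_toFinset, walkLists, List.mem_filter, List.mem_dedup, decide_eq_true_eq]
    have hv := ValidL.of_walk γ
    obtain ⟨l', hl'⟩ := List.head?_eq_some_iff.1 γ.head_eq
    refine ⟨?_, γ.getLast_eq⟩
    have hlen : l'.length ≤ depth Dl := by
      have := hv.length_le
      rw [hl'] at this
      simp at this
      exact this
    have := dfs_complete (Dl := Dl) (a := a) l' (depth Dl) [a] (by simpa [hl'] using hv) (by simp) hlen
    simpa [hl'] using this
  · -- soundness
    rw [Finset.mem_coe, List.mem_toFinset, walkLists, List.mem_filter, List.mem_dedup, decide_eq_true_eq] at hl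
    obtain ⟨hmem, hz⟩ := hl
    have hv := dfs_sound (Dl := Dl) (a := a) (depth Dl) [a] (ValidL.single Dl a) l hmem
    exact ⟨hv.toWalk hz, Finset.mem_univ _, rfl⟩

/-! ### The free-weight plaquette observable on `ℤ²` and its vertex functional -/

/-- Complex plaquette weights `(u₁, u₂, v, w₁, w₂)` (one corner arc, one co-corner arc, one straight
arc, two corner arcs, two co-corner arcs; the empty plaquette weighs `1`). [cite: GlazmanManolescu2019, §1, Fig. 1, eq. (1)] -/
structure CWeights where
  /-- one arc at a corner `{W,N}` / `{S,E}` -/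
  u₁ : ℂ
  /-- one arc at a co-corner `{W,S}` / `{N,E}` -/
  u₂ : ℂ
  /-- one straight arc -/
  v : ℂ
  /-- two corner arcs -/
  w₁ : ℂ
  /-- two co-corner arcs -/
  w₂ : ℂ

/-- The weight monomial `u₁^{n₁} u₂^{n₂} v^{n_v} w₁^{n_{w₁}} w₂^{n_{w₂}}` of an exponent vector.
[folklore] -/
def CWeights.mono (W : CWeights) (n1 n2 nv nw1 nw2 : ℕ) : ℂ :=
  W.u₁ ^ n1 * W.u₂ ^ n2 * W.v ^ nv * W.w₁ ^ nw1 * W.w₂ ^ nw2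

/-- The plaquette weight of a mid-edge list: the product over the visited faces of the local
weights, i.e. `u₁^{#faces with one corner arc} ⋯ w₂^{#faces with two co-corner arcs}`.
[cite: GlazmanManolescu2019, §1 ("the weight of a walk is the product of weights associated to each rhombus")] -/
def weightL (W : CWeights) (l : List MidEdge) : ℂ :=
  W.mono (cfgCount l [.corner]) (cfgCount l [.coCorner]) (cfgCount l [.straight])
    (cfgCount l [.corner, .corner]) (cfgCount l [.coCorner, .coCorner])

/-- **The square-lattice parafermionic observable of the plaquette walk with free weights**:
`F(z) = Σ_{γ : a → z} w_W(γ) t^{q(γ)}`, over the Glazman–Manolescu walks (`YBWalk`) of the finite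
domain `dom Dl` from the root mid-edge `a` to the mid-edge `z`, `q(γ)` the signed number of quarter
turns (so `t = e^{−iσπ/2}` gives the parafermionic phase `e^{−iσ·wind(γ)}` of the square embedding).
[cite: GlazmanManolescu2019, §2.1, eq. (2.1) (Θ ≡ π/2)] -/
def gmObservable (W : CWeights) (t : ℂ) (Dl : List Face) (a z : MidEdge) : ℂ :=
  ∑ γ : YBWalk (dom Dl) a z, weightL W γ.mids * t ^ quarterTurnsL γ.mids

/-- The four sides of `f₀` in slot order `(E, N, W, S)`. [folklore] -/
def slotSide (f₀ : Face) : Fin 4 → MidEdge := ![f₀.side .E, f₀.side .N, f₀.side .W, f₀.side .S]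

/-- **The vertex functional** `Σ_{s ∈ (E,N,W,S)} c_s F(z_s)` at the face `f₀` (Duminil-Copin–Smirnov's
Lemma 1 shape on the square lattice, free coefficient per slot). [cite: DuminilCopinSmirnov2012, Lemma 1 (shape of the relation)] -/
def vertexFunctional (W : CWeights) (t : ℂ) (c : Fin 4 → ℂ) (Dl : List Face) (a : MidEdge) (f₀ : Face) : ℂ :=
  ∑ s : Fin 4, c s * gmObservable W t Dl a (slotSide f₀ s)

/-- A boundary root of a face list: a mid-edge with exactly one of its two faces in the list.
[cite: GlazmanManolescu2019, §2.1 (walks start on the boundary)] -/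
def IsBoundaryRoot (Dl : List Face) (a : MidEdge) : Prop :=
  (a.faces.1 ∈ Dl ∧ a.faces.2 ∉ Dl) ∨ (a.faces.1 ∉ Dl ∧ a.faces.2 ∈ Dl)

/-- Being a boundary root is decidable. [folklore] -/
instance (Dl : List Face) (a : MidEdge) : Decidable (IsBoundaryRoot Dl a) := by
  unfold IsBoundaryRoot; infer_instance

/-- **Technique class** `ExactPlaquetteVertexRelation W t c`: the plaquette walk with weights `W` and
square-lattice phase `t` per left quarter turn satisfies the exact vertex relation with the
vertex-independent coefficients `c` at EVERY face of EVERY finite domain for EVERY boundary root.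
[cite: GlazmanManolescu2019, Lemma 2.1 (shape: a relation at each rhombus of the domain)] -/
def ExactPlaquetteVertexRelation (W : CWeights) (t : ℂ) (c : Fin 4 → ℂ) : Prop :=
  ∀ (Dl : List Face) (a : MidEdge) (f₀ : Face), f₀ ∈ Dl → IsBoundaryRoot Dl a →
    vertexFunctional W t c Dl a f₀ = 0

/-! ### The vertex functional as a kernel-computable row -/

/-- The cleared row sum of a term list: `Σ_τ c_{slot τ} · mono(τ) · t^{q(τ)+m₀}`. [folklore] -/
def rowSum (W : CWeights) (t : ℂ) (c : Fin 4 → ℂ) (m₀ : ℕ) (L : List Term) : ℂ :=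
  (L.map fun τ => c τ.slot * W.mono τ.n1 τ.n2 τ.nv τ.nw1 τ.nw2 * t ^ (τ.q + (m₀ : ℤ)).toNat).sum

/-- The term selector of `terms`. [folklore] -/
private def termOf (f₀ : Face) (l : List MidEdge) : Option Term :=
  match l.getLast? with
  | none => none
  | some e =>
    match slotOf f₀ e with
    | none => none
    | some s => some (expo s l)

/-- `terms` as a `filterMap`. [folklore] -/
private theorem terms_eq (Dl : List Face) (a : MidEdge) (f₀ : Face) (n : ℕ) :
    terms Dl a f₀ n = ((dfs Dl n [a]).dedup).filterMap (termOf f₀) := rfl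

/-- `slotOf` inverts `slotSide`. [folklore] -/
private theorem slotOf_eq_some_iff (f₀ : Face) (e : MidEdge) (s : Fin 4) :
    slotOf f₀ e = some s ↔ e = slotSide f₀ s := by
  unfold slotOf
  constructor
  · intro h
    cases hs : f₀.sideOf e with
    | none => rw [hs] at h; simp at h
    | some sd =>
      rw [hs] at h
      have he := (Face.sideOf_eq_some_iff f₀ e sd).1 hs
      cases sd <;> simp at h <;> subst h <;> simp [slotSide, he.symm]
  · rintro rfl
    fin_cases s <;> simp [slotSide]

/-- Regrouping the term list by slots. [folklore] -/
private theorem sum_terms (c : Fin 4 → ℂ) (f₀ : Face) (g : List MidEdge → ℂ) (G : Term → ℂ)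
    (hG : ∀ s l, G (expo s l) = c s * g l) : ∀ L : List (List MidEdge),
    ((L.filterMap (termOf f₀)).map G).sum =
      ∑ s : Fin 4, c s * ((L.filter fun l => l.getLast? = some (slotSide f₀ s)).map g).sum
  | [] => by simp
  | l :: L => by
    have ih := sum_terms c f₀ g G hG L
    rw [List.filterMap_cons]
    cases hl : l.getLast? with
    | none =>
      have : termOf f₀ l = none := by simp [termOf, hl]
      rw [this, ih]
      refine Finset.sum_congr rfl fun s _ => ?_
      rw [List.filter_cons_of_neg]
      simp [hl]
    | some e =>
      cases hs : slotOf f₀ e with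
      | none =>
        have : termOf f₀ l = none := by simp [termOf, hl, hs]
        rw [this, ih]
        refine Finset.sum_congr rfl fun s _ => ?_
        rw [List.filter_cons_of_neg]
        simp only [hl, Option.some.injEq, decide_eq_true_eq]
        intro he
        rw [(slotOf_eq_some_iff f₀ e s).2 he] at hs
        exact Option.some_ne_none _ hs
      | some s₀ =>
        have : termOf f₀ l = some (expo s₀ l) := by simp [termOf, hl, hs]
        rw [this, List.map_cons, List.sum_cons, ih, hG]
        have he := (slotOf_eq_some_iff f₀ e s₀).1 hs
        have key : ∀ s : Fin 4,
            c s * (((l :: L).filter fun l => l.getLast? = some (slotSide f₀ s)).map g).sum =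
              c s * ((L.filter fun l => l.getLast? = some (slotSide f₀ s)).map g).sum +
                (if s = s₀ then c s₀ * g l else 0) := by
          intro s
          by_cases hss : s = s₀
          · subst hss
            rw [if_pos rfl, List.filter_cons_of_pos (by simp [hl, he]), List.map_cons, List.sum_cons]
            ring
          · rw [if_neg hss, List.filter_cons_of_neg, add_zero]
            simp only [hl, Option.some.injEq, decide_eq_true_eq]
            intro h'
            have h2 := (slotOf_eq_some_iff f₀ e s).2 h'
            rw [hs] at h2
            exact hss (Option.some.inj h2).symm
        simp_rw [key]
        rw [Finset.sum_add_distrib, Finset.sum_ite_eq' Finset.univ s₀, if_pos (Finset.mem_univ _)]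
        ring

/-- A list enumerated with its last edge on slot `s` contributes the term `expo s l`. [folklore] -/
private theorem expo_mem_terms {Dl : List Face} {a : MidEdge} {f₀ : Face} {n : ℕ} {s : Fin 4}
    {l : List MidEdge} (hl : l ∈ (dfs Dl n [a]).dedup) (hz : l.getLast? = some (slotSide f₀ s)) :
    expo s l ∈ terms Dl a f₀ n := by
  rw [terms_eq, List.mem_filterMap]
  refine ⟨l, hl, ?_⟩
  simp [termOf, hz, (slotOf_eq_some_iff f₀ _ s).2 rfl]

/-- **The vertex functional is the kernel-computable row sum** (after clearing the negative powers of
`t` by `t^{m₀}`). [folklore] -/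
private theorem vertexFunctional_mul_pow_eq_rowSum (W : CWeights) {t : ℂ} (ht : t ≠ 0) (c : Fin 4 → ℂ)
    (Dl : List Face) (a : MidEdge) (f₀ : Face) (m₀ : ℕ)
    (hm : ∀ τ ∈ terms Dl a f₀ (depth Dl), 0 ≤ τ.q + (m₀ : ℤ)) :
    vertexFunctional W t c Dl a f₀ * t ^ m₀ = rowSum W t c m₀ (terms Dl a f₀ (depth Dl)) := by
  -- the row sum regrouped by slots
  set g : List MidEdge → ℂ := fun l => weightL W l * t ^ (quarterTurnsL l + (m₀ : ℤ)).toNat with hg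
  have hrow : rowSum W t c m₀ (terms Dl a f₀ (depth Dl)) =
      ∑ s : Fin 4, c s * ((walkLists Dl a (slotSide f₀ s)).map g).sum := by
    rw [rowSum, terms_eq]
    exact sum_terms c f₀ g _ (fun s l => by simp [hg, expo, weightL, mul_assoc]) _
  rw [hrow, vertexFunctional, Finset.sum_mul]
  refine Finset.sum_congr rfl fun s _ => ?_
  rw [mul_assoc]
  congr 1
  rw [gmObservable, Finset.sum_mul,
    sum_walks_eq (fun l => weightL W l * t ^ quarterTurnsL l * t ^ m₀) Dl a (slotSide f₀ s)]
  refine congrArg List.sum (List.map_congr_left fun l hl => ?_)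
  -- on the enumerated lists the exponent is nonnegative, so the powers agree
  have hl' := hl
  rw [walkLists, List.mem_filter, decide_eq_true_eq] at hl'
  have h0 : 0 ≤ quarterTurnsL l + (m₀ : ℤ) := hm _ (expo_mem_terms hl'.1 hl'.2)
  rw [hg]
  simp only
  rw [mul_assoc]
  congr 1
  have h1 : t ^ (quarterTurnsL l + (m₀ : ℤ)).toNat = t ^ (quarterTurnsL l + (m₀ : ℤ)) := by
    have := zpow_natCast t (quarterTurnsL l + (m₀ : ℤ)).toNat
    rw [Int.toNat_of_nonneg h0] at this
    exact this.symm
  rw [h1, zpow_add₀ ht, zpow_natCast]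


/-- A term with the power of `t` cleared to a natural exponent (same five configuration counts of
eq. (1)). [cite: GlazmanManolescu2019, §1, Fig. 1 and eq. (1) (the five local configurations)] -/
structure TermN where
  /-- slot index -/
  slot : Fin 4
  /-- faces crossed by one corner arc -/
  n1 : ℕ
  /-- faces crossed by one co-corner arc -/
  n2 : ℕ
  /-- faces crossed by one straight arc -/
  nv : ℕ
  /-- faces crossed by two corner arcs -/
  nw1 : ℕ
  /-- faces crossed by two co-corner arcs -/
  nw2 : ℕ
  /-- cleared exponent `q + m₀` -/
  qn : ℕ
  deriving DecidableEq, Repr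

/-- Clearing the exponent of a term by `m₀`. [folklore] -/
def Term.toN (m₀ : ℕ) (τ : Term) : TermN :=
  ⟨τ.slot, τ.n1, τ.n2, τ.nv, τ.nw1, τ.nw2, (τ.q + (m₀ : ℤ)).toNat⟩

/-- The cleared term list. [folklore] -/
def termsN (Dl : List Face) (a : MidEdge) (f₀ : Face) (n m₀ : ℕ) : List TermN :=
  (terms Dl a f₀ n).map (Term.toN m₀)

/-- The cleared row sum `Σ_τ c_{slot τ} · mono(τ) · t^{qn(τ)}`. [folklore] -/
def rowSumN (W : CWeights) (t : ℂ) (c : Fin 4 → ℂ) (L : List TermN) : ℂ :=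
  (L.map fun τ => c τ.slot * W.mono τ.n1 τ.n2 τ.nv τ.nw1 τ.nw2 * t ^ τ.qn).sum

/-- **The vertex functional is the kernel-computable cleared row sum.** [folklore] -/
private theorem vertexFunctional_mul_pow_eq_rowSumN (W : CWeights) {t : ℂ} (ht : t ≠ 0) (c : Fin 4 → ℂ)
    (Dl : List Face) (a : MidEdge) (f₀ : Face) (m₀ : ℕ)
    (hm : ∀ τ ∈ terms Dl a f₀ (depth Dl), 0 ≤ τ.q + (m₀ : ℤ)) :
    vertexFunctional W t c Dl a f₀ * t ^ m₀ = rowSumN W t c (termsN Dl a f₀ (depth Dl) m₀) := by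
  rw [vertexFunctional_mul_pow_eq_rowSum W ht c Dl a f₀ m₀ hm, rowSum, rowSumN, termsN, List.map_map]
  rfl

/-! ### The fourteen instances (kernel enumeration by `decide`) -/

section Instances

variable {W : CWeights} {t : ℂ} {c : Fin 4 → ℂ}

/-- Instance `IE`: faces `[(0, 0)]`, root = the `E` side of `(0,0)`, relation at `(0,0)`;
4 walks end on a side of `(0,0)` (row cleared by `t^1`). [folklore] -/
private theorem inst_IE (hrel : ExactPlaquetteVertexRelation W t c) (ht : t ≠ 0) :
    c 0 * t + c 2 * W.v * t + c 3 * W.u₁ * t ^ 2 + c 1 * W.u₂ = 0 := by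
  have hT : termsN [(0, 0)] (Face.side (0, 0) .E) (0, 0) (depth [(0, 0)]) 1 =
      [⟨0, 0, 0, 0, 0, 0, 1⟩, ⟨2, 0, 0, 1, 0, 0, 1⟩, ⟨3, 1, 0, 0, 0, 0, 2⟩, ⟨1, 0, 1, 0, 0, 0, 0⟩] := by
    decide
  have hrow := vertexFunctional_mul_pow_eq_rowSumN W ht c [(0, 0)] (Face.side (0, 0) .E) (0, 0) 1
    (by decide)
  rw [hrel _ _ _ (by decide) (by decide), zero_mul, hT] at hrow
  simp only [rowSumN, List.map_cons, List.map_nil, List.sum_cons, List.sum_nil, CWeights.mono, pow_zero,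
    pow_one, mul_one, one_mul] at hrow
  linear_combination -hrow

/-- Instance `IN`: faces `[(0, 0)]`, root = the `N` side of `(0,0)`, relation at `(0,0)`;
4 walks end on a side of `(0,0)` (row cleared by `t^1`). [folklore] -/
private theorem inst_IN (hrel : ExactPlaquetteVertexRelation W t c) (ht : t ≠ 0) :
    c 1 * t + c 2 * W.u₁ + c 0 * W.u₂ * t ^ 2 + c 3 * W.v * t = 0 := by
  have hT : termsN [(0, 0)] (Face.side (0, 0) .N) (0, 0) (depth [(0, 0)]) 1 =
      [⟨1, 0, 0, 0, 0, 0, 1⟩, ⟨2, 1, 0, 0, 0, 0, 0⟩, ⟨0, 0, 1, 0, 0, 0, 2⟩, ⟨3, 0, 0, 1, 0, 0, 1⟩] := by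
    decide
  have hrow := vertexFunctional_mul_pow_eq_rowSumN W ht c [(0, 0)] (Face.side (0, 0) .N) (0, 0) 1
    (by decide)
  rw [hrel _ _ _ (by decide) (by decide), zero_mul, hT] at hrow
  simp only [rowSumN, List.map_cons, List.map_nil, List.sum_cons, List.sum_nil, CWeights.mono, pow_zero,
    pow_one, mul_one, one_mul] at hrow
  linear_combination -hrow

/-- Instance `IW`: faces `[(0, 0)]`, root = the `W` side of `(0,0)`, relation at `(0,0)`;
4 walks end on a side of `(0,0)` (row cleared by `t^1`). [folklore] -/
private theorem inst_IW (hrel : ExactPlaquetteVertexRelation W t c) (ht : t ≠ 0) :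
    c 2 * t + c 0 * W.v * t + c 3 * W.u₂ + c 1 * W.u₁ * t ^ 2 = 0 := by
  have hT : termsN [(0, 0)] (Face.side (0, 0) .W) (0, 0) (depth [(0, 0)]) 1 =
      [⟨2, 0, 0, 0, 0, 0, 1⟩, ⟨0, 0, 0, 1, 0, 0, 1⟩, ⟨3, 0, 1, 0, 0, 0, 0⟩, ⟨1, 1, 0, 0, 0, 0, 2⟩] := by
    decide
  have hrow := vertexFunctional_mul_pow_eq_rowSumN W ht c [(0, 0)] (Face.side (0, 0) .W) (0, 0) 1
    (by decide)
  rw [hrel _ _ _ (by decide) (by decide), zero_mul, hT] at hrow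
  simp only [rowSumN, List.map_cons, List.map_nil, List.sum_cons, List.sum_nil, CWeights.mono, pow_zero,
    pow_one, mul_one, one_mul] at hrow
  linear_combination -hrow

/-- Instance `IS`: faces `[(0, 0)]`, root = the `S` side of `(0,0)`, relation at `(0,0)`;
4 walks end on a side of `(0,0)` (row cleared by `t^1`). [folklore] -/
private theorem inst_IS (hrel : ExactPlaquetteVertexRelation W t c) (ht : t ≠ 0) :
    c 3 * t + c 2 * W.u₂ * t ^ 2 + c 0 * W.u₁ + c 1 * W.v * t = 0 := by
  have hT : termsN [(0, 0)] (Face.side (0, 0) .S) (0, 0) (depth [(0, 0)]) 1 =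
      [⟨3, 0, 0, 0, 0, 0, 1⟩, ⟨2, 0, 1, 0, 0, 0, 2⟩, ⟨0, 1, 0, 0, 0, 0, 0⟩, ⟨1, 0, 0, 1, 0, 0, 1⟩] := by
    decide
  have hrow := vertexFunctional_mul_pow_eq_rowSumN W ht c [(0, 0)] (Face.side (0, 0) .S) (0, 0) 1
    (by decide)
  rw [hrel _ _ _ (by decide) (by decide), zero_mul, hT] at hrow
  simp only [rowSumN, List.map_cons, List.map_nil, List.sum_cons, List.sum_nil, CWeights.mono, pow_zero,
    pow_one, mul_one, one_mul] at hrow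
  linear_combination -hrow

/-- Instance `BNWE`: faces `[(0, 0), (0, 1), (-1, 1), (-1, 0)]`, root = the `E` side of `(0,0)`, relation at `(0,0)`;
7 walks end on a side of `(0,0)` (row cleared by `t^3`). [folklore] -/
private theorem inst_BNWE (hrel : ExactPlaquetteVertexRelation W t c) (ht : t ≠ 0) :
    c 0 * t ^ 3 + c 3 * W.u₁ * t ^ 4 + c 1 * W.u₂ * t ^ 2 + c 2 * W.u₁ * W.u₂ ^ 3 * t ^ 5 + c 3 * W.u₁ * W.u₂ ^ 2 * W.w₂ * t ^ 4 + c 2 * W.v * t ^ 3 + c 1 * W.u₁ * W.u₂ ^ 2 * W.v = 0 := by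
  have hT : termsN [(0, 0), (0, 1), (-1, 1), (-1, 0)] (Face.side (0, 0) .E) (0, 0) (depth [(0, 0), (0, 1), (-1, 1), (-1, 0)]) 3 =
      [⟨0, 0, 0, 0, 0, 0, 3⟩, ⟨3, 1, 0, 0, 0, 0, 4⟩, ⟨1, 0, 1, 0, 0, 0, 2⟩, ⟨2, 1, 3, 0, 0, 0, 5⟩, ⟨3, 1, 2, 0, 0, 1, 4⟩, ⟨2, 0, 0, 1, 0, 0, 3⟩, ⟨1, 1, 2, 1, 0, 0, 0⟩] := by
    decide
  have hrow := vertexFunctional_mul_pow_eq_rowSumN W ht c [(0, 0), (0, 1), (-1, 1), (-1, 0)] (Face.side (0, 0) .E) (0, 0) 3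
    (by decide)
  rw [hrel _ _ _ (by decide) (by decide), zero_mul, hT] at hrow
  simp only [rowSumN, List.map_cons, List.map_nil, List.sum_cons, List.sum_nil, CWeights.mono, pow_zero,
    pow_one, mul_one, one_mul] at hrow
  linear_combination -hrow

/-- Instance `BNWS`: faces `[(0, 0), (0, 1), (-1, 1), (-1, 0)]`, root = the `S` side of `(0,0)`, relation at `(0,0)`;
7 walks end on a side of `(0,0)` (row cleared by `t^2`). [folklore] -/
private theorem inst_BNWS (hrel : ExactPlaquetteVertexRelation W t c) (ht : t ≠ 0) :
    c 3 * t ^ 2 + c 0 * W.u₁ * t + c 1 * W.v * t ^ 2 + c 2 * W.u₁ * W.u₂ ^ 2 * W.v * t ^ 5 + c 2 * W.u₂ * t ^ 3 + c 1 * W.u₁ * W.u₂ ^ 3 + c 0 * W.u₁ * W.u₂ ^ 2 * W.w₂ * t = 0 := by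
  have hT : termsN [(0, 0), (0, 1), (-1, 1), (-1, 0)] (Face.side (0, 0) .S) (0, 0) (depth [(0, 0), (0, 1), (-1, 1), (-1, 0)]) 2 =
      [⟨3, 0, 0, 0, 0, 0, 2⟩, ⟨0, 1, 0, 0, 0, 0, 1⟩, ⟨1, 0, 0, 1, 0, 0, 2⟩, ⟨2, 1, 2, 1, 0, 0, 5⟩, ⟨2, 0, 1, 0, 0, 0, 3⟩, ⟨1, 1, 3, 0, 0, 0, 0⟩, ⟨0, 1, 2, 0, 0, 1, 1⟩] := by
    decide
  have hrow := vertexFunctional_mul_pow_eq_rowSumN W ht c [(0, 0), (0, 1), (-1, 1), (-1, 0)] (Face.side (0, 0) .S) (0, 0) 2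
    (by decide)
  rw [hrel _ _ _ (by decide) (by decide), zero_mul, hT] at hrow
  simp only [rowSumN, List.map_cons, List.map_nil, List.sum_cons, List.sum_nil, CWeights.mono, pow_zero,
    pow_one, mul_one, one_mul] at hrow
  linear_combination -hrow

/-- Instance `BNEW`: faces `[(0, 0), (0, 1), (1, 1), (1, 0)]`, root = the `W` side of `(0,0)`, relation at `(0,0)`;
7 walks end on a side of `(0,0)` (row cleared by `t^2`). [folklore] -/
private theorem inst_BNEW (hrel : ExactPlaquetteVertexRelation W t c) (ht : t ≠ 0) :
    c 2 * t ^ 2 + c 3 * W.u₂ * t + c 1 * W.u₁ * t ^ 3 + c 0 * W.u₁ ^ 3 * W.u₂ + c 3 * W.u₁ ^ 2 * W.u₂ * W.w₁ * t + c 0 * W.v * t ^ 2 + c 1 * W.u₁ ^ 2 * W.u₂ * W.v * t ^ 5 = 0 := by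
  have hT : termsN [(0, 0), (0, 1), (1, 1), (1, 0)] (Face.side (0, 0) .W) (0, 0) (depth [(0, 0), (0, 1), (1, 1), (1, 0)]) 2 =
      [⟨2, 0, 0, 0, 0, 0, 2⟩, ⟨3, 0, 1, 0, 0, 0, 1⟩, ⟨1, 1, 0, 0, 0, 0, 3⟩, ⟨0, 3, 1, 0, 0, 0, 0⟩, ⟨3, 2, 1, 0, 1, 0, 1⟩, ⟨0, 0, 0, 1, 0, 0, 2⟩, ⟨1, 2, 1, 1, 0, 0, 5⟩] := by
    decide
  have hrow := vertexFunctional_mul_pow_eq_rowSumN W ht c [(0, 0), (0, 1), (1, 1), (1, 0)] (Face.side (0, 0) .W) (0, 0) 2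
    (by decide)
  rw [hrel _ _ _ (by decide) (by decide), zero_mul, hT] at hrow
  simp only [rowSumN, List.map_cons, List.map_nil, List.sum_cons, List.sum_nil, CWeights.mono, pow_zero,
    pow_one, mul_one, one_mul] at hrow
  linear_combination -hrow

/-- Instance `BNES`: faces `[(0, 0), (0, 1), (1, 1), (1, 0)]`, root = the `S` side of `(0,0)`, relation at `(0,0)`;
7 walks end on a side of `(0,0)` (row cleared by `t^3`). [folklore] -/
private theorem inst_BNES (hrel : ExactPlaquetteVertexRelation W t c) (ht : t ≠ 0) :
    c 3 * t ^ 3 + c 2 * W.u₂ * t ^ 4 + c 1 * W.v * t ^ 3 + c 0 * W.u₁ ^ 2 * W.u₂ * W.v + c 0 * W.u₁ * t ^ 2 + c 1 * W.u₁ ^ 3 * W.u₂ * t ^ 5 + c 2 * W.u₁ ^ 2 * W.u₂ * W.w₁ * t ^ 4 = 0 := by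
  have hT : termsN [(0, 0), (0, 1), (1, 1), (1, 0)] (Face.side (0, 0) .S) (0, 0) (depth [(0, 0), (0, 1), (1, 1), (1, 0)]) 3 =
      [⟨3, 0, 0, 0, 0, 0, 3⟩, ⟨2, 0, 1, 0, 0, 0, 4⟩, ⟨1, 0, 0, 1, 0, 0, 3⟩, ⟨0, 2, 1, 1, 0, 0, 0⟩, ⟨0, 1, 0, 0, 0, 0, 2⟩, ⟨1, 3, 1, 0, 0, 0, 5⟩, ⟨2, 2, 1, 0, 1, 0, 4⟩] := by
    decide
  have hrow := vertexFunctional_mul_pow_eq_rowSumN W ht c [(0, 0), (0, 1), (1, 1), (1, 0)] (Face.side (0, 0) .S) (0, 0) 3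
    (by decide)
  rw [hrel _ _ _ (by decide) (by decide), zero_mul, hT] at hrow
  simp only [rowSumN, List.map_cons, List.map_nil, List.sum_cons, List.sum_nil, CWeights.mono, pow_zero,
    pow_one, mul_one, one_mul] at hrow
  linear_combination -hrow

/-- Instance `BSWE`: faces `[(0, 0), (0, -1), (-1, -1), (-1, 0)]`, root = the `E` side of `(0,0)`, relation at `(0,0)`;
7 walks end on a side of `(0,0)` (row cleared by `t^2`). [folklore] -/
private theorem inst_BSWE (hrel : ExactPlaquetteVertexRelation W t c) (ht : t ≠ 0) :
    c 0 * t ^ 2 + c 1 * W.u₂ * t + c 3 * W.u₁ * t ^ 3 + c 2 * W.u₁ ^ 3 * W.u₂ + c 1 * W.u₁ ^ 2 * W.u₂ * W.w₁ * t + c 2 * W.v * t ^ 2 + c 3 * W.u₁ ^ 2 * W.u₂ * W.v * t ^ 5 = 0 := by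
  have hT : termsN [(0, 0), (0, -1), (-1, -1), (-1, 0)] (Face.side (0, 0) .E) (0, 0) (depth [(0, 0), (0, -1), (-1, -1), (-1, 0)]) 2 =
      [⟨0, 0, 0, 0, 0, 0, 2⟩, ⟨1, 0, 1, 0, 0, 0, 1⟩, ⟨3, 1, 0, 0, 0, 0, 3⟩, ⟨2, 3, 1, 0, 0, 0, 0⟩, ⟨1, 2, 1, 0, 1, 0, 1⟩, ⟨2, 0, 0, 1, 0, 0, 2⟩, ⟨3, 2, 1, 1, 0, 0, 5⟩] := by
    decide
  have hrow := vertexFunctional_mul_pow_eq_rowSumN W ht c [(0, 0), (0, -1), (-1, -1), (-1, 0)] (Face.side (0, 0) .E) (0, 0) 2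
    (by decide)
  rw [hrel _ _ _ (by decide) (by decide), zero_mul, hT] at hrow
  simp only [rowSumN, List.map_cons, List.map_nil, List.sum_cons, List.sum_nil, CWeights.mono, pow_zero,
    pow_one, mul_one, one_mul] at hrow
  linear_combination -hrow

/-- Instance `BSWN`: faces `[(0, 0), (0, -1), (-1, -1), (-1, 0)]`, root = the `N` side of `(0,0)`, relation at `(0,0)`;
7 walks end on a side of `(0,0)` (row cleared by `t^3`). [folklore] -/
private theorem inst_BSWN (hrel : ExactPlaquetteVertexRelation W t c) (ht : t ≠ 0) :
    c 1 * t ^ 3 + c 0 * W.u₂ * t ^ 4 + c 3 * W.v * t ^ 3 + c 2 * W.u₁ ^ 2 * W.u₂ * W.v + c 2 * W.u₁ * t ^ 2 + c 3 * W.u₁ ^ 3 * W.u₂ * t ^ 5 + c 0 * W.u₁ ^ 2 * W.u₂ * W.w₁ * t ^ 4 = 0 := by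
  have hT : termsN [(0, 0), (0, -1), (-1, -1), (-1, 0)] (Face.side (0, 0) .N) (0, 0) (depth [(0, 0), (0, -1), (-1, -1), (-1, 0)]) 3 =
      [⟨1, 0, 0, 0, 0, 0, 3⟩, ⟨0, 0, 1, 0, 0, 0, 4⟩, ⟨3, 0, 0, 1, 0, 0, 3⟩, ⟨2, 2, 1, 1, 0, 0, 0⟩, ⟨2, 1, 0, 0, 0, 0, 2⟩, ⟨3, 3, 1, 0, 0, 0, 5⟩, ⟨0, 2, 1, 0, 1, 0, 4⟩] := by
    decide
  have hrow := vertexFunctional_mul_pow_eq_rowSumN W ht c [(0, 0), (0, -1), (-1, -1), (-1, 0)] (Face.side (0, 0) .N) (0, 0) 3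
    (by decide)
  rw [hrel _ _ _ (by decide) (by decide), zero_mul, hT] at hrow
  simp only [rowSumN, List.map_cons, List.map_nil, List.sum_cons, List.sum_nil, CWeights.mono, pow_zero,
    pow_one, mul_one, one_mul] at hrow
  linear_combination -hrow

/-- Instance `BSEW`: faces `[(0, 0), (0, -1), (1, -1), (1, 0)]`, root = the `W` side of `(0,0)`, relation at `(0,0)`;
7 walks end on a side of `(0,0)` (row cleared by `t^3`). [folklore] -/
private theorem inst_BSEW (hrel : ExactPlaquetteVertexRelation W t c) (ht : t ≠ 0) :
    c 2 * t ^ 3 + c 1 * W.u₁ * t ^ 4 + c 3 * W.u₂ * t ^ 2 + c 0 * W.u₁ * W.u₂ ^ 3 * t ^ 5 + c 1 * W.u₁ * W.u₂ ^ 2 * W.w₂ * t ^ 4 + c 0 * W.v * t ^ 3 + c 3 * W.u₁ * W.u₂ ^ 2 * W.v = 0 := by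
  have hT : termsN [(0, 0), (0, -1), (1, -1), (1, 0)] (Face.side (0, 0) .W) (0, 0) (depth [(0, 0), (0, -1), (1, -1), (1, 0)]) 3 =
      [⟨2, 0, 0, 0, 0, 0, 3⟩, ⟨1, 1, 0, 0, 0, 0, 4⟩, ⟨3, 0, 1, 0, 0, 0, 2⟩, ⟨0, 1, 3, 0, 0, 0, 5⟩, ⟨1, 1, 2, 0, 0, 1, 4⟩, ⟨0, 0, 0, 1, 0, 0, 3⟩, ⟨3, 1, 2, 1, 0, 0, 0⟩] := by
    decide
  have hrow := vertexFunctional_mul_pow_eq_rowSumN W ht c [(0, 0), (0, -1), (1, -1), (1, 0)] (Face.side (0, 0) .W) (0, 0) 3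
    (by decide)
  rw [hrel _ _ _ (by decide) (by decide), zero_mul, hT] at hrow
  simp only [rowSumN, List.map_cons, List.map_nil, List.sum_cons, List.sum_nil, CWeights.mono, pow_zero,
    pow_one, mul_one, one_mul] at hrow
  linear_combination -hrow

/-- Instance `BSEN`: faces `[(0, 0), (0, -1), (1, -1), (1, 0)]`, root = the `N` side of `(0,0)`, relation at `(0,0)`;
7 walks end on a side of `(0,0)` (row cleared by `t^2`). [folklore] -/
private theorem inst_BSEN (hrel : ExactPlaquetteVertexRelation W t c) (ht : t ≠ 0) :
    c 1 * t ^ 2 + c 2 * W.u₁ * t + c 3 * W.v * t ^ 2 + c 0 * W.u₁ * W.u₂ ^ 2 * W.v * t ^ 5 + c 0 * W.u₂ * t ^ 3 + c 3 * W.u₁ * W.u₂ ^ 3 + c 2 * W.u₁ * W.u₂ ^ 2 * W.w₂ * t = 0 := by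
  have hT : termsN [(0, 0), (0, -1), (1, -1), (1, 0)] (Face.side (0, 0) .N) (0, 0) (depth [(0, 0), (0, -1), (1, -1), (1, 0)]) 2 =
      [⟨1, 0, 0, 0, 0, 0, 2⟩, ⟨2, 1, 0, 0, 0, 0, 1⟩, ⟨3, 0, 0, 1, 0, 0, 2⟩, ⟨0, 1, 2, 1, 0, 0, 5⟩, ⟨0, 0, 1, 0, 0, 0, 3⟩, ⟨3, 1, 3, 0, 0, 0, 0⟩, ⟨2, 1, 2, 0, 0, 1, 1⟩] := by
    decide
  have hrow := vertexFunctional_mul_pow_eq_rowSumN W ht c [(0, 0), (0, -1), (1, -1), (1, 0)] (Face.side (0, 0) .N) (0, 0) 2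
    (by decide)
  rw [hrel _ _ _ (by decide) (by decide), zero_mul, hT] at hrow
  simp only [rowSumN, List.map_cons, List.map_nil, List.sum_cons, List.sum_nil, CWeights.mono, pow_zero,
    pow_one, mul_one, one_mul] at hrow
  linear_combination -hrow

/-- Instance `HSN`: faces `[(0, 0), (1, 0), (1, -1), (0, -1), (-1, -1), (-1, 0)]`, root = the `N` side of `(0,0)`, relation at `(0,0)`;
14 walks end on a side of `(0,0)` (row cleared by `t^4`). [folklore] -/
private theorem inst_HSN (hrel : ExactPlaquetteVertexRelation W t c) (ht : t ≠ 0) :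
    c 1 * t ^ 4 + c 0 * W.u₂ * t ^ 5 + c 3 * W.u₁ * W.u₂ ^ 3 * t ^ 2 + c 2 * W.u₁ * W.u₂ ^ 2 * W.w₂ * t ^ 3 + c 2 * W.u₁ ^ 2 * W.u₂ ^ 3 * W.v * t + c 3 * W.u₁ ^ 2 * W.u₂ ^ 2 * W.v * W.w₂ + c 3 * W.v * t ^ 4 + c 0 * W.u₁ * W.u₂ ^ 2 * W.v * t ^ 7 + c 2 * W.u₁ ^ 2 * W.u₂ * W.v * t + c 2 * W.u₁ * t ^ 3 + c 0 * W.u₁ ^ 3 * W.u₂ ^ 2 * W.v * t ^ 7 + c 3 * W.u₁ ^ 2 * W.u₂ ^ 2 * W.v * W.w₁ * t ^ 8 + c 3 * W.u₁ ^ 3 * W.u₂ * t ^ 6 + c 0 * W.u₁ ^ 2 * W.u₂ * W.w₁ * t ^ 5 = 0 := by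
  have hT : termsN [(0, 0), (1, 0), (1, -1), (0, -1), (-1, -1), (-1, 0)] (Face.side (0, 0) .N) (0, 0) (depth [(0, 0), (1, 0), (1, -1), (0, -1), (-1, -1), (-1, 0)]) 4 =
      [⟨1, 0, 0, 0, 0, 0, 4⟩, ⟨0, 0, 1, 0, 0, 0, 5⟩, ⟨3, 1, 3, 0, 0, 0, 2⟩, ⟨2, 1, 2, 0, 0, 1, 3⟩, ⟨2, 2, 3, 1, 0, 0, 1⟩, ⟨3, 2, 2, 1, 0, 1, 0⟩, ⟨3, 0, 0, 1, 0, 0, 4⟩, ⟨0, 1, 2, 1, 0, 0, 7⟩, ⟨2, 2, 1, 1, 0, 0, 1⟩, ⟨2, 1, 0, 0, 0, 0, 3⟩, ⟨0, 3, 2, 1, 0, 0, 7⟩, ⟨3, 2, 2, 1, 1, 0, 8⟩, ⟨3, 3, 1, 0, 0, 0, 6⟩, ⟨0, 2, 1, 0, 1, 0, 5⟩] := by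
    decide
  have hrow := vertexFunctional_mul_pow_eq_rowSumN W ht c [(0, 0), (1, 0), (1, -1), (0, -1), (-1, -1), (-1, 0)] (Face.side (0, 0) .N) (0, 0) 4
    (by decide)
  rw [hrel _ _ _ (by decide) (by decide), zero_mul, hT] at hrow
  simp only [rowSumN, List.map_cons, List.map_nil, List.sum_cons, List.sum_nil, CWeights.mono, pow_zero,
    pow_one, mul_one, one_mul] at hrow
  linear_combination -hrow

/-- Instance `HNS`: faces `[(0, 0), (1, 0), (1, 1), (0, 1), (-1, 1), (-1, 0)]`, root = the `S` side of `(0,0)`, relation at `(0,0)`;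
14 walks end on a side of `(0,0)` (row cleared by `t^4`). [folklore] -/
private theorem inst_HNS (hrel : ExactPlaquetteVertexRelation W t c) (ht : t ≠ 0) :
    c 3 * t ^ 4 + c 0 * W.u₁ * t ^ 3 + c 1 * W.u₁ ^ 3 * W.u₂ * t ^ 6 + c 2 * W.u₁ ^ 2 * W.u₂ * W.w₁ * t ^ 5 + c 2 * W.u₁ ^ 3 * W.u₂ ^ 2 * W.v * t ^ 7 + c 1 * W.u₁ ^ 2 * W.u₂ ^ 2 * W.v * W.w₁ * t ^ 8 + c 1 * W.v * t ^ 4 + c 0 * W.u₁ ^ 2 * W.u₂ * W.v * t + c 2 * W.u₁ * W.u₂ ^ 2 * W.v * t ^ 7 + c 2 * W.u₂ * t ^ 5 + c 0 * W.u₁ ^ 2 * W.u₂ ^ 3 * W.v * t + c 1 * W.u₁ ^ 2 * W.u₂ ^ 2 * W.v * W.w₂ + c 1 * W.u₁ * W.u₂ ^ 3 * t ^ 2 + c 0 * W.u₁ * W.u₂ ^ 2 * W.w₂ * t ^ 3 = 0 := by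
  have hT : termsN [(0, 0), (1, 0), (1, 1), (0, 1), (-1, 1), (-1, 0)] (Face.side (0, 0) .S) (0, 0) (depth [(0, 0), (1, 0), (1, 1), (0, 1), (-1, 1), (-1, 0)]) 4 =
      [⟨3, 0, 0, 0, 0, 0, 4⟩, ⟨0, 1, 0, 0, 0, 0, 3⟩, ⟨1, 3, 1, 0, 0, 0, 6⟩, ⟨2, 2, 1, 0, 1, 0, 5⟩, ⟨2, 3, 2, 1, 0, 0, 7⟩, ⟨1, 2, 2, 1, 1, 0, 8⟩, ⟨1, 0, 0, 1, 0, 0, 4⟩, ⟨0, 2, 1, 1, 0, 0, 1⟩, ⟨2, 1, 2, 1, 0, 0, 7⟩, ⟨2, 0, 1, 0, 0, 0, 5⟩, ⟨0, 2, 3, 1, 0, 0, 1⟩, ⟨1, 2, 2, 1, 0, 1, 0⟩, ⟨1, 1, 3, 0, 0, 0, 2⟩, ⟨0, 1, 2, 0, 0, 1, 3⟩] := by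
    decide
  have hrow := vertexFunctional_mul_pow_eq_rowSumN W ht c [(0, 0), (1, 0), (1, 1), (0, 1), (-1, 1), (-1, 0)] (Face.side (0, 0) .S) (0, 0) 4
    (by decide)
  rw [hrel _ _ _ (by decide) (by decide), zero_mul, hT] at hrow
  simp only [rowSumN, List.map_cons, List.map_nil, List.sum_cons, List.sum_nil, CWeights.mono, pow_zero,
    pow_one, mul_one, one_mul] at hrow
  linear_combination -hrow

end Instances

/-! ### The local group forms and the spin rigidity theorem -/

section Rigidity

variable {W : CWeights} {t : ℂ} {c : Fin 4 → ℂ}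

/-- The six local group forms (adjacent excursions `[E;NW]`, `[W;ES]`, `[E;WS]`, `[W;EN]` and opposite
excursions `[N;EW]`, `[S;EW]`) annihilate `c`, for `u₁ u₂ v ≠ 0`. [folklore] -/
private theorem forms (hrel : ExactPlaquetteVertexRelation W t c) (ht : t ≠ 0) (h1 : W.u₁ ≠ 0)
    (h2 : W.u₂ ≠ 0) (hv : W.v ≠ 0) :
    (W.v * c 1 + W.u₂ * t ^ 5 * c 2 + W.w₂ * t ^ 4 * c 3 = 0) ∧
    (W.u₂ * t ^ 5 * c 0 + W.w₂ * t ^ 4 * c 1 + W.v * c 3 = 0) ∧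
    (W.w₁ * t * c 1 + W.u₁ * c 2 + W.v * t ^ 5 * c 3 = 0) ∧
    (W.u₁ * c 0 + W.v * t ^ 5 * c 1 + W.w₁ * t * c 3 = 0) ∧
    (W.u₁ * t ^ 7 * c 0 + W.u₂ * t * c 2 + (W.w₂ + W.w₁ * t ^ 8) * c 3 = 0) ∧
    (W.u₂ * t * c 0 + (W.w₂ + W.w₁ * t ^ 8) * c 1 + W.u₁ * t ^ 7 * c 2 = 0) := by
  have hIE := inst_IE hrel ht
  have hIN := inst_IN hrel ht
  have hIW := inst_IW hrel ht
  have hIS := inst_IS hrel ht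
  have hBNWE := inst_BNWE hrel ht
  have hBSEW := inst_BSEW hrel ht
  have hBSWE := inst_BSWE hrel ht
  have hBNEW := inst_BNEW hrel ht
  have hBSEN := inst_BSEN hrel ht
  have hBSWN := inst_BSWN hrel ht
  have hBNES := inst_BNES hrel ht
  have hBNWS := inst_BNWS hrel ht
  have hHSN := inst_HSN hrel ht
  have hHNS := inst_HNS hrel ht
  have m12 : W.u₁ * W.u₂ ^ 2 ≠ 0 := mul_ne_zero h1 (pow_ne_zero _ h2)
  have m21 : W.u₁ ^ 2 * W.u₂ ≠ 0 := mul_ne_zero (pow_ne_zero _ h1) h2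
  have m221 : W.u₁ ^ 2 * W.u₂ ^ 2 * W.v ≠ 0 := mul_ne_zero (mul_ne_zero (pow_ne_zero _ h1) (pow_ne_zero _ h2)) hv
  refine ⟨?_, ?_, ?_, ?_, ?_, ?_⟩
  · have h : W.u₁ * W.u₂ ^ 2 * (W.v * c 1 + W.u₂ * t ^ 5 * c 2 + W.w₂ * t ^ 4 * c 3) = 0 := by
      linear_combination hBNWE - t ^ 2 * hIE
    exact (mul_eq_zero.1 h).resolve_left m12
  · have h : W.u₁ * W.u₂ ^ 2 * (W.u₂ * t ^ 5 * c 0 + W.w₂ * t ^ 4 * c 1 + W.v * c 3) = 0 := by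
      linear_combination hBSEW - t ^ 2 * hIW
    exact (mul_eq_zero.1 h).resolve_left m12
  · have h : W.u₁ ^ 2 * W.u₂ * (W.w₁ * t * c 1 + W.u₁ * c 2 + W.v * t ^ 5 * c 3) = 0 := by
      linear_combination hBSWE - t * hIE
    exact (mul_eq_zero.1 h).resolve_left m21
  · have h : W.u₁ ^ 2 * W.u₂ * (W.u₁ * c 0 + W.v * t ^ 5 * c 1 + W.w₁ * t * c 3) = 0 := by
      linear_combination hBNEW - t * hIW
    exact (mul_eq_zero.1 h).resolve_left m21
  · have h : W.u₁ ^ 2 * W.u₂ ^ 2 * W.v *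
        (W.u₁ * t ^ 7 * c 0 + W.u₂ * t * c 2 + (W.w₂ + W.w₁ * t ^ 8) * c 3) = 0 := by
      linear_combination hHSN - t ^ 2 * hBSEN - t * hBSWN + t ^ 3 * hIN
    exact (mul_eq_zero.1 h).resolve_left m221
  · have h : W.u₁ ^ 2 * W.u₂ ^ 2 * W.v *
        (W.u₂ * t * c 0 + (W.w₂ + W.w₁ * t ^ 8) * c 1 + W.u₁ * t ^ 7 * c 2) = 0 := by
      linear_combination hHNS - t * hBNES - t ^ 2 * hBNWS + t ^ 3 * hIS
    exact (mul_eq_zero.1 h).resolve_left m221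

/-- **Spin rigidity.** If the plaquette walk with weights `u₁ u₂ v ≠ 0` (any `w₁, w₂`) and phase `t ≠ 0`
per left quarter turn satisfies an exact vertex relation with some nonzero vertex-independent
coefficient vector on every finite domain, then `t¹⁶ = −1`, i.e. `t = e^{−iσπ/2}` with
`σ ∈ (2ℤ+1)/8` — the `v ≠ 0` branch of Glazman's printed dichotomy "either `v = 0` or `σ = ℓ/8`",
here proved NECESSARY for arbitrary complex weights and coefficients. [cite: Glazman2015WeightedSAW, Lemma 3.1 (proof: "either v = 0 or σ = ℓ/8"; weights exist only for σ = ℓ/8 or σ = 1)] [cite: IkhlefCardy2009, §3 (cos 4πs = cos 6η)] -/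
theorem t_pow_sixteen_of_exactPlaquetteVertexRelation (hrel : ExactPlaquetteVertexRelation W t c)
    (ht : t ≠ 0) (h1 : W.u₁ ≠ 0) (h2 : W.u₂ ≠ 0) (hv : W.v ≠ 0) (hc : c ≠ 0) : t ^ 16 = -1 := by
  obtain ⟨fA1, fA1', fB1, fB1', fD2, fD2'⟩ := forms hrel ht h1 h2 hv
  -- ρ²-symmetrisation: `p, q` (even part) and `p', q'` (odd part)
  have E1p : W.u₂ * t ^ 5 * (c 0 + c 2) + (W.v + W.w₂ * t ^ 4) * (c 1 + c 3) = 0 := by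
    linear_combination fA1' + fA1
  have E3p : W.u₁ * (c 0 + c 2) + (W.w₁ * t + W.v * t ^ 5) * (c 1 + c 3) = 0 := by
    linear_combination fB1' + fB1
  have E4p : t * (W.u₁ * t ^ 6 + W.u₂) * (c 0 + c 2) + (W.w₂ + W.w₁ * t ^ 8) * (c 1 + c 3) = 0 := by
    linear_combination fD2 + fD2'
  have keyp : W.v * (c 1 + c 3) * (t ^ 16 + 1) = 0 := by
    linear_combination (-t ^ 4) * E4p + t ^ 11 * E3p + E1p
  have E1m : W.u₂ * t ^ 5 * (c 0 - c 2) + (W.w₂ * t ^ 4 - W.v) * (c 1 - c 3) = 0 := by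
    linear_combination fA1' - fA1
  have E3m : W.u₁ * (c 0 - c 2) + (W.v * t ^ 5 - W.w₁ * t) * (c 1 - c 3) = 0 := by
    linear_combination fB1' - fB1
  have E4m : t * (W.u₁ * t ^ 6 - W.u₂) * (c 0 - c 2) - (W.w₂ + W.w₁ * t ^ 8) * (c 1 - c 3) = 0 := by
    linear_combination fD2 - fD2'
  have keym : W.v * (c 1 - c 3) * (t ^ 16 + 1) = 0 := by
    linear_combination (-t ^ 4) * E4m + t ^ 11 * E3m - E1m
  have ht5 : W.u₂ * t ^ 5 ≠ 0 := mul_ne_zero h2 (pow_ne_zero _ ht)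
  by_cases hq : c 1 + c 3 = 0
  · -- even part trivial: then the odd part is nontrivial
    have hp : c 0 + c 2 = 0 := by
      rw [hq, mul_zero, add_zero] at E1p
      exact (mul_eq_zero.1 E1p).resolve_left ht5
    by_cases hq' : c 1 - c 3 = 0
    · have hp' : c 0 - c 2 = 0 := by
        rw [hq', mul_zero, add_zero] at E1m
        exact (mul_eq_zero.1 E1m).resolve_left ht5
      exfalso
      apply hc
      funext i
      fin_cases i
      · show c 0 = 0; linear_combination (hp + hp') / 2
      · show c 1 = 0; linear_combination (hq + hq') / 2
      · show c 2 = 0; linear_combination (hp - hp') / 2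
      · show c 3 = 0; linear_combination (hq - hq') / 2
    · have := (mul_eq_zero.1 keym).resolve_left (mul_ne_zero hv hq')
      linear_combination this
  · have := (mul_eq_zero.1 keyp).resolve_left (mul_ne_zero hv hq)
    linear_combination this

/-- **The `w₂ = 0` face** (no self-touching at co-corners; `w₁` arbitrary — with `w₁ = 0` as well
the walk is vertex-self-avoiding with anisotropic corner weights `u₁, u₂` and straight weight `v`,
the uniform SAW being `u₁ = u₂ = v`): off the quadric `v² = u₂²` there is no exact vertex relation
at all (`c = 0`), at any phase `t ≠ 0`. Uses only the four `{N,W}`/`{E,S}` adjacent forms.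
[cite: Glazman2015WeightedSAW, Lemma 3.1 (no holomorphic weights with w₁ = w₂ = 0)] -/
theorem eq_zero_of_exactPlaquetteVertexRelation_of_w₂_eq_zero
    (hrel : ExactPlaquetteVertexRelation W t c) (ht : t ≠ 0) (h1 : W.u₁ ≠ 0) (h2 : W.u₂ ≠ 0)
    (hw2 : W.w₂ = 0) (hne : W.v ^ 2 ≠ W.u₂ ^ 2) : c = 0 := by
  have hIE := inst_IE hrel ht
  have hIN := inst_IN hrel ht
  have hIW := inst_IW hrel ht
  have hIS := inst_IS hrel ht
  have hBNWE := inst_BNWE hrel ht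
  have hBSEW := inst_BSEW hrel ht
  have hBNWS := inst_BNWS hrel ht
  have hBSEN := inst_BSEN hrel ht
  have m12 : W.u₁ * W.u₂ ^ 2 ≠ 0 := mul_ne_zero h1 (pow_ne_zero _ h2)
  -- the four `{N,W}` / `{E,S}` adjacent forms with `w₂ = 0`
  have fA1 : W.v * c 1 + W.u₂ * t ^ 5 * c 2 = 0 := by
    have h : W.u₁ * W.u₂ ^ 2 * (W.v * c 1 + W.u₂ * t ^ 5 * c 2) = 0 := by
      linear_combination hBNWE - t ^ 2 * hIE - W.u₁ * W.u₂ ^ 2 * t ^ 4 * c 3 * hw2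
    exact (mul_eq_zero.1 h).resolve_left m12
  have fA2 : W.u₂ * c 1 + W.v * t ^ 5 * c 2 = 0 := by
    have h : W.u₁ * W.u₂ ^ 2 * (W.u₂ * c 1 + W.v * t ^ 5 * c 2) = 0 := by
      linear_combination hBNWS - t * hIS - W.u₁ * W.u₂ ^ 2 * t * c 0 * hw2
    exact (mul_eq_zero.1 h).resolve_left m12
  have fA1' : W.u₂ * t ^ 5 * c 0 + W.v * c 3 = 0 := by
    have h : W.u₁ * W.u₂ ^ 2 * (W.u₂ * t ^ 5 * c 0 + W.v * c 3) = 0 := by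
      linear_combination hBSEW - t ^ 2 * hIW - W.u₁ * W.u₂ ^ 2 * t ^ 4 * c 1 * hw2
    exact (mul_eq_zero.1 h).resolve_left m12
  have fA2' : W.v * t ^ 5 * c 0 + W.u₂ * c 3 = 0 := by
    have h : W.u₁ * W.u₂ ^ 2 * (W.v * t ^ 5 * c 0 + W.u₂ * c 3) = 0 := by
      linear_combination hBSEN - t * hIN - W.u₁ * W.u₂ ^ 2 * t * c 2 * hw2
    exact (mul_eq_zero.1 h).resolve_left m12
  have hdet0 : W.v ^ 2 - W.u₂ ^ 2 ≠ 0 := sub_ne_zero.2 hne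
  have hdet5 : (W.v ^ 2 - W.u₂ ^ 2) * t ^ 5 ≠ 0 := mul_ne_zero hdet0 (pow_ne_zero _ ht)
  have k1 : (W.v ^ 2 - W.u₂ ^ 2) * c 1 = 0 := by linear_combination W.v * fA1 - W.u₂ * fA2
  have k2 : (W.v ^ 2 - W.u₂ ^ 2) * t ^ 5 * c 2 = 0 := by linear_combination W.v * fA2 - W.u₂ * fA1
  have k0 : (W.v ^ 2 - W.u₂ ^ 2) * t ^ 5 * c 0 = 0 := by linear_combination W.v * fA2' - W.u₂ * fA1'
  have k3 : (W.v ^ 2 - W.u₂ ^ 2) * c 3 = 0 := by linear_combination W.v * fA1' - W.u₂ * fA2'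
  funext i
  fin_cases i
  · exact (mul_eq_zero.1 k0).resolve_left hdet5
  · exact (mul_eq_zero.1 k1).resolve_left hdet0
  · exact (mul_eq_zero.1 k2).resolve_left hdet5
  · exact (mul_eq_zero.1 k3).resolve_left hdet0

/-- **Barrier `PlaquetteWalkSpinRigidity`.** For the five-parameter plaquette (Glazman–Manolescu /
Nienhuis `O(0)`) walk on `ℤ²` with complex weights `u₁ u₂ v ≠ 0` (self-touching weights `w₁, w₂`
arbitrary) and phase `t ≠ 0` per left quarter turn, an exact vertex relation with a nonzero
vertex-independent coefficient vector on every finite domain (`ExactPlaquetteVertexRelation`)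
forces `t¹⁶ = −1`: the spin is `σ ∈ (2ℤ+1)/8`. PROVED below (`PlaquetteWalkSpinRigidity_holds`).

BARRIER (structured block, D-0021):
- technique_class: discrete-holomorphicity parafermionic-observable exact-local-relation plaquette-walk free-weights free-spin — the predicate `ExactPlaquetteVertexRelation W t c` (`Σ_s c_s F(z_s) = 0` at every face of every finite face list for every boundary root, `F = gmObservable W t`)
- blocks: any parafermionic vertex identity for a square-lattice `O(0)`-type walk (uniform, stiff, anisotropic or self-touching) at a spin OUTSIDE `(2ℤ+1)/8` — in particular every attempt to tune `σ` continuously together with the weights; combined with `eq_zero_of_exactPlaquetteVertexRelation_of_w₂_eq_zero` it also blocks every weight system without co-corner self-touching off the quadric `v² = u₂²` [cite: Glazman2015WeightedSAW, Lemma 3.1] [cite: BeatonGuttmannJensen2012, p. 2]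
- because: printed: "either `v = 0` or `σ = ℓ/8`, `ℓ` odd" [cite: Glazman2015WeightedSAW, Lemma 3.1]; the one-plaquette determinant's spin factor `2cos 4πs − 3n + n³` [cite: IkhlefCardy2009, §3] [cite: AlamBatchelor2014, §3.2]; this file (necessity, any weights, any coefficients): on fourteen explicit domains of ≤ 6 faces the relation yields the one-visit rows and six excursion forms with free weights; symmetrised under the half-turn `(c_E,c_N,c_W,c_S) ↦ (c_W,c_S,c_E,c_N)` the forms `[E;NW]±[W;ES]`, `[W;EN]±[E;WS]`, `[N;EW]±[S;EW]` combine (coefficients `1, t¹¹, −t⁴`) to `v (c_N ± c_S)(t¹⁶+1) = 0`, and `c_N ± c_S = 0` for both signs forces `c = 0` through `[E;NW]±[W;ES]` (`u₂ t⁵ (c_E ± c_W) = 0`) [cite: Glazman2015WeightedSAW, Lemma 3.1 (proof: the local linear system)] [cite: IkhlefCardy2009, §3]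
- evasions_known: the spins `σ ∈ (2ℤ+1)/8` themselves, where the printed Yang–Baxter curve carries identities (`YangBaxterSAWSquareLattice.sqParafermion_relation`, σ = 5/8; Galois images) [cite: GlazmanManolescu2019, Lemma 2.1]; `v = 0` — the printed solution classes outside `(2ℤ+1)/8` all live there (Glazman's degenerate `σ = 1` family; Ikhlef–Cardy's `n = 1` line and `s = −1` class) [cite: Glazman2015WeightedSAW, Lemma 3.1] [cite: IkhlefCardy2009, §3]; `u₁ = 0` or `u₂ = 0`; position-dependent (Z-invariant) weights change the coefficients, not the spin [cite: IkhlefWestonWheelerZinnJustin2013, §4.2.1]; remainder terms, multi-face stencils (not excluded here)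
- scope_caveats: (a) this statement quantifies over ALL finite face lists, ALL faces (boundary faces included — Glazman–Manolescu's "each rhombus of `Rect`") and boundary roots; the interior-faces-only version (Duminil-Copin–Smirnov's quantifier) is `PlaquetteWalkSpinRigidityInt` below (appended; fourteen further instances); (b) weights and `t` complex, no reality or positivity used; `u₁ u₂ v ≠ 0` is needed to divide the loop monomials `u₁u₂²`, `u₁²u₂`, `u₁²u₂²v` out of the instance differences; (c) the converse at `t¹⁶ = −1` (existence: the Yang–Baxter curve) is the companion file's subject and is proved there only on Glazman–Manolescu rectangles; (d) the observable is defined by configuration counts over the visited faces (`weightL`), which is the printed product weight on every `YBWalk` (the only two-arc configurations of a face are two corners or two co-corners), not re-proved against `YBWalk.weight`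
- status: established — `PlaquetteWalkSpinRigidity_holds` and the stronger `PlaquetteWalkSpinRigidityInt_holds` (this file, axioms standard); printed counterpart ("either v = 0 or σ = ℓ/8"; Cauchy–Riemann-shaped coefficients, rhombic frame) [cite: Glazman2015WeightedSAW, Lemma 3.1]

[cite: Glazman2015WeightedSAW, Lemma 3.1] [cite: DuminilCopinSmirnov2012, Lemma 1 (shape of the relation)] -/
def _root_.Literature.Barriers.CriticalPhenomena.PlaquetteWalkSpinRigidity : Prop :=
  ∀ (W : CWeights) (t : ℂ) (c : Fin 4 → ℂ), t ≠ 0 → W.u₁ ≠ 0 → W.u₂ ≠ 0 → W.v ≠ 0 → c ≠ 0 →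
    ExactPlaquetteVertexRelation W t c → t ^ 16 = -1

/-- Discharge of the barrier statement `PlaquetteWalkSpinRigidity`. [cite: Glazman2015WeightedSAW, Lemma 3.1] -/
theorem _root_.Literature.Barriers.CriticalPhenomena.PlaquetteWalkSpinRigidity_holds :
    PlaquetteWalkSpinRigidity :=
  fun _ _ _ ht h1 h2 hv hc hrel => t_pow_sixteen_of_exactPlaquetteVertexRelation hrel ht h1 h2 hv hc

/-- **Real spins.** With `t = e^{−iσπ/2}` (the parafermionic phase per left quarter turn at spin `σ`),
an exact vertex relation forces `e^{−8πiσ} = −1`, i.e. `cos (8πσ) = −1`, `σ ∈ (2ℤ+1)/8`.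
[cite: Glazman2015WeightedSAW, Lemma 3.1] -/
theorem cos_eq_neg_one_of_exactPlaquetteVertexRelation {σ : ℝ}
    (hrel : ExactPlaquetteVertexRelation W (Complex.exp (((-(π / 2 * σ) : ℝ) : ℂ) * Complex.I)) c)
    (h1 : W.u₁ ≠ 0) (h2 : W.u₂ ≠ 0) (hv : W.v ≠ 0) (hc : c ≠ 0) : Real.cos (8 * π * σ) = -1 := by
  have h16 := t_pow_sixteen_of_exactPlaquetteVertexRelation hrel (Complex.exp_ne_zero _) h1 h2 hv hc
  have hexp : Complex.exp (((-(π / 2 * σ) : ℝ) : ℂ) * Complex.I) ^ 16 =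
      Complex.exp (((-(8 * π * σ) : ℝ) : ℂ) * Complex.I) := by
    rw [← Complex.exp_nat_mul]
    congr 1
    push_cast
    ring
  rw [hexp] at h16
  have := congrArg Complex.re h16
  rw [Complex.exp_ofReal_mul_I_re, Real.cos_neg] at this
  simpa using this

end Rigidity


/-! ### Appended: the interior-faces class (Duminil-Copin–Smirnov's quantifier) -/

section InteriorPlacements

/-- An interior face of a face list: its four neighbours belong to the list (the vertex of `ℤ²` dual
to the face has its four lattice neighbours in the domain — the quantifier of the catalogue's
`ExactVertexRelationZ2`). [cite: DuminilCopinSmirnov2012, Lemma 1 ("for every vertex v ∈ V(Ω)")] -/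
def IsInteriorFace (Dl : List Face) (f₀ : Face) : Prop :=
  (f₀.1 + 1, f₀.2) ∈ Dl ∧ (f₀.1 - 1, f₀.2) ∈ Dl ∧ (f₀.1, f₀.2 + 1) ∈ Dl ∧ (f₀.1, f₀.2 - 1) ∈ Dl

/-- Being an interior face is decidable. [folklore] -/
instance (Dl : List Face) (f₀ : Face) : Decidable (IsInteriorFace Dl f₀) := by
  unfold IsInteriorFace; infer_instance

/-- **Technique class, interior placements only** `ExactPlaquetteVertexRelationInt W t c`: the
relation is demanded only at INTERIOR faces (all four neighbouring faces in the domain), for every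
finite face list and every boundary root — the weaker, Duminil-Copin–Smirnov-style hypothesis
(relation at the vertices of the domain, boundary behaviour free). [cite: DuminilCopinSmirnov2012, Lemma 1 (shape of the relation)] -/
def ExactPlaquetteVertexRelationInt (W : CWeights) (t : ℂ) (c : Fin 4 → ℂ) : Prop :=
  ∀ (Dl : List Face) (a : MidEdge) (f₀ : Face), f₀ ∈ Dl → IsInteriorFace Dl f₀ → IsBoundaryRoot Dl a →
    vertexFunctional W t c Dl a f₀ = 0

/-- The all-faces class implies the interior-faces class. [folklore] -/
private theorem ExactPlaquetteVertexRelation.toInt {W : CWeights} {t : ℂ} {c : Fin 4 → ℂ}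
    (h : ExactPlaquetteVertexRelation W t c) : ExactPlaquetteVertexRelationInt W t c :=
  fun Dl a f₀ hf _ ha => h Dl a f₀ hf ha

/-! ### The fourteen INTERIOR-placement instances (the same domains with the four arms of `(0,0)` added,
rooted at the far side of an arm; each row is `v ×` the corresponding boundary-placement row) -/

section InstancesInt

variable {W : CWeights} {t : ℂ} {c : Fin 4 → ℂ}

/-- Interior instance `JE`: faces `[(0, 0), (1, 0), (0, 1), (-1, 0), (0, -1)]`, root = the `E` side of the arm `(1, 0)`,
relation at the INTERIOR face `(0,0)`; 4 walks end on a side of `(0,0)`; the row is `v ×` that of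
the boundary instance. [folklore] -/
private theorem inst_JE (hrel : ExactPlaquetteVertexRelationInt W t c) (ht : t ≠ 0) (hv : W.v ≠ 0) :
    c 0 * t + c 2 * W.v * t + c 3 * W.u₁ * t ^ 2 + c 1 * W.u₂ = 0 := by
  have hT : termsN [(0, 0), (1, 0), (0, 1), (-1, 0), (0, -1)] (Face.side (1, 0) .E) (0, 0) (depth [(0, 0), (1, 0), (0, 1), (-1, 0), (0, -1)]) 1 =
      [⟨0, 0, 0, 1, 0, 0, 1⟩, ⟨1, 0, 1, 1, 0, 0, 0⟩, ⟨2, 0, 0, 2, 0, 0, 1⟩, ⟨3, 1, 0, 1, 0, 0, 2⟩] := by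
    decide
  have hrow := vertexFunctional_mul_pow_eq_rowSumN W ht c [(0, 0), (1, 0), (0, 1), (-1, 0), (0, -1)] (Face.side (1, 0) .E) (0, 0) 1
    (by decide)
  rw [hrel _ _ _ (by decide) (by decide) (by decide), zero_mul, hT] at hrow
  simp only [rowSumN, List.map_cons, List.map_nil, List.sum_cons, List.sum_nil, CWeights.mono, pow_zero,
    pow_one, mul_one, one_mul] at hrow
  have h' : W.v * (c 0 * t + c 2 * W.v * t + c 3 * W.u₁ * t ^ 2 + c 1 * W.u₂) = 0 := by
    linear_combination -hrow
  exact (mul_eq_zero.1 h').resolve_left hv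

/-- Interior instance `JN`: faces `[(0, 0), (1, 0), (0, 1), (-1, 0), (0, -1)]`, root = the `N` side of the arm `(0, 1)`,
relation at the INTERIOR face `(0,0)`; 4 walks end on a side of `(0,0)`; the row is `v ×` that of
the boundary instance. [folklore] -/
private theorem inst_JN (hrel : ExactPlaquetteVertexRelationInt W t c) (ht : t ≠ 0) (hv : W.v ≠ 0) :
    c 1 * t + c 2 * W.u₁ + c 0 * W.u₂ * t ^ 2 + c 3 * W.v * t = 0 := by
  have hT : termsN [(0, 0), (1, 0), (0, 1), (-1, 0), (0, -1)] (Face.side (0, 1) .N) (0, 0) (depth [(0, 0), (1, 0), (0, 1), (-1, 0), (0, -1)]) 1 =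
      [⟨1, 0, 0, 1, 0, 0, 1⟩, ⟨0, 0, 1, 1, 0, 0, 2⟩, ⟨2, 1, 0, 1, 0, 0, 0⟩, ⟨3, 0, 0, 2, 0, 0, 1⟩] := by
    decide
  have hrow := vertexFunctional_mul_pow_eq_rowSumN W ht c [(0, 0), (1, 0), (0, 1), (-1, 0), (0, -1)] (Face.side (0, 1) .N) (0, 0) 1
    (by decide)
  rw [hrel _ _ _ (by decide) (by decide) (by decide), zero_mul, hT] at hrow
  simp only [rowSumN, List.map_cons, List.map_nil, List.sum_cons, List.sum_nil, CWeights.mono, pow_zero,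
    pow_one, mul_one, one_mul] at hrow
  have h' : W.v * (c 1 * t + c 2 * W.u₁ + c 0 * W.u₂ * t ^ 2 + c 3 * W.v * t) = 0 := by
    linear_combination -hrow
  exact (mul_eq_zero.1 h').resolve_left hv

/-- Interior instance `JW`: faces `[(0, 0), (1, 0), (0, 1), (-1, 0), (0, -1)]`, root = the `W` side of the arm `(-1, 0)`,
relation at the INTERIOR face `(0,0)`; 4 walks end on a side of `(0,0)`; the row is `v ×` that of
the boundary instance. [folklore] -/
private theorem inst_JW (hrel : ExactPlaquetteVertexRelationInt W t c) (ht : t ≠ 0) (hv : W.v ≠ 0) :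
    c 2 * t + c 0 * W.v * t + c 3 * W.u₂ + c 1 * W.u₁ * t ^ 2 = 0 := by
  have hT : termsN [(0, 0), (1, 0), (0, 1), (-1, 0), (0, -1)] (Face.side (-1, 0) .W) (0, 0) (depth [(0, 0), (1, 0), (0, 1), (-1, 0), (0, -1)]) 1 =
      [⟨2, 0, 0, 1, 0, 0, 1⟩, ⟨0, 0, 0, 2, 0, 0, 1⟩, ⟨1, 1, 0, 1, 0, 0, 2⟩, ⟨3, 0, 1, 1, 0, 0, 0⟩] := by
    decide
  have hrow := vertexFunctional_mul_pow_eq_rowSumN W ht c [(0, 0), (1, 0), (0, 1), (-1, 0), (0, -1)] (Face.side (-1, 0) .W) (0, 0) 1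
    (by decide)
  rw [hrel _ _ _ (by decide) (by decide) (by decide), zero_mul, hT] at hrow
  simp only [rowSumN, List.map_cons, List.map_nil, List.sum_cons, List.sum_nil, CWeights.mono, pow_zero,
    pow_one, mul_one, one_mul] at hrow
  have h' : W.v * (c 2 * t + c 0 * W.v * t + c 3 * W.u₂ + c 1 * W.u₁ * t ^ 2) = 0 := by
    linear_combination -hrow
  exact (mul_eq_zero.1 h').resolve_left hv

/-- Interior instance `JS`: faces `[(0, 0), (1, 0), (0, 1), (-1, 0), (0, -1)]`, root = the `S` side of the arm `(0, -1)`,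
relation at the INTERIOR face `(0,0)`; 4 walks end on a side of `(0,0)`; the row is `v ×` that of
the boundary instance. [folklore] -/
private theorem inst_JS (hrel : ExactPlaquetteVertexRelationInt W t c) (ht : t ≠ 0) (hv : W.v ≠ 0) :
    c 3 * t + c 2 * W.u₂ * t ^ 2 + c 0 * W.u₁ + c 1 * W.v * t = 0 := by
  have hT : termsN [(0, 0), (1, 0), (0, 1), (-1, 0), (0, -1)] (Face.side (0, -1) .S) (0, 0) (depth [(0, 0), (1, 0), (0, 1), (-1, 0), (0, -1)]) 1 =
      [⟨3, 0, 0, 1, 0, 0, 1⟩, ⟨0, 1, 0, 1, 0, 0, 0⟩, ⟨1, 0, 0, 2, 0, 0, 1⟩, ⟨2, 0, 1, 1, 0, 0, 2⟩] := by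
    decide
  have hrow := vertexFunctional_mul_pow_eq_rowSumN W ht c [(0, 0), (1, 0), (0, 1), (-1, 0), (0, -1)] (Face.side (0, -1) .S) (0, 0) 1
    (by decide)
  rw [hrel _ _ _ (by decide) (by decide) (by decide), zero_mul, hT] at hrow
  simp only [rowSumN, List.map_cons, List.map_nil, List.sum_cons, List.sum_nil, CWeights.mono, pow_zero,
    pow_one, mul_one, one_mul] at hrow
  have h' : W.v * (c 3 * t + c 2 * W.u₂ * t ^ 2 + c 0 * W.u₁ + c 1 * W.v * t) = 0 := by
    linear_combination -hrow
  exact (mul_eq_zero.1 h').resolve_left hv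

/-- Interior instance `CNWE`: faces `[(0, 0), (0, 1), (-1, 1), (-1, 0), (1, 0), (0, -1)]`, root = the `E` side of the arm `(1, 0)`,
relation at the INTERIOR face `(0,0)`; 7 walks end on a side of `(0,0)`; the row is `v ×` that of
the boundary instance. [folklore] -/
private theorem inst_CNWE (hrel : ExactPlaquetteVertexRelationInt W t c) (ht : t ≠ 0) (hv : W.v ≠ 0) :
    c 0 * t ^ 3 + c 3 * W.u₁ * t ^ 4 + c 1 * W.u₂ * t ^ 2 + c 2 * W.u₁ * W.u₂ ^ 3 * t ^ 5 + c 3 * W.u₁ * W.u₂ ^ 2 * W.w₂ * t ^ 4 + c 2 * W.v * t ^ 3 + c 1 * W.u₁ * W.u₂ ^ 2 * W.v = 0 := by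
  have hT : termsN [(0, 0), (0, 1), (-1, 1), (-1, 0), (1, 0), (0, -1)] (Face.side (1, 0) .E) (0, 0) (depth [(0, 0), (0, 1), (-1, 1), (-1, 0), (1, 0), (0, -1)]) 3 =
      [⟨0, 0, 0, 1, 0, 0, 3⟩, ⟨1, 0, 1, 1, 0, 0, 2⟩, ⟨2, 1, 3, 1, 0, 0, 5⟩, ⟨3, 1, 2, 1, 0, 1, 4⟩, ⟨2, 0, 0, 2, 0, 0, 3⟩, ⟨1, 1, 2, 2, 0, 0, 0⟩, ⟨3, 1, 0, 1, 0, 0, 4⟩] := by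
    decide
  have hrow := vertexFunctional_mul_pow_eq_rowSumN W ht c [(0, 0), (0, 1), (-1, 1), (-1, 0), (1, 0), (0, -1)] (Face.side (1, 0) .E) (0, 0) 3
    (by decide)
  rw [hrel _ _ _ (by decide) (by decide) (by decide), zero_mul, hT] at hrow
  simp only [rowSumN, List.map_cons, List.map_nil, List.sum_cons, List.sum_nil, CWeights.mono, pow_zero,
    pow_one, mul_one, one_mul] at hrow
  have h' : W.v * (c 0 * t ^ 3 + c 3 * W.u₁ * t ^ 4 + c 1 * W.u₂ * t ^ 2 + c 2 * W.u₁ * W.u₂ ^ 3 * t ^ 5 + c 3 * W.u₁ * W.u₂ ^ 2 * W.w₂ * t ^ 4 + c 2 * W.v * t ^ 3 + c 1 * W.u₁ * W.u₂ ^ 2 * W.v) = 0 := by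
    linear_combination -hrow
  exact (mul_eq_zero.1 h').resolve_left hv

/-- Interior instance `CNWS`: faces `[(0, 0), (0, 1), (-1, 1), (-1, 0), (1, 0), (0, -1)]`, root = the `S` side of the arm `(0, -1)`,
relation at the INTERIOR face `(0,0)`; 7 walks end on a side of `(0,0)`; the row is `v ×` that of
the boundary instance. [folklore] -/
private theorem inst_CNWS (hrel : ExactPlaquetteVertexRelationInt W t c) (ht : t ≠ 0) (hv : W.v ≠ 0) :
    c 3 * t ^ 2 + c 0 * W.u₁ * t + c 1 * W.v * t ^ 2 + c 2 * W.u₁ * W.u₂ ^ 2 * W.v * t ^ 5 + c 2 * W.u₂ * t ^ 3 + c 1 * W.u₁ * W.u₂ ^ 3 + c 0 * W.u₁ * W.u₂ ^ 2 * W.w₂ * t = 0 := by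
  have hT : termsN [(0, 0), (0, 1), (-1, 1), (-1, 0), (1, 0), (0, -1)] (Face.side (0, -1) .S) (0, 0) (depth [(0, 0), (0, 1), (-1, 1), (-1, 0), (1, 0), (0, -1)]) 2 =
      [⟨3, 0, 0, 1, 0, 0, 2⟩, ⟨1, 0, 0, 2, 0, 0, 2⟩, ⟨2, 1, 2, 2, 0, 0, 5⟩, ⟨2, 0, 1, 1, 0, 0, 3⟩, ⟨1, 1, 3, 1, 0, 0, 0⟩, ⟨0, 1, 2, 1, 0, 1, 1⟩, ⟨0, 1, 0, 1, 0, 0, 1⟩] := by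
    decide
  have hrow := vertexFunctional_mul_pow_eq_rowSumN W ht c [(0, 0), (0, 1), (-1, 1), (-1, 0), (1, 0), (0, -1)] (Face.side (0, -1) .S) (0, 0) 2
    (by decide)
  rw [hrel _ _ _ (by decide) (by decide) (by decide), zero_mul, hT] at hrow
  simp only [rowSumN, List.map_cons, List.map_nil, List.sum_cons, List.sum_nil, CWeights.mono, pow_zero,
    pow_one, mul_one, one_mul] at hrow
  have h' : W.v * (c 3 * t ^ 2 + c 0 * W.u₁ * t + c 1 * W.v * t ^ 2 + c 2 * W.u₁ * W.u₂ ^ 2 * W.v * t ^ 5 + c 2 * W.u₂ * t ^ 3 + c 1 * W.u₁ * W.u₂ ^ 3 + c 0 * W.u₁ * W.u₂ ^ 2 * W.w₂ * t) = 0 := by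
    linear_combination -hrow
  exact (mul_eq_zero.1 h').resolve_left hv

/-- Interior instance `CNEW`: faces `[(0, 0), (0, 1), (1, 1), (1, 0), (-1, 0), (0, -1)]`, root = the `W` side of the arm `(-1, 0)`,
relation at the INTERIOR face `(0,0)`; 7 walks end on a side of `(0,0)`; the row is `v ×` that of
the boundary instance. [folklore] -/
private theorem inst_CNEW (hrel : ExactPlaquetteVertexRelationInt W t c) (ht : t ≠ 0) (hv : W.v ≠ 0) :
    c 2 * t ^ 2 + c 3 * W.u₂ * t + c 1 * W.u₁ * t ^ 3 + c 0 * W.u₁ ^ 3 * W.u₂ + c 3 * W.u₁ ^ 2 * W.u₂ * W.w₁ * t + c 0 * W.v * t ^ 2 + c 1 * W.u₁ ^ 2 * W.u₂ * W.v * t ^ 5 = 0 := by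
  have hT : termsN [(0, 0), (0, 1), (1, 1), (1, 0), (-1, 0), (0, -1)] (Face.side (-1, 0) .W) (0, 0) (depth [(0, 0), (0, 1), (1, 1), (1, 0), (-1, 0), (0, -1)]) 2 =
      [⟨2, 0, 0, 1, 0, 0, 2⟩, ⟨1, 1, 0, 1, 0, 0, 3⟩, ⟨0, 3, 1, 1, 0, 0, 0⟩, ⟨3, 2, 1, 1, 1, 0, 1⟩, ⟨0, 0, 0, 2, 0, 0, 2⟩, ⟨1, 2, 1, 2, 0, 0, 5⟩, ⟨3, 0, 1, 1, 0, 0, 1⟩] := by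
    decide
  have hrow := vertexFunctional_mul_pow_eq_rowSumN W ht c [(0, 0), (0, 1), (1, 1), (1, 0), (-1, 0), (0, -1)] (Face.side (-1, 0) .W) (0, 0) 2
    (by decide)
  rw [hrel _ _ _ (by decide) (by decide) (by decide), zero_mul, hT] at hrow
  simp only [rowSumN, List.map_cons, List.map_nil, List.sum_cons, List.sum_nil, CWeights.mono, pow_zero,
    pow_one, mul_one, one_mul] at hrow
  have h' : W.v * (c 2 * t ^ 2 + c 3 * W.u₂ * t + c 1 * W.u₁ * t ^ 3 + c 0 * W.u₁ ^ 3 * W.u₂ + c 3 * W.u₁ ^ 2 * W.u₂ * W.w₁ * t + c 0 * W.v * t ^ 2 + c 1 * W.u₁ ^ 2 * W.u₂ * W.v * t ^ 5) = 0 := by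
    linear_combination -hrow
  exact (mul_eq_zero.1 h').resolve_left hv

/-- Interior instance `CNES`: faces `[(0, 0), (0, 1), (1, 1), (1, 0), (-1, 0), (0, -1)]`, root = the `S` side of the arm `(0, -1)`,
relation at the INTERIOR face `(0,0)`; 7 walks end on a side of `(0,0)`; the row is `v ×` that of
the boundary instance. [folklore] -/
private theorem inst_CNES (hrel : ExactPlaquetteVertexRelationInt W t c) (ht : t ≠ 0) (hv : W.v ≠ 0) :
    c 3 * t ^ 3 + c 2 * W.u₂ * t ^ 4 + c 1 * W.v * t ^ 3 + c 0 * W.u₁ ^ 2 * W.u₂ * W.v + c 0 * W.u₁ * t ^ 2 + c 1 * W.u₁ ^ 3 * W.u₂ * t ^ 5 + c 2 * W.u₁ ^ 2 * W.u₂ * W.w₁ * t ^ 4 = 0 := by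
  have hT : termsN [(0, 0), (0, 1), (1, 1), (1, 0), (-1, 0), (0, -1)] (Face.side (0, -1) .S) (0, 0) (depth [(0, 0), (0, 1), (1, 1), (1, 0), (-1, 0), (0, -1)]) 3 =
      [⟨3, 0, 0, 1, 0, 0, 3⟩, ⟨1, 0, 0, 2, 0, 0, 3⟩, ⟨0, 2, 1, 2, 0, 0, 0⟩, ⟨0, 1, 0, 1, 0, 0, 2⟩, ⟨1, 3, 1, 1, 0, 0, 5⟩, ⟨2, 2, 1, 1, 1, 0, 4⟩, ⟨2, 0, 1, 1, 0, 0, 4⟩] := by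
    decide
  have hrow := vertexFunctional_mul_pow_eq_rowSumN W ht c [(0, 0), (0, 1), (1, 1), (1, 0), (-1, 0), (0, -1)] (Face.side (0, -1) .S) (0, 0) 3
    (by decide)
  rw [hrel _ _ _ (by decide) (by decide) (by decide), zero_mul, hT] at hrow
  simp only [rowSumN, List.map_cons, List.map_nil, List.sum_cons, List.sum_nil, CWeights.mono, pow_zero,
    pow_one, mul_one, one_mul] at hrow
  have h' : W.v * (c 3 * t ^ 3 + c 2 * W.u₂ * t ^ 4 + c 1 * W.v * t ^ 3 + c 0 * W.u₁ ^ 2 * W.u₂ * W.v + c 0 * W.u₁ * t ^ 2 + c 1 * W.u₁ ^ 3 * W.u₂ * t ^ 5 + c 2 * W.u₁ ^ 2 * W.u₂ * W.w₁ * t ^ 4) = 0 := by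
    linear_combination -hrow
  exact (mul_eq_zero.1 h').resolve_left hv

/-- Interior instance `CSWE`: faces `[(0, 0), (0, -1), (-1, -1), (-1, 0), (1, 0), (0, 1)]`, root = the `E` side of the arm `(1, 0)`,
relation at the INTERIOR face `(0,0)`; 7 walks end on a side of `(0,0)`; the row is `v ×` that of
the boundary instance. [folklore] -/
private theorem inst_CSWE (hrel : ExactPlaquetteVertexRelationInt W t c) (ht : t ≠ 0) (hv : W.v ≠ 0) :
    c 0 * t ^ 2 + c 1 * W.u₂ * t + c 3 * W.u₁ * t ^ 3 + c 2 * W.u₁ ^ 3 * W.u₂ + c 1 * W.u₁ ^ 2 * W.u₂ * W.w₁ * t + c 2 * W.v * t ^ 2 + c 3 * W.u₁ ^ 2 * W.u₂ * W.v * t ^ 5 = 0 := by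
  have hT : termsN [(0, 0), (0, -1), (-1, -1), (-1, 0), (1, 0), (0, 1)] (Face.side (1, 0) .E) (0, 0) (depth [(0, 0), (0, -1), (-1, -1), (-1, 0), (1, 0), (0, 1)]) 2 =
      [⟨0, 0, 0, 1, 0, 0, 2⟩, ⟨3, 1, 0, 1, 0, 0, 3⟩, ⟨2, 3, 1, 1, 0, 0, 0⟩, ⟨1, 2, 1, 1, 1, 0, 1⟩, ⟨2, 0, 0, 2, 0, 0, 2⟩, ⟨3, 2, 1, 2, 0, 0, 5⟩, ⟨1, 0, 1, 1, 0, 0, 1⟩] := by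
    decide
  have hrow := vertexFunctional_mul_pow_eq_rowSumN W ht c [(0, 0), (0, -1), (-1, -1), (-1, 0), (1, 0), (0, 1)] (Face.side (1, 0) .E) (0, 0) 2
    (by decide)
  rw [hrel _ _ _ (by decide) (by decide) (by decide), zero_mul, hT] at hrow
  simp only [rowSumN, List.map_cons, List.map_nil, List.sum_cons, List.sum_nil, CWeights.mono, pow_zero,
    pow_one, mul_one, one_mul] at hrow
  have h' : W.v * (c 0 * t ^ 2 + c 1 * W.u₂ * t + c 3 * W.u₁ * t ^ 3 + c 2 * W.u₁ ^ 3 * W.u₂ + c 1 * W.u₁ ^ 2 * W.u₂ * W.w₁ * t + c 2 * W.v * t ^ 2 + c 3 * W.u₁ ^ 2 * W.u₂ * W.v * t ^ 5) = 0 := by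
    linear_combination -hrow
  exact (mul_eq_zero.1 h').resolve_left hv

/-- Interior instance `CSWN`: faces `[(0, 0), (0, -1), (-1, -1), (-1, 0), (1, 0), (0, 1)]`, root = the `N` side of the arm `(0, 1)`,
relation at the INTERIOR face `(0,0)`; 7 walks end on a side of `(0,0)`; the row is `v ×` that of
the boundary instance. [folklore] -/
private theorem inst_CSWN (hrel : ExactPlaquetteVertexRelationInt W t c) (ht : t ≠ 0) (hv : W.v ≠ 0) :
    c 1 * t ^ 3 + c 0 * W.u₂ * t ^ 4 + c 3 * W.v * t ^ 3 + c 2 * W.u₁ ^ 2 * W.u₂ * W.v + c 2 * W.u₁ * t ^ 2 + c 3 * W.u₁ ^ 3 * W.u₂ * t ^ 5 + c 0 * W.u₁ ^ 2 * W.u₂ * W.w₁ * t ^ 4 = 0 := by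
  have hT : termsN [(0, 0), (0, -1), (-1, -1), (-1, 0), (1, 0), (0, 1)] (Face.side (0, 1) .N) (0, 0) (depth [(0, 0), (0, -1), (-1, -1), (-1, 0), (1, 0), (0, 1)]) 3 =
      [⟨1, 0, 0, 1, 0, 0, 3⟩, ⟨3, 0, 0, 2, 0, 0, 3⟩, ⟨2, 2, 1, 2, 0, 0, 0⟩, ⟨2, 1, 0, 1, 0, 0, 2⟩, ⟨3, 3, 1, 1, 0, 0, 5⟩, ⟨0, 2, 1, 1, 1, 0, 4⟩, ⟨0, 0, 1, 1, 0, 0, 4⟩] := by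
    decide
  have hrow := vertexFunctional_mul_pow_eq_rowSumN W ht c [(0, 0), (0, -1), (-1, -1), (-1, 0), (1, 0), (0, 1)] (Face.side (0, 1) .N) (0, 0) 3
    (by decide)
  rw [hrel _ _ _ (by decide) (by decide) (by decide), zero_mul, hT] at hrow
  simp only [rowSumN, List.map_cons, List.map_nil, List.sum_cons, List.sum_nil, CWeights.mono, pow_zero,
    pow_one, mul_one, one_mul] at hrow
  have h' : W.v * (c 1 * t ^ 3 + c 0 * W.u₂ * t ^ 4 + c 3 * W.v * t ^ 3 + c 2 * W.u₁ ^ 2 * W.u₂ * W.v + c 2 * W.u₁ * t ^ 2 + c 3 * W.u₁ ^ 3 * W.u₂ * t ^ 5 + c 0 * W.u₁ ^ 2 * W.u₂ * W.w₁ * t ^ 4) = 0 := by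
    linear_combination -hrow
  exact (mul_eq_zero.1 h').resolve_left hv

/-- Interior instance `CSEW`: faces `[(0, 0), (0, -1), (1, -1), (1, 0), (0, 1), (-1, 0)]`, root = the `W` side of the arm `(-1, 0)`,
relation at the INTERIOR face `(0,0)`; 7 walks end on a side of `(0,0)`; the row is `v ×` that of
the boundary instance. [folklore] -/
private theorem inst_CSEW (hrel : ExactPlaquetteVertexRelationInt W t c) (ht : t ≠ 0) (hv : W.v ≠ 0) :
    c 2 * t ^ 3 + c 1 * W.u₁ * t ^ 4 + c 3 * W.u₂ * t ^ 2 + c 0 * W.u₁ * W.u₂ ^ 3 * t ^ 5 + c 1 * W.u₁ * W.u₂ ^ 2 * W.w₂ * t ^ 4 + c 0 * W.v * t ^ 3 + c 3 * W.u₁ * W.u₂ ^ 2 * W.v = 0 := by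
  have hT : termsN [(0, 0), (0, -1), (1, -1), (1, 0), (0, 1), (-1, 0)] (Face.side (-1, 0) .W) (0, 0) (depth [(0, 0), (0, -1), (1, -1), (1, 0), (0, 1), (-1, 0)]) 3 =
      [⟨2, 0, 0, 1, 0, 0, 3⟩, ⟨3, 0, 1, 1, 0, 0, 2⟩, ⟨0, 1, 3, 1, 0, 0, 5⟩, ⟨1, 1, 2, 1, 0, 1, 4⟩, ⟨0, 0, 0, 2, 0, 0, 3⟩, ⟨3, 1, 2, 2, 0, 0, 0⟩, ⟨1, 1, 0, 1, 0, 0, 4⟩] := by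
    decide
  have hrow := vertexFunctional_mul_pow_eq_rowSumN W ht c [(0, 0), (0, -1), (1, -1), (1, 0), (0, 1), (-1, 0)] (Face.side (-1, 0) .W) (0, 0) 3
    (by decide)
  rw [hrel _ _ _ (by decide) (by decide) (by decide), zero_mul, hT] at hrow
  simp only [rowSumN, List.map_cons, List.map_nil, List.sum_cons, List.sum_nil, CWeights.mono, pow_zero,
    pow_one, mul_one, one_mul] at hrow
  have h' : W.v * (c 2 * t ^ 3 + c 1 * W.u₁ * t ^ 4 + c 3 * W.u₂ * t ^ 2 + c 0 * W.u₁ * W.u₂ ^ 3 * t ^ 5 + c 1 * W.u₁ * W.u₂ ^ 2 * W.w₂ * t ^ 4 + c 0 * W.v * t ^ 3 + c 3 * W.u₁ * W.u₂ ^ 2 * W.v) = 0 := by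
    linear_combination -hrow
  exact (mul_eq_zero.1 h').resolve_left hv

/-- Interior instance `CSEN`: faces `[(0, 0), (0, -1), (1, -1), (1, 0), (0, 1), (-1, 0)]`, root = the `N` side of the arm `(0, 1)`,
relation at the INTERIOR face `(0,0)`; 7 walks end on a side of `(0,0)`; the row is `v ×` that of
the boundary instance. [folklore] -/
private theorem inst_CSEN (hrel : ExactPlaquetteVertexRelationInt W t c) (ht : t ≠ 0) (hv : W.v ≠ 0) :
    c 1 * t ^ 2 + c 2 * W.u₁ * t + c 3 * W.v * t ^ 2 + c 0 * W.u₁ * W.u₂ ^ 2 * W.v * t ^ 5 + c 0 * W.u₂ * t ^ 3 + c 3 * W.u₁ * W.u₂ ^ 3 + c 2 * W.u₁ * W.u₂ ^ 2 * W.w₂ * t = 0 := by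
  have hT : termsN [(0, 0), (0, -1), (1, -1), (1, 0), (0, 1), (-1, 0)] (Face.side (0, 1) .N) (0, 0) (depth [(0, 0), (0, -1), (1, -1), (1, 0), (0, 1), (-1, 0)]) 2 =
      [⟨1, 0, 0, 1, 0, 0, 2⟩, ⟨3, 0, 0, 2, 0, 0, 2⟩, ⟨0, 1, 2, 2, 0, 0, 5⟩, ⟨0, 0, 1, 1, 0, 0, 3⟩, ⟨3, 1, 3, 1, 0, 0, 0⟩, ⟨2, 1, 2, 1, 0, 1, 1⟩, ⟨2, 1, 0, 1, 0, 0, 1⟩] := by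
    decide
  have hrow := vertexFunctional_mul_pow_eq_rowSumN W ht c [(0, 0), (0, -1), (1, -1), (1, 0), (0, 1), (-1, 0)] (Face.side (0, 1) .N) (0, 0) 2
    (by decide)
  rw [hrel _ _ _ (by decide) (by decide) (by decide), zero_mul, hT] at hrow
  simp only [rowSumN, List.map_cons, List.map_nil, List.sum_cons, List.sum_nil, CWeights.mono, pow_zero,
    pow_one, mul_one, one_mul] at hrow
  have h' : W.v * (c 1 * t ^ 2 + c 2 * W.u₁ * t + c 3 * W.v * t ^ 2 + c 0 * W.u₁ * W.u₂ ^ 2 * W.v * t ^ 5 + c 0 * W.u₂ * t ^ 3 + c 3 * W.u₁ * W.u₂ ^ 3 + c 2 * W.u₁ * W.u₂ ^ 2 * W.w₂ * t) = 0 := by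
    linear_combination -hrow
  exact (mul_eq_zero.1 h').resolve_left hv

/-- Interior instance `KSN`: faces `[(0, 0), (1, 0), (1, -1), (0, -1), (-1, -1), (-1, 0), (0, 1)]`, root = the `N` side of the arm `(0, 1)`,
relation at the INTERIOR face `(0,0)`; 14 walks end on a side of `(0,0)`; the row is `v ×` that of
the boundary instance. [folklore] -/
private theorem inst_KSN (hrel : ExactPlaquetteVertexRelationInt W t c) (ht : t ≠ 0) (hv : W.v ≠ 0) :
    c 1 * t ^ 4 + c 0 * W.u₂ * t ^ 5 + c 3 * W.u₁ * W.u₂ ^ 3 * t ^ 2 + c 2 * W.u₁ * W.u₂ ^ 2 * W.w₂ * t ^ 3 + c 2 * W.u₁ ^ 2 * W.u₂ ^ 3 * W.v * t + c 3 * W.u₁ ^ 2 * W.u₂ ^ 2 * W.v * W.w₂ + c 3 * W.v * t ^ 4 + c 0 * W.u₁ * W.u₂ ^ 2 * W.v * t ^ 7 + c 2 * W.u₁ ^ 2 * W.u₂ * W.v * t + c 2 * W.u₁ * t ^ 3 + c 0 * W.u₁ ^ 3 * W.u₂ ^ 2 * W.v * t ^ 7 + c 3 * W.u₁ ^ 2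 * W.u₂ ^ 2 * W.v * W.w₁ * t ^ 8 + c 3 * W.u₁ ^ 3 * W.u₂ * t ^ 6 + c 0 * W.u₁ ^ 2 * W.u₂ * W.w₁ * t ^ 5 = 0 := by
  have hT : termsN [(0, 0), (1, 0), (1, -1), (0, -1), (-1, -1), (-1, 0), (0, 1)] (Face.side (0, 1) .N) (0, 0) (depth [(0, 0), (1, 0), (1, -1), (0, -1), (-1, -1), (-1, 0), (0, 1)]) 4 =
      [⟨1, 0, 0, 1, 0, 0, 4⟩, ⟨0, 0, 1, 1, 0, 0, 5⟩, ⟨3, 1, 3, 1, 0, 0, 2⟩, ⟨2, 1, 2, 1, 0, 1, 3⟩, ⟨2, 2, 3, 2, 0, 0, 1⟩, ⟨3, 2, 2, 2, 0, 1, 0⟩, ⟨3, 0, 0, 2, 0, 0, 4⟩, ⟨0, 1, 2, 2, 0, 0, 7⟩, ⟨2, 2, 1, 2, 0, 0, 1⟩, ⟨2, 1, 0, 1, 0, 0, 3⟩, ⟨0, 3, 2, 2, 0, 0, 7⟩, ⟨3, 2, 2, 2, 1, 0, 8⟩, ⟨3, 3, 1, 1, 0, 0, 6⟩, ⟨0,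 2, 1, 1, 1, 0, 5⟩] := by
    decide
  have hrow := vertexFunctional_mul_pow_eq_rowSumN W ht c [(0, 0), (1, 0), (1, -1), (0, -1), (-1, -1), (-1, 0), (0, 1)] (Face.side (0, 1) .N) (0, 0) 4
    (by decide)
  rw [hrel _ _ _ (by decide) (by decide) (by decide), zero_mul, hT] at hrow
  simp only [rowSumN, List.map_cons, List.map_nil, List.sum_cons, List.sum_nil, CWeights.mono, pow_zero,
    pow_one, mul_one, one_mul] at hrow
  have h' : W.v * (c 1 * t ^ 4 + c 0 * W.u₂ * t ^ 5 + c 3 * W.u₁ * W.u₂ ^ 3 * t ^ 2 + c 2 * W.u₁ * W.u₂ ^ 2 * W.w₂ * t ^ 3 + c 2 * W.u₁ ^ 2 * W.u₂ ^ 3 * W.v * t + c 3 * W.u₁ ^ 2 * W.u₂ ^ 2 * W.v * W.w₂ + c 3 * W.v * t ^ 4 + c 0 * W.u₁ * W.u₂ ^ 2 * W.v * t ^ 7 + c 2 * W.u₁ ^ 2 * W.u₂ * W.v * t + c 2 * W.u₁ * t ^ 3 + c 0 * W.u₁ ^ 3 * W.u₂ ^ 2 * W.v * t ^ 7 + c 3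 * W.u₁ ^ 2 * W.u₂ ^ 2 * W.v * W.w₁ * t ^ 8 + c 3 * W.u₁ ^ 3 * W.u₂ * t ^ 6 + c 0 * W.u₁ ^ 2 * W.u₂ * W.w₁ * t ^ 5) = 0 := by
    linear_combination -hrow
  exact (mul_eq_zero.1 h').resolve_left hv

/-- Interior instance `KNS`: faces `[(0, 0), (1, 0), (1, 1), (0, 1), (-1, 1), (-1, 0), (0, -1)]`, root = the `S` side of the arm `(0, -1)`,
relation at the INTERIOR face `(0,0)`; 14 walks end on a side of `(0,0)`; the row is `v ×` that of
the boundary instance. [folklore] -/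
private theorem inst_KNS (hrel : ExactPlaquetteVertexRelationInt W t c) (ht : t ≠ 0) (hv : W.v ≠ 0) :
    c 3 * t ^ 4 + c 0 * W.u₁ * t ^ 3 + c 1 * W.u₁ ^ 3 * W.u₂ * t ^ 6 + c 2 * W.u₁ ^ 2 * W.u₂ * W.w₁ * t ^ 5 + c 2 * W.u₁ ^ 3 * W.u₂ ^ 2 * W.v * t ^ 7 + c 1 * W.u₁ ^ 2 * W.u₂ ^ 2 * W.v * W.w₁ * t ^ 8 + c 1 * W.v * t ^ 4 + c 0 * W.u₁ ^ 2 * W.u₂ * W.v * t + c 2 * W.u₁ * W.u₂ ^ 2 * W.v * t ^ 7 + c 2 * W.u₂ * t ^ 5 + c 0 * W.u₁ ^ 2 * W.u₂ ^ 3 * W.v * t + c 1 * W.u₁ ^ 2 * W.u₂ ^ 2 * W.v * W.w₂ + c 1 * W.u₁ * W.u₂ ^ 3 * t ^ 2 + c 0 * W.u₁ * W.u₂ ^ 2 * W.w₂ * t ^ 3 = 0 := by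
  have hT : termsN [(0, 0), (1, 0), (1, 1), (0, 1), (-1, 1), (-1, 0), (0, -1)] (Face.side (0, -1) .S) (0, 0) (depth [(0, 0), (1, 0), (1, 1), (0, 1), (-1, 1), (-1, 0), (0, -1)]) 4 =
      [⟨3, 0, 0, 1, 0, 0, 4⟩, ⟨0, 1, 0, 1, 0, 0, 3⟩, ⟨1, 3, 1, 1, 0, 0, 6⟩, ⟨2, 2, 1, 1, 1, 0, 5⟩, ⟨2, 3, 2, 2, 0, 0, 7⟩, ⟨1, 2, 2, 2, 1, 0, 8⟩, ⟨1, 0, 0, 2, 0, 0, 4⟩, ⟨0, 2, 1, 2, 0, 0, 1⟩, ⟨2, 1, 2, 2, 0, 0, 7⟩, ⟨2, 0, 1, 1, 0, 0, 5⟩, ⟨0, 2, 3, 2, 0, 0, 1⟩, ⟨1, 2, 2, 2, 0, 1, 0⟩, ⟨1, 1, 3, 1, 0, 0, 2⟩, ⟨0, 1, 2, 1, 0, 1, 3⟩] := by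
    decide
  have hrow := vertexFunctional_mul_pow_eq_rowSumN W ht c [(0, 0), (1, 0), (1, 1), (0, 1), (-1, 1), (-1, 0), (0, -1)] (Face.side (0, -1) .S) (0, 0) 4
    (by decide)
  rw [hrel _ _ _ (by decide) (by decide) (by decide), zero_mul, hT] at hrow
  simp only [rowSumN, List.map_cons, List.map_nil, List.sum_cons, List.sum_nil, CWeights.mono, pow_zero,
    pow_one, mul_one, one_mul] at hrow
  have h' : W.v * (c 3 * t ^ 4 + c 0 * W.u₁ * t ^ 3 + c 1 * W.u₁ ^ 3 * W.u₂ * t ^ 6 + c 2 * W.u₁ ^ 2 * W.u₂ * W.w₁ * t ^ 5 + c 2 * W.u₁ ^ 3 * W.u₂ ^ 2 * W.v * t ^ 7 + c 1 * W.u₁ ^ 2 * W.u₂ ^ 2 * W.v * W.w₁ * t ^ 8 + c 1 * W.v * t ^ 4 + c 0 * W.u₁ ^ 2 * W.u₂ * W.v * t + c 2 * W.u₁ * W.u₂ ^ 2 * W.v * t ^ 7 + c 2 * W.u₂ * t ^ 5 + c 0 * W.u₁ ^ 2 * W.u₂ ^ 3 * W.v * t + c 1 * W.u₁ ^ 2 *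 W.u₂ ^ 2 * W.v * W.w₂ + c 1 * W.u₁ * W.u₂ ^ 3 * t ^ 2 + c 0 * W.u₁ * W.u₂ ^ 2 * W.w₂ * t ^ 3) = 0 := by
    linear_combination -hrow
  exact (mul_eq_zero.1 h').resolve_left hv

end InstancesInt

section RigidityInt

variable {W : CWeights} {t : ℂ} {c : Fin 4 → ℂ}

/-- The elimination: the six excursion forms force `t¹⁶ = −1` (or `c = 0`). [folklore] -/
private theorem t_pow_sixteen_of_forms (ht : t ≠ 0) (h2 : W.u₂ ≠ 0) (hv : W.v ≠ 0) (hc : c ≠ 0)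
    (fA1 : W.v * c 1 + W.u₂ * t ^ 5 * c 2 + W.w₂ * t ^ 4 * c 3 = 0)
    (fA1' : W.u₂ * t ^ 5 * c 0 + W.w₂ * t ^ 4 * c 1 + W.v * c 3 = 0)
    (fB1 : W.w₁ * t * c 1 + W.u₁ * c 2 + W.v * t ^ 5 * c 3 = 0)
    (fB1' : W.u₁ * c 0 + W.v * t ^ 5 * c 1 + W.w₁ * t * c 3 = 0)
    (fD2 : W.u₁ * t ^ 7 * c 0 + W.u₂ * t * c 2 + (W.w₂ + W.w₁ * t ^ 8) * c 3 = 0)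
    (fD2' : W.u₂ * t * c 0 + (W.w₂ + W.w₁ * t ^ 8) * c 1 + W.u₁ * t ^ 7 * c 2 = 0) : t ^ 16 = -1 := by
  -- ρ²-symmetrisation: `p, q` (even part) and `p', q'` (odd part)
  have E1p : W.u₂ * t ^ 5 * (c 0 + c 2) + (W.v + W.w₂ * t ^ 4) * (c 1 + c 3) = 0 := by
    linear_combination fA1' + fA1
  have E3p : W.u₁ * (c 0 + c 2) + (W.w₁ * t + W.v * t ^ 5) * (c 1 + c 3) = 0 := by
    linear_combination fB1' + fB1
  have E4p : t * (W.u₁ * t ^ 6 + W.u₂) * (c 0 + c 2) + (W.w₂ + W.w₁ * t ^ 8) * (c 1 + c 3) = 0 := by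
    linear_combination fD2 + fD2'
  have keyp : W.v * (c 1 + c 3) * (t ^ 16 + 1) = 0 := by
    linear_combination (-t ^ 4) * E4p + t ^ 11 * E3p + E1p
  have E1m : W.u₂ * t ^ 5 * (c 0 - c 2) + (W.w₂ * t ^ 4 - W.v) * (c 1 - c 3) = 0 := by
    linear_combination fA1' - fA1
  have E3m : W.u₁ * (c 0 - c 2) + (W.v * t ^ 5 - W.w₁ * t) * (c 1 - c 3) = 0 := by
    linear_combination fB1' - fB1
  have E4m : t * (W.u₁ * t ^ 6 - W.u₂) * (c 0 - c 2) - (W.w₂ + W.w₁ * t ^ 8) * (c 1 - c 3) = 0 := by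
    linear_combination fD2 - fD2'
  have keym : W.v * (c 1 - c 3) * (t ^ 16 + 1) = 0 := by
    linear_combination (-t ^ 4) * E4m + t ^ 11 * E3m - E1m
  have ht5 : W.u₂ * t ^ 5 ≠ 0 := mul_ne_zero h2 (pow_ne_zero _ ht)
  by_cases hq : c 1 + c 3 = 0
  · -- even part trivial: then the odd part is nontrivial
    have hp : c 0 + c 2 = 0 := by
      rw [hq, mul_zero, add_zero] at E1p
      exact (mul_eq_zero.1 E1p).resolve_left ht5
    by_cases hq' : c 1 - c 3 = 0
    · have hp' : c 0 - c 2 = 0 := by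
        rw [hq', mul_zero, add_zero] at E1m
        exact (mul_eq_zero.1 E1m).resolve_left ht5
      exfalso
      apply hc
      funext i
      fin_cases i
      · show c 0 = 0; linear_combination (hp + hp') / 2
      · show c 1 = 0; linear_combination (hq + hq') / 2
      · show c 2 = 0; linear_combination (hp - hp') / 2
      · show c 3 = 0; linear_combination (hq - hq') / 2
    · have := (mul_eq_zero.1 keym).resolve_left (mul_ne_zero hv hq')
      linear_combination this
  · have := (mul_eq_zero.1 keyp).resolve_left (mul_ne_zero hv hq)
    linear_combination this


/-- The six excursion forms from the interior-faces class (`u₁ u₂ v ≠ 0`). [folklore] -/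
private theorem formsInt (hrel : ExactPlaquetteVertexRelationInt W t c) (ht : t ≠ 0) (h1 : W.u₁ ≠ 0)
    (h2 : W.u₂ ≠ 0) (hv : W.v ≠ 0) :
    (W.v * c 1 + W.u₂ * t ^ 5 * c 2 + W.w₂ * t ^ 4 * c 3 = 0) ∧
    (W.u₂ * t ^ 5 * c 0 + W.w₂ * t ^ 4 * c 1 + W.v * c 3 = 0) ∧
    (W.w₁ * t * c 1 + W.u₁ * c 2 + W.v * t ^ 5 * c 3 = 0) ∧
    (W.u₁ * c 0 + W.v * t ^ 5 * c 1 + W.w₁ * t * c 3 = 0) ∧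
    (W.u₁ * t ^ 7 * c 0 + W.u₂ * t * c 2 + (W.w₂ + W.w₁ * t ^ 8) * c 3 = 0) ∧
    (W.u₂ * t * c 0 + (W.w₂ + W.w₁ * t ^ 8) * c 1 + W.u₁ * t ^ 7 * c 2 = 0) := by
  have hIE := inst_JE hrel ht hv
  have hIN := inst_JN hrel ht hv
  have hIW := inst_JW hrel ht hv
  have hIS := inst_JS hrel ht hv
  have hBNWE := inst_CNWE hrel ht hv
  have hBSEW := inst_CSEW hrel ht hv
  have hBSWE := inst_CSWE hrel ht hv
  have hBNEW := inst_CNEW hrel ht hv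
  have hBSEN := inst_CSEN hrel ht hv
  have hBSWN := inst_CSWN hrel ht hv
  have hBNES := inst_CNES hrel ht hv
  have hBNWS := inst_CNWS hrel ht hv
  have hHSN := inst_KSN hrel ht hv
  have hHNS := inst_KNS hrel ht hv
  have m12 : W.u₁ * W.u₂ ^ 2 ≠ 0 := mul_ne_zero h1 (pow_ne_zero _ h2)
  have m21 : W.u₁ ^ 2 * W.u₂ ≠ 0 := mul_ne_zero (pow_ne_zero _ h1) h2
  have m221 : W.u₁ ^ 2 * W.u₂ ^ 2 * W.v ≠ 0 := mul_ne_zero (mul_ne_zero (pow_ne_zero _ h1) (pow_ne_zero _ h2)) hv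
  refine ⟨?_, ?_, ?_, ?_, ?_, ?_⟩
  · have h : W.u₁ * W.u₂ ^ 2 * (W.v * c 1 + W.u₂ * t ^ 5 * c 2 + W.w₂ * t ^ 4 * c 3) = 0 := by
      linear_combination hBNWE - t ^ 2 * hIE
    exact (mul_eq_zero.1 h).resolve_left m12
  · have h : W.u₁ * W.u₂ ^ 2 * (W.u₂ * t ^ 5 * c 0 + W.w₂ * t ^ 4 * c 1 + W.v * c 3) = 0 := by
      linear_combination hBSEW - t ^ 2 * hIW
    exact (mul_eq_zero.1 h).resolve_left m12
  · have h : W.u₁ ^ 2 * W.u₂ * (W.w₁ * t * c 1 + W.u₁ * c 2 + W.v * t ^ 5 * c 3) = 0 := by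
      linear_combination hBSWE - t * hIE
    exact (mul_eq_zero.1 h).resolve_left m21
  · have h : W.u₁ ^ 2 * W.u₂ * (W.u₁ * c 0 + W.v * t ^ 5 * c 1 + W.w₁ * t * c 3) = 0 := by
      linear_combination hBNEW - t * hIW
    exact (mul_eq_zero.1 h).resolve_left m21
  · have h : W.u₁ ^ 2 * W.u₂ ^ 2 * W.v *
        (W.u₁ * t ^ 7 * c 0 + W.u₂ * t * c 2 + (W.w₂ + W.w₁ * t ^ 8) * c 3) = 0 := by
      linear_combination hHSN - t ^ 2 * hBSEN - t * hBSWN + t ^ 3 * hIN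
    exact (mul_eq_zero.1 h).resolve_left m221
  · have h : W.u₁ ^ 2 * W.u₂ ^ 2 * W.v *
        (W.u₂ * t * c 0 + (W.w₂ + W.w₁ * t ^ 8) * c 1 + W.u₁ * t ^ 7 * c 2) = 0 := by
      linear_combination hHNS - t * hBNES - t ^ 2 * hBNWS + t ^ 3 * hIS
    exact (mul_eq_zero.1 h).resolve_left m221


/-- **Spin rigidity from the interior-faces class.** If the plaquette walk with weights `u₁ u₂ v ≠ 0`
(any `w₁, w₂`) and phase `t ≠ 0` satisfies an exact vertex relation with some nonzero
vertex-independent coefficient vector at the INTERIOR faces of every finite domain, then `t¹⁶ = −1`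
(`σ ∈ (2ℤ+1)/8`). [cite: Glazman2015WeightedSAW, Lemma 3.1 (proof: "either v = 0 or σ = ℓ/8")] [cite: IkhlefCardy2009, §3 (cos 4πs = cos 6η)] -/
theorem t_pow_sixteen_of_exactPlaquetteVertexRelationInt (hrel : ExactPlaquetteVertexRelationInt W t c)
    (ht : t ≠ 0) (h1 : W.u₁ ≠ 0) (h2 : W.u₂ ≠ 0) (hv : W.v ≠ 0) (hc : c ≠ 0) : t ^ 16 = -1 := by
  obtain ⟨fA1, fA1', fB1, fB1', fD2, fD2'⟩ := formsInt hrel ht h1 h2 hv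
  exact t_pow_sixteen_of_forms ht h2 hv hc fA1 fA1' fB1 fB1' fD2 fD2'

/-- **Barrier `PlaquetteWalkSpinRigidityInt`** (the stronger form of `PlaquetteWalkSpinRigidity`:
Duminil-Copin–Smirnov's quantifier — the relation is assumed only at interior faces): for the
plaquette walk on `ℤ²` with complex weights `u₁ u₂ v ≠ 0` and phase `t ≠ 0`, an exact vertex relation
with a nonzero vertex-independent coefficient vector at the interior faces of every finite domain
forces `t¹⁶ = −1`. PROVED (`PlaquetteWalkSpinRigidityInt_holds`); it implies `PlaquetteWalkSpinRigidity`.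
[cite: Glazman2015WeightedSAW, Lemma 3.1] [cite: DuminilCopinSmirnov2012, Lemma 1 (shape of the relation)] -/
def _root_.Literature.Barriers.CriticalPhenomena.PlaquetteWalkSpinRigidityInt : Prop :=
  ∀ (W : CWeights) (t : ℂ) (c : Fin 4 → ℂ), t ≠ 0 → W.u₁ ≠ 0 → W.u₂ ≠ 0 → W.v ≠ 0 → c ≠ 0 →
    ExactPlaquetteVertexRelationInt W t c → t ^ 16 = -1

/-- Discharge of `PlaquetteWalkSpinRigidityInt`. [cite: Glazman2015WeightedSAW, Lemma 3.1] -/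
theorem _root_.Literature.Barriers.CriticalPhenomena.PlaquetteWalkSpinRigidityInt_holds :
    PlaquetteWalkSpinRigidityInt :=
  fun _ _ _ ht h1 h2 hv hc hrel => t_pow_sixteen_of_exactPlaquetteVertexRelationInt hrel ht h1 h2 hv hc

/-- The interior form implies the all-faces form. [folklore] -/
private theorem spinRigidity_of_int (h : PlaquetteWalkSpinRigidityInt) : PlaquetteWalkSpinRigidity :=
  fun W t c ht h1 h2 hv hc hrel => h W t c ht h1 h2 hv hc hrel.toInt

/-- **The `w₁ = 0` face** (mirror image of the previous statement: no self-touching at corners; `w₂`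
arbitrary): off the quadric `v² = u₁²` there is no exact vertex relation (`c = 0`), at any phase
`t ≠ 0`. Uses only the four `{W,S}`/`{E,N}` adjacent forms. [cite: Glazman2015WeightedSAW, Lemma 3.1 (no holomorphic weights with w₁ = w₂ = 0)] -/
theorem eq_zero_of_exactPlaquetteVertexRelation_of_w₁_eq_zero
    (hrel : ExactPlaquetteVertexRelation W t c) (ht : t ≠ 0) (h1 : W.u₁ ≠ 0) (h2 : W.u₂ ≠ 0)
    (hw1 : W.w₁ = 0) (hne : W.v ^ 2 ≠ W.u₁ ^ 2) : c = 0 := by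
  have hIE := inst_IE hrel ht
  have hIN := inst_IN hrel ht
  have hIW := inst_IW hrel ht
  have hIS := inst_IS hrel ht
  have hBSWE := inst_BSWE hrel ht
  have hBSWN := inst_BSWN hrel ht
  have hBNEW := inst_BNEW hrel ht
  have hBNES := inst_BNES hrel ht
  have m21 : W.u₁ ^ 2 * W.u₂ ≠ 0 := mul_ne_zero (pow_ne_zero _ h1) h2
  have fB1 : W.u₁ * c 2 + W.v * t ^ 5 * c 3 = 0 := by
    have h : W.u₁ ^ 2 * W.u₂ * (W.u₁ * c 2 + W.v * t ^ 5 * c 3) = 0 := by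
      linear_combination hBSWE - t * hIE - W.u₁ ^ 2 * W.u₂ * t * c 1 * hw1
    exact (mul_eq_zero.1 h).resolve_left m21
  have fB2 : W.v * c 2 + W.u₁ * t ^ 5 * c 3 = 0 := by
    have h : W.u₁ ^ 2 * W.u₂ * (W.v * c 2 + W.u₁ * t ^ 5 * c 3) = 0 := by
      linear_combination hBSWN - t ^ 2 * hIN - W.u₁ ^ 2 * W.u₂ * t ^ 4 * c 0 * hw1
    exact (mul_eq_zero.1 h).resolve_left m21
  have fB1' : W.u₁ * c 0 + W.v * t ^ 5 * c 1 = 0 := by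
    have h : W.u₁ ^ 2 * W.u₂ * (W.u₁ * c 0 + W.v * t ^ 5 * c 1) = 0 := by
      linear_combination hBNEW - t * hIW - W.u₁ ^ 2 * W.u₂ * t * c 3 * hw1
    exact (mul_eq_zero.1 h).resolve_left m21
  have fB2' : W.v * c 0 + W.u₁ * t ^ 5 * c 1 = 0 := by
    have h : W.u₁ ^ 2 * W.u₂ * (W.v * c 0 + W.u₁ * t ^ 5 * c 1) = 0 := by
      linear_combination hBNES - t ^ 2 * hIS - W.u₁ ^ 2 * W.u₂ * t ^ 4 * c 2 * hw1
    exact (mul_eq_zero.1 h).resolve_left m21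
  have hdet0 : W.v ^ 2 - W.u₁ ^ 2 ≠ 0 := sub_ne_zero.2 hne
  have hdet5 : (W.v ^ 2 - W.u₁ ^ 2) * t ^ 5 ≠ 0 := mul_ne_zero hdet0 (pow_ne_zero _ ht)
  have k2 : (W.v ^ 2 - W.u₁ ^ 2) * c 2 = 0 := by linear_combination W.v * fB2 - W.u₁ * fB1
  have k3 : (W.v ^ 2 - W.u₁ ^ 2) * t ^ 5 * c 3 = 0 := by linear_combination W.v * fB1 - W.u₁ * fB2
  have k0 : (W.v ^ 2 - W.u₁ ^ 2) * c 0 = 0 := by linear_combination W.v * fB2' - W.u₁ * fB1'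
  have k1 : (W.v ^ 2 - W.u₁ ^ 2) * t ^ 5 * c 1 = 0 := by linear_combination W.v * fB1' - W.u₁ * fB2'
  funext i
  fin_cases i
  · exact (mul_eq_zero.1 k0).resolve_left hdet0
  · exact (mul_eq_zero.1 k1).resolve_left hdet5
  · exact (mul_eq_zero.1 k2).resolve_left hdet0
  · exact (mul_eq_zero.1 k3).resolve_left hdet5

/-- **Vertex-self-avoiding walks with arbitrary corner and straight weights** (`w₁ = w₂ = 0`, corner
weights `u₁, u₂ ≠ 0`, straight weight `v`, phase `t ≠ 0`): an exact vertex relation with `c ≠ 0`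
forces `v² = u₁²` AND `v² = u₂²` (the uniform walk `u₁ = u₂ = v` up to signs) AND, if `v ≠ 0`,
`t¹⁶ = −1`. (The uniform walk itself carries no relation at real `x ≠ 0`, real spin:
`NienhuisWeightsExcludeVertexSAW`, `NoExactDominoRelationZ2` Appendix V.)
[cite: Glazman2015WeightedSAW, Lemma 3.1 (no holomorphic weights with w₁ = w₂ = 0)] -/
theorem sq_eq_and_sq_eq_of_exactPlaquetteVertexRelation_noTouch
    (hrel : ExactPlaquetteVertexRelation W t c) (ht : t ≠ 0) (h1 : W.u₁ ≠ 0) (h2 : W.u₂ ≠ 0)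
    (hw1 : W.w₁ = 0) (hw2 : W.w₂ = 0) (hc : c ≠ 0) :
    W.v ^ 2 = W.u₁ ^ 2 ∧ W.v ^ 2 = W.u₂ ^ 2 ∧ (W.v ≠ 0 → t ^ 16 = -1) := by
  refine ⟨?_, ?_, fun hv => t_pow_sixteen_of_exactPlaquetteVertexRelation hrel ht h1 h2 hv hc⟩
  · by_contra hne
    exact hc (eq_zero_of_exactPlaquetteVertexRelation_of_w₁_eq_zero hrel ht h1 h2 hw1 hne)
  · by_contra hne
    exact hc (eq_zero_of_exactPlaquetteVertexRelation_of_w₂_eq_zero hrel ht h1 h2 hw2 hne)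

end RigidityInt

end InteriorPlacements


/-! ### Appended: c-free weight relations (the four-walk determinants) -/

section WeightRelations

variable {W : CWeights} {t : ℂ} {c : Fin 4 → ℂ}

/-- From four homogeneous linear equations with a nonzero solution, the determinant vanishes
(adjugate certificates, here for the co-corner adjacent quadruple `[E;NW], [W;ES], [S;NW], [N;ES]`).
[folklore] -/
private theorem detA_eq_zero (hc : c ≠ 0)
    (fA1 : W.v * c 1 + W.u₂ * t ^ 5 * c 2 + W.w₂ * t ^ 4 * c 3 = 0)
    (fA1p : W.u₂ * t ^ 5 * c 0 + W.w₂ * t ^ 4 * c 1 + W.v * c 3 = 0)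
    (fA2 : W.w₂ * t * c 0 + W.u₂ * c 1 + W.v * t ^ 5 * c 2 = 0)
    (fA2p : W.v * t ^ 5 * c 0 + W.w₂ * t * c 2 + W.u₂ * c 3 = 0) :
    W.w₂ ^ 4 * t ^ 10 - (W.v ^ 2 * W.w₂ ^ 2 * t ^ 2) - (W.v ^ 2 * W.w₂ ^ 2 * t ^ 18) + W.v ^ 4 * t ^ 10 + -2 * W.u₂ ^ 2 * W.w₂ ^ 2 * t ^ 10 + -2 * W.u₂ ^ 2 * W.v ^ 2 * t ^ 10 + W.u₂ ^ 4 * t ^ 10 = 0 := by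
  have kA0 : (W.w₂ ^ 4 * t ^ 10 - (W.v ^ 2 * W.w₂ ^ 2 * t ^ 2) - (W.v ^ 2 * W.w₂ ^ 2 * t ^ 18) + W.v ^ 4 * t ^ 10 + -2 * W.u₂ ^ 2 * W.w₂ ^ 2 * t ^ 10 + -2 * W.u₂ ^ 2 * W.v ^ 2 * t ^ 10 + W.u₂ ^ 4 * t ^ 10) * c 0 = 0 := by
    linear_combination (W.u₂ * W.v * W.w₂ * t + W.u₂ * W.v * W.w₂ * t ^ 9) * fA1 + (-(W.u₂ * W.w₂ ^ 2 * t ^ 5) - (W.u₂ * W.v ^ 2 * t ^ 5) + W.u₂ ^ 3 * t ^ 5) * fA1p + (W.w₂ ^ 3 * t ^ 9 - (W.v ^ 2 * W.w₂ * t) - (W.u₂ ^ 2 * W.w₂ * t ^ 9)) * fA2 + (-(W.v * W.w₂ ^ 2 * t ^ 13) + W.v ^ 3 * t ^ 5 - (W.u₂ ^ 2 * W.v * t ^ 5)) * fA2p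
  have kA1 : (W.w₂ ^ 4 * t ^ 10 - (W.v ^ 2 * W.w₂ ^ 2 * t ^ 2) - (W.v ^ 2 * W.w₂ ^ 2 * t ^ 18) + W.v ^ 4 * t ^ 10 + -2 * W.u₂ ^ 2 * W.w₂ ^ 2 * t ^ 10 + -2 * W.u₂ ^ 2 * W.v ^ 2 * t ^ 10 + W.u₂ ^ 4 * t ^ 10) * c 1 = 0 := by
    linear_combination (-(W.v * W.w₂ ^ 2 * t ^ 2) + W.v ^ 3 * t ^ 10 - (W.u₂ ^ 2 * W.v * t ^ 10)) * fA1 + (W.w₂ ^ 3 * t ^ 6 - (W.v ^ 2 * W.w₂ * t ^ 14) - (W.u₂ ^ 2 * W.w₂ * t ^ 6)) * fA1p + (-(W.u₂ * W.w₂ ^ 2 * t ^ 10) - (W.u₂ * W.v ^ 2 * t ^ 10) + W.u₂ ^ 3 * t ^ 10) * fA2 + (W.u₂ * W.v * W.w₂ * t ^ 6 + W.u₂ * W.v * W.w₂ * t ^ 14) * fA2p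
  have kA2 : (W.w₂ ^ 4 * t ^ 10 - (W.v ^ 2 * W.w₂ ^ 2 * t ^ 2) - (W.v ^ 2 * W.w₂ ^ 2 * t ^ 18) + W.v ^ 4 * t ^ 10 + -2 * W.u₂ ^ 2 * W.w₂ ^ 2 * t ^ 10 + -2 * W.u₂ ^ 2 * W.v ^ 2 * t ^ 10 + W.u₂ ^ 4 * t ^ 10) * c 2 = 0 := by
    linear_combination (-(W.u₂ * W.w₂ ^ 2 * t ^ 5) - (W.u₂ * W.v ^ 2 * t ^ 5) + W.u₂ ^ 3 * t ^ 5) * fA1 + (W.u₂ * W.v * W.w₂ * t + W.u₂ * W.v * W.w₂ * t ^ 9) * fA1p + (-(W.v * W.w₂ ^ 2 * t ^ 13) + W.v ^ 3 * t ^ 5 - (W.u₂ ^ 2 * W.v * t ^ 5)) * fA2 + (W.w₂ ^ 3 * t ^ 9 - (W.v ^ 2 * W.w₂ * t) - (W.u₂ ^ 2 * W.w₂ * t ^ 9)) * fA2p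
  have kA3 : (W.w₂ ^ 4 * t ^ 10 - (W.v ^ 2 * W.w₂ ^ 2 * t ^ 2) - (W.v ^ 2 * W.w₂ ^ 2 * t ^ 18) + W.v ^ 4 * t ^ 10 + -2 * W.u₂ ^ 2 * W.w₂ ^ 2 * t ^ 10 + -2 * W.u₂ ^ 2 * W.v ^ 2 * t ^ 10 + W.u₂ ^ 4 * t ^ 10) * c 3 = 0 := by
    linear_combination (W.w₂ ^ 3 * t ^ 6 - (W.v ^ 2 * W.w₂ * t ^ 14) - (W.u₂ ^ 2 * W.w₂ * t ^ 6)) * fA1 + (-(W.v * W.w₂ ^ 2 * t ^ 2) + W.v ^ 3 * t ^ 10 - (W.u₂ ^ 2 * W.v * t ^ 10)) * fA1p + (W.u₂ * W.v * W.w₂ * t ^ 6 + W.u₂ * W.v * W.w₂ * t ^ 14) * fA2 + (-(W.u₂ * W.w₂ ^ 2 * t ^ 10) - (W.u₂ * W.v ^ 2 * t ^ 10) + W.u₂ ^ 3 * t ^ 10) * fA2p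
  by_contra hdet
  apply hc
  funext j
  fin_cases j
  · exact (mul_eq_zero.1 kA0).resolve_left hdet
  · exact (mul_eq_zero.1 kA1).resolve_left hdet
  · exact (mul_eq_zero.1 kA2).resolve_left hdet
  · exact (mul_eq_zero.1 kA3).resolve_left hdet

/-- Same for the corner adjacent quadruple `[E;WS], [W;EN], [N;WS], [S;EN]`. [folklore] -/
private theorem detB_eq_zero (hc : c ≠ 0)
    (fB1 : W.w₁ * t * c 1 + W.u₁ * c 2 + W.v * t ^ 5 * c 3 = 0)
    (fB1p : W.u₁ * c 0 + W.v * t ^ 5 * c 1 + W.w₁ * t * c 3 = 0)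
    (fB2 : W.w₁ * t ^ 4 * c 0 + W.v * c 2 + W.u₁ * t ^ 5 * c 3 = 0)
    (fB2p : W.v * c 0 + W.u₁ * t ^ 5 * c 1 + W.w₁ * t ^ 4 * c 2 = 0) :
    -(W.w₁ ^ 4 * t ^ 10) + W.v ^ 2 * W.w₁ ^ 2 * t ^ 2 + W.v ^ 2 * W.w₁ ^ 2 * t ^ 18 - (W.v ^ 4 * t ^ 10) + 2 * W.u₁ ^ 2 * W.w₁ ^ 2 * t ^ 10 + 2 * W.u₁ ^ 2 * W.v ^ 2 * t ^ 10 - (W.u₁ ^ 4 * t ^ 10) = 0 := by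
  have kB0 : (-(W.w₁ ^ 4 * t ^ 10) + W.v ^ 2 * W.w₁ ^ 2 * t ^ 2 + W.v ^ 2 * W.w₁ ^ 2 * t ^ 18 - (W.v ^ 4 * t ^ 10) + 2 * W.u₁ ^ 2 * W.w₁ ^ 2 * t ^ 10 + 2 * W.u₁ ^ 2 * W.v ^ 2 * t ^ 10 - (W.u₁ ^ 4 * t ^ 10)) * c 0 = 0 := by
    linear_combination (-(W.u₁ * W.v * W.w₁ * t ^ 6) - (W.u₁ * W.v * W.w₁ * t ^ 14)) * fB1 + (W.u₁ * W.w₁ ^ 2 * t ^ 10 + W.u₁ * W.v ^ 2 * t ^ 10 - (W.u₁ ^ 3 * t ^ 10)) * fB1p + (-(W.w₁ ^ 3 * t ^ 6) + W.v ^ 2 * W.w₁ * t ^ 14 + W.u₁ ^ 2 * W.w₁ * t ^ 6) * fB2 + (W.v * W.w₁ ^ 2 * t ^ 2 - (W.v ^ 3 * t ^ 10) + W.u₁ ^ 2 * W.v * t ^ 10) * fB2p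
  have kB1 : (-(W.w₁ ^ 4 * t ^ 10) + W.v ^ 2 * W.w₁ ^ 2 * t ^ 2 + W.v ^ 2 * W.w₁ ^ 2 * t ^ 18 - (W.v ^ 4 * t ^ 10) + 2 * W.u₁ ^ 2 * W.w₁ ^ 2 * t ^ 10 + 2 * W.u₁ ^ 2 * W.v ^ 2 * t ^ 10 - (W.u₁ ^ 4 * t ^ 10)) * c 1 = 0 := by
    linear_combination (-(W.w₁ ^ 3 * t ^ 9) + W.v ^ 2 * W.w₁ * t + W.u₁ ^ 2 * W.w₁ * t ^ 9) * fB1 + (W.v * W.w₁ ^ 2 * t ^ 13 - (W.v ^ 3 * t ^ 5) + W.u₁ ^ 2 * W.v * t ^ 5) * fB1p + (-(W.u₁ * W.v * W.w₁ * t) - (W.u₁ * W.v * W.w₁ * t ^ 9)) * fB2 + (W.u₁ * W.w₁ ^ 2 * t ^ 5 + W.u₁ * W.v ^ 2 * t ^ 5 - (W.u₁ ^ 3 * t ^ 5)) * fB2p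
  have kB2 : (-(W.w₁ ^ 4 * t ^ 10) + W.v ^ 2 * W.w₁ ^ 2 * t ^ 2 + W.v ^ 2 * W.w₁ ^ 2 * t ^ 18 - (W.v ^ 4 * t ^ 10) + 2 * W.u₁ ^ 2 * W.w₁ ^ 2 * t ^ 10 + 2 * W.u₁ ^ 2 * W.v ^ 2 * t ^ 10 - (W.u₁ ^ 4 * t ^ 10)) * c 2 = 0 := by
    linear_combination (W.u₁ * W.w₁ ^ 2 * t ^ 10 + W.u₁ * W.v ^ 2 * t ^ 10 - (W.u₁ ^ 3 * t ^ 10)) * fB1 + (-(W.u₁ * W.v * W.w₁ * t ^ 6) - (W.u₁ * W.v * W.w₁ * t ^ 14)) * fB1p + (W.v * W.w₁ ^ 2 * t ^ 2 - (W.v ^ 3 * t ^ 10) + W.u₁ ^ 2 * W.v * t ^ 10) * fB2 + (-(W.w₁ ^ 3 * t ^ 6) + W.v ^ 2 * W.w₁ * t ^ 14 + W.u₁ ^ 2 * W.w₁ * t ^ 6) * fB2p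
  have kB3 : (-(W.w₁ ^ 4 * t ^ 10) + W.v ^ 2 * W.w₁ ^ 2 * t ^ 2 + W.v ^ 2 * W.w₁ ^ 2 * t ^ 18 - (W.v ^ 4 * t ^ 10) + 2 * W.u₁ ^ 2 * W.w₁ ^ 2 * t ^ 10 + 2 * W.u₁ ^ 2 * W.v ^ 2 * t ^ 10 - (W.u₁ ^ 4 * t ^ 10)) * c 3 = 0 := by
    linear_combination (W.v * W.w₁ ^ 2 * t ^ 13 - (W.v ^ 3 * t ^ 5) + W.u₁ ^ 2 * W.v * t ^ 5) * fB1 + (-(W.w₁ ^ 3 * t ^ 9) + W.v ^ 2 * W.w₁ * t + W.u₁ ^ 2 * W.w₁ * t ^ 9) * fB1p + (W.u₁ * W.w₁ ^ 2 * t ^ 5 + W.u₁ * W.v ^ 2 * t ^ 5 - (W.u₁ ^ 3 * t ^ 5)) * fB2 + (-(W.u₁ * W.v * W.w₁ * t) - (W.u₁ * W.v * W.w₁ * t ^ 9)) * fB2p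
  by_contra hdet
  apply hc
  funext j
  fin_cases j
  · exact (mul_eq_zero.1 kB0).resolve_left hdet
  · exact (mul_eq_zero.1 kB1).resolve_left hdet
  · exact (mul_eq_zero.1 kB2).resolve_left hdet
  · exact (mul_eq_zero.1 kB3).resolve_left hdet

/-- Same for the one-visit ("group one") quadruple of the four single-face instances. [folklore] -/
private theorem detG_eq_zero (hc : c ≠ 0)
    (hIE : c 0 * t + c 2 * W.v * t + c 3 * W.u₁ * t ^ 2 + c 1 * W.u₂ = 0)
    (hIN : c 1 * t + c 2 * W.u₁ + c 0 * W.u₂ * t ^ 2 + c 3 * W.v * t = 0)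
    (hIW : c 2 * t + c 0 * W.v * t + c 3 * W.u₂ + c 1 * W.u₁ * t ^ 2 = 0)
    (hIS : c 3 * t + c 2 * W.u₂ * t ^ 2 + c 0 * W.u₁ + c 1 * W.v * t = 0) :
    t ^ 4 + -2 * W.v ^ 2 * t ^ 4 + W.v ^ 4 * t ^ 4 + -2 * W.u₂ ^ 2 * t ^ 4 + -2 * W.u₂ ^ 2 * W.v ^ 2 * t ^ 4 + W.u₂ ^ 4 * t ^ 4 + 4 * W.u₁ * W.u₂ * W.v * t ^ 2 + 4 * W.u₁ * W.u₂ * W.v * t ^ 6 + -2 * W.u₁ ^ 2 * t ^ 4 + -2 * W.u₁ ^ 2 * W.v ^ 2 * t ^ 4 - (W.u₁ ^ 2 * W.u₂ ^ 2) - (W.u₁ ^ 2 * W.u₂ ^ 2 * t ^ 8) + W.u₁ ^ 4 * t ^ 4 = 0 := by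
  have kG0 : (t ^ 4 + -2 * W.v ^ 2 * t ^ 4 + W.v ^ 4 * t ^ 4 + -2 * W.u₂ ^ 2 * t ^ 4 + -2 * W.u₂ ^ 2 * W.v ^ 2 * t ^ 4 + W.u₂ ^ 4 * t ^ 4 + 4 * W.u₁ * W.u₂ * W.v * t ^ 2 + 4 * W.u₁ * W.u₂ * W.v * t ^ 6 + -2 * W.u₁ ^ 2 * t ^ 4 + -2 * W.u₁ ^ 2 * W.v ^ 2 * t ^ 4 - (W.u₁ ^ 2 * W.u₂ ^ 2) - (W.u₁ ^ 2 * W.u₂ ^ 2 * t ^ 8) + W.u₁ ^ 4 * t ^ 4) * c 0 = 0 := by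
    linear_combination (t ^ 3 - (W.v ^ 2 * t ^ 3) - (W.u₂ ^ 2 * t ^ 3) + W.u₁ * W.u₂ * W.v * t + W.u₁ * W.u₂ * W.v * t ^ 5 - (W.u₁ ^ 2 * t ^ 3)) * hIE + (-(W.u₂ * t ^ 2) - (W.u₂ * W.v ^ 2 * t ^ 2) + W.u₂ ^ 3 * t ^ 2 + 2 * W.u₁ * W.v * t ^ 4 - (W.u₁ ^ 2 * W.u₂ * t ^ 6)) * hIN + (-(W.v * t ^ 3) + W.v ^ 3 * t ^ 3 - (W.u₂ ^ 2 * W.v * t ^ 3) + W.u₁ * W.u₂ * t + W.u₁ * W.u₂ * t ^ 5 - (W.u₁ ^ 2 * W.v * t ^ 3)) * hIW + (2 * W.u₂ * W.v * t ^ 2 - (W.u₁ * t ^ 4) - (W.u₁ * W.v ^ 2 * t ^ 4) - (W.u₁ * W.u₂ ^ 2) + W.u₁ ^ 3 * t ^ 4) * hIS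
  have kG1 : (t ^ 4 + -2 * W.v ^ 2 * t ^ 4 + W.v ^ 4 * t ^ 4 + -2 * W.u₂ ^ 2 * t ^ 4 + -2 * W.u₂ ^ 2 * W.v ^ 2 * t ^ 4 + W.u₂ ^ 4 * t ^ 4 + 4 * W.u₁ * W.u₂ * W.v * t ^ 2 + 4 * W.u₁ * W.u₂ * W.v * t ^ 6 + -2 * W.u₁ ^ 2 * t ^ 4 + -2 * W.u₁ ^ 2 * W.v ^ 2 * t ^ 4 - (W.u₁ ^ 2 * W.u₂ ^ 2) - (W.u₁ ^ 2 * W.u₂ ^ 2 * t ^ 8) + W.u₁ ^ 4 * t ^ 4) * c 1 = 0 := by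
    linear_combination (-(W.u₂ * t ^ 4) - (W.u₂ * W.v ^ 2 * t ^ 4) + W.u₂ ^ 3 * t ^ 4 + 2 * W.u₁ * W.v * t ^ 2 - (W.u₁ ^ 2 * W.u₂)) * hIE + (t ^ 3 - (W.v ^ 2 * t ^ 3) - (W.u₂ ^ 2 * t ^ 3) + W.u₁ * W.u₂ * W.v * t + W.u₁ * W.u₂ * W.v * t ^ 5 - (W.u₁ ^ 2 * t ^ 3)) * hIN + (2 * W.u₂ * W.v * t ^ 4 - (W.u₁ * t ^ 2) - (W.u₁ * W.v ^ 2 * t ^ 2) - (W.u₁ * W.u₂ ^ 2 * t ^ 6) + W.u₁ ^ 3 * t ^ 2) * hIW + (-(W.v * t ^ 3) + W.v ^ 3 * t ^ 3 - (W.u₂ ^ 2 * W.v * t ^ 3) + W.u₁ * W.u₂ * t + W.u₁ * W.u₂ * t ^ 5 - (W.u₁ ^ 2 * W.v * t ^ 3)) * hIS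
  have kG2 : (t ^ 4 + -2 * W.v ^ 2 * t ^ 4 + W.v ^ 4 * t ^ 4 + -2 * W.u₂ ^ 2 * t ^ 4 + -2 * W.u₂ ^ 2 * W.v ^ 2 * t ^ 4 + W.u₂ ^ 4 * t ^ 4 + 4 * W.u₁ * W.u₂ * W.v * t ^ 2 + 4 * W.u₁ * W.u₂ * W.v * t ^ 6 + -2 * W.u₁ ^ 2 * t ^ 4 + -2 * W.u₁ ^ 2 * W.v ^ 2 * t ^ 4 - (W.u₁ ^ 2 * W.u₂ ^ 2) - (W.u₁ ^ 2 * W.u₂ ^ 2 * t ^ 8) + W.u₁ ^ 4 * t ^ 4) * c 2 = 0 := by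
    linear_combination (-(W.v * t ^ 3) + W.v ^ 3 * t ^ 3 - (W.u₂ ^ 2 * W.v * t ^ 3) + W.u₁ * W.u₂ * t + W.u₁ * W.u₂ * t ^ 5 - (W.u₁ ^ 2 * W.v * t ^ 3)) * hIE + (2 * W.u₂ * W.v * t ^ 2 - (W.u₁ * t ^ 4) - (W.u₁ * W.v ^ 2 * t ^ 4) - (W.u₁ * W.u₂ ^ 2) + W.u₁ ^ 3 * t ^ 4) * hIN + (t ^ 3 - (W.v ^ 2 * t ^ 3) - (W.u₂ ^ 2 * t ^ 3) + W.u₁ * W.u₂ * W.v * t + W.u₁ * W.u₂ * W.v * t ^ 5 - (W.u₁ ^ 2 * t ^ 3)) * hIW + (-(W.u₂ * t ^ 2) - (W.u₂ * W.v ^ 2 * t ^ 2) + W.u₂ ^ 3 * t ^ 2 + 2 * W.u₁ * W.v * t ^ 4 - (W.u₁ ^ 2 * W.u₂ * t ^ 6)) * hIS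
  have kG3 : (t ^ 4 + -2 * W.v ^ 2 * t ^ 4 + W.v ^ 4 * t ^ 4 + -2 * W.u₂ ^ 2 * t ^ 4 + -2 * W.u₂ ^ 2 * W.v ^ 2 * t ^ 4 + W.u₂ ^ 4 * t ^ 4 + 4 * W.u₁ * W.u₂ * W.v * t ^ 2 + 4 * W.u₁ * W.u₂ * W.v * t ^ 6 + -2 * W.u₁ ^ 2 * t ^ 4 + -2 * W.u₁ ^ 2 * W.v ^ 2 * t ^ 4 - (W.u₁ ^ 2 * W.u₂ ^ 2) - (W.u₁ ^ 2 * W.u₂ ^ 2 * t ^ 8) + W.u₁ ^ 4 * t ^ 4) * c 3 = 0 := by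
    linear_combination (2 * W.u₂ * W.v * t ^ 4 - (W.u₁ * t ^ 2) - (W.u₁ * W.v ^ 2 * t ^ 2) - (W.u₁ * W.u₂ ^ 2 * t ^ 6) + W.u₁ ^ 3 * t ^ 2) * hIE + (-(W.v * t ^ 3) + W.v ^ 3 * t ^ 3 - (W.u₂ ^ 2 * W.v * t ^ 3) + W.u₁ * W.u₂ * t + W.u₁ * W.u₂ * t ^ 5 - (W.u₁ ^ 2 * W.v * t ^ 3)) * hIN + (-(W.u₂ * t ^ 4) - (W.u₂ * W.v ^ 2 * t ^ 4) + W.u₂ ^ 3 * t ^ 4 + 2 * W.u₁ * W.v * t ^ 2 - (W.u₁ ^ 2 * W.u₂)) * hIW + (t ^ 3 - (W.v ^ 2 * t ^ 3) - (W.u₂ ^ 2 * t ^ 3) + W.u₁ * W.u₂ * W.v * t + W.u₁ * W.u₂ * W.v * t ^ 5 - (W.u₁ ^ 2 * t ^ 3)) * hIS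
  by_contra hdet
  apply hc
  funext j
  fin_cases j
  · exact (mul_eq_zero.1 kG0).resolve_left hdet
  · exact (mul_eq_zero.1 kG1).resolve_left hdet
  · exact (mul_eq_zero.1 kG2).resolve_left hdet
  · exact (mul_eq_zero.1 kG3).resolve_left hdet

/-- **The one-visit weight relation** (holds for ALL complex weights, no division): an exact vertex
relation with `c ≠ 0` forces the vanishing of the determinant of the four one-visit rows
`(t, u₂, vt, u₁t²)` and its rotations — the square-frame analogue of the "group one" condition of the
printed local linear system. [cite: Glazman2015WeightedSAW, Lemma 3.1 (proof: the local linear system)] [cite: IkhlefCardy2009, §3 (eqs. (3.1)–(3.4))] -/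
theorem oneVisit_det_eq_zero (hrel : ExactPlaquetteVertexRelation W t c) (ht : t ≠ 0) (hc : c ≠ 0) :
    t ^ 4 + -2 * W.v ^ 2 * t ^ 4 + W.v ^ 4 * t ^ 4 + -2 * W.u₂ ^ 2 * t ^ 4 + -2 * W.u₂ ^ 2 * W.v ^ 2 * t ^ 4 + W.u₂ ^ 4 * t ^ 4 + 4 * W.u₁ * W.u₂ * W.v * t ^ 2 + 4 * W.u₁ * W.u₂ * W.v * t ^ 6 + -2 * W.u₁ ^ 2 * t ^ 4 + -2 * W.u₁ ^ 2 * W.v ^ 2 * t ^ 4 - (W.u₁ ^ 2 * W.u₂ ^ 2) - (W.u₁ ^ 2 * W.u₂ ^ 2 * t ^ 8) + W.u₁ ^ 4 * t ^ 4 = 0 :=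
  detG_eq_zero hc (inst_IE hrel ht) (inst_IN hrel ht) (inst_IW hrel ht) (inst_IS hrel ht)

/-- **The co-corner weight relation**: for `u₁ u₂ v ≠ 0`, an exact vertex relation with `c ≠ 0`
forces `t⁸ (u₂² − v² − w₂²)² = (t⁸ + 1)² v² w₂²`, i.e. `u₂² − v² − w₂² = ± (t⁴ + t⁻⁴) v w₂` — the
square-frame form of the printed relation between the co-corner, straight and self-touching weights.
[cite: Glazman2015WeightedSAW, Lemma 3.1 (the weights (1.1)–(1.5))] [cite: IkhlefCardy2009, §3 (eq. (3.7))] -/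
theorem coCorner_weight_relation (hrel : ExactPlaquetteVertexRelation W t c) (ht : t ≠ 0)
    (h1 : W.u₁ ≠ 0) (h2 : W.u₂ ≠ 0) (hv : W.v ≠ 0) (hc : c ≠ 0) :
    t ^ 8 * (W.u₂ ^ 2 - W.v ^ 2 - W.w₂ ^ 2) ^ 2 = (t ^ 8 + 1) ^ 2 * W.v ^ 2 * W.w₂ ^ 2 := by
  obtain ⟨fA1, fA1', -, -, -, -⟩ := forms hrel ht h1 h2 hv
  have hIN := inst_IN hrel ht
  have hIS := inst_IS hrel ht
  have hBNWS := inst_BNWS hrel ht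
  have hBSEN := inst_BSEN hrel ht
  have m12 : W.u₁ * W.u₂ ^ 2 ≠ 0 := mul_ne_zero h1 (pow_ne_zero _ h2)
  have fA2 : W.w₂ * t * c 0 + W.u₂ * c 1 + W.v * t ^ 5 * c 2 = 0 := by
    have h : W.u₁ * W.u₂ ^ 2 * (W.w₂ * t * c 0 + W.u₂ * c 1 + W.v * t ^ 5 * c 2) = 0 := by
      linear_combination hBNWS - t * hIS
    exact (mul_eq_zero.1 h).resolve_left m12
  have fA2' : W.v * t ^ 5 * c 0 + W.w₂ * t * c 2 + W.u₂ * c 3 = 0 := by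
    have h : W.u₁ * W.u₂ ^ 2 * (W.v * t ^ 5 * c 0 + W.w₂ * t * c 2 + W.u₂ * c 3) = 0 := by
      linear_combination hBSEN - t * hIN
    exact (mul_eq_zero.1 h).resolve_left m12
  have hdet := detA_eq_zero hc fA1 fA1' fA2 fA2'
  have h2t : t ^ 2 ≠ 0 := pow_ne_zero _ ht
  have key : t ^ 2 * (t ^ 8 * (W.u₂ ^ 2 - W.v ^ 2 - W.w₂ ^ 2) ^ 2 - (t ^ 8 + 1) ^ 2 * W.v ^ 2 * W.w₂ ^ 2) = 0 := by
    linear_combination hdet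
  have := (mul_eq_zero.1 key).resolve_left h2t
  linear_combination this

/-- **The corner weight relation** (mirror): for `u₁ u₂ v ≠ 0`, an exact vertex relation with
`c ≠ 0` forces `t⁸ (u₁² − v² − w₁²)² = (t⁸ + 1)² v² w₁²`. [cite: Glazman2015WeightedSAW, Lemma 3.1 (the weights (1.1)–(1.5))] [cite: IkhlefCardy2009, §3 (eq. (3.7))] -/
theorem corner_weight_relation (hrel : ExactPlaquetteVertexRelation W t c) (ht : t ≠ 0)
    (h1 : W.u₁ ≠ 0) (h2 : W.u₂ ≠ 0) (hv : W.v ≠ 0) (hc : c ≠ 0) :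
    t ^ 8 * (W.u₁ ^ 2 - W.v ^ 2 - W.w₁ ^ 2) ^ 2 = (t ^ 8 + 1) ^ 2 * W.v ^ 2 * W.w₁ ^ 2 := by
  obtain ⟨-, -, fB1, fB1', -, -⟩ := forms hrel ht h1 h2 hv
  have hIN := inst_IN hrel ht
  have hIS := inst_IS hrel ht
  have hBSWN := inst_BSWN hrel ht
  have hBNES := inst_BNES hrel ht
  have m21 : W.u₁ ^ 2 * W.u₂ ≠ 0 := mul_ne_zero (pow_ne_zero _ h1) h2
  have fB2 : W.w₁ * t ^ 4 * c 0 + W.v * c 2 + W.u₁ * t ^ 5 * c 3 = 0 := by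
    have h : W.u₁ ^ 2 * W.u₂ * (W.w₁ * t ^ 4 * c 0 + W.v * c 2 + W.u₁ * t ^ 5 * c 3) = 0 := by
      linear_combination hBSWN - t ^ 2 * hIN
    exact (mul_eq_zero.1 h).resolve_left m21
  have fB2' : W.v * c 0 + W.u₁ * t ^ 5 * c 1 + W.w₁ * t ^ 4 * c 2 = 0 := by
    have h : W.u₁ ^ 2 * W.u₂ * (W.v * c 0 + W.u₁ * t ^ 5 * c 1 + W.w₁ * t ^ 4 * c 2) = 0 := by
      linear_combination hBNES - t ^ 2 * hIS
    exact (mul_eq_zero.1 h).resolve_left m21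
  have hdet := detB_eq_zero hc fB1 fB1' fB2 fB2'
  have h2t : t ^ 2 ≠ 0 := pow_ne_zero _ ht
  have key : t ^ 2 * (t ^ 8 * (W.u₁ ^ 2 - W.v ^ 2 - W.w₁ ^ 2) ^ 2 - (t ^ 8 + 1) ^ 2 * W.v ^ 2 * W.w₁ ^ 2) = 0 := by
    linear_combination -hdet
  have := (mul_eq_zero.1 key).resolve_left h2t
  linear_combination this

/-- **At the forced spins** (`t¹⁶ = −1`, so `(t⁸ + 1)² = 2t⁸`): Nienhuis' relations
`(u₂² − v² − w₂²)² = 2 v² w₂²` and `(u₁² − v² − w₁²)² = 2 v² w₁²`, i.e. `u² = v² + w² ± √2 · v w` for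
each corner type — necessary for EVERY complex weight system with `u₁ u₂ v ≠ 0` carrying an exact
vertex identity on `ℤ²` (the printed integrable weights at `θ = π/2` satisfy `u² = v² + w² + √2 v w`).
[cite: Glazman2015WeightedSAW, Lemma 3.1 (the weights (1.1)–(1.5) at θ = π/2)] [cite: IkhlefCardy2009, §3 (eq. (3.7))] -/
theorem nienhuis_weight_relations (hrel : ExactPlaquetteVertexRelation W t c) (ht : t ≠ 0)
    (h1 : W.u₁ ≠ 0) (h2 : W.u₂ ≠ 0) (hv : W.v ≠ 0) (hc : c ≠ 0) :
    (W.u₂ ^ 2 - W.v ^ 2 - W.w₂ ^ 2) ^ 2 = 2 * W.v ^ 2 * W.w₂ ^ 2 ∧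
      (W.u₁ ^ 2 - W.v ^ 2 - W.w₁ ^ 2) ^ 2 = 2 * W.v ^ 2 * W.w₁ ^ 2 := by
  have h16 := t_pow_sixteen_of_exactPlaquetteVertexRelation hrel ht h1 h2 hv hc
  have hA := coCorner_weight_relation hrel ht h1 h2 hv hc
  have hB := corner_weight_relation hrel ht h1 h2 hv hc
  have h8 : t ^ 8 ≠ 0 := pow_ne_zero _ ht
  constructor
  · have key : t ^ 8 * ((W.u₂ ^ 2 - W.v ^ 2 - W.w₂ ^ 2) ^ 2 - 2 * W.v ^ 2 * W.w₂ ^ 2) = 0 := by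
      linear_combination hA + W.v ^ 2 * W.w₂ ^ 2 * h16
    have := (mul_eq_zero.1 key).resolve_left h8
    linear_combination this
  · have key : t ^ 8 * ((W.u₁ ^ 2 - W.v ^ 2 - W.w₁ ^ 2) ^ 2 - 2 * W.v ^ 2 * W.w₁ ^ 2) = 0 := by
      linear_combination hB + W.v ^ 2 * W.w₁ ^ 2 * h16
    have := (mul_eq_zero.1 key).resolve_left h8
    linear_combination this

end WeightRelations


/-! ### Appended: the opposite-excursion weight relation -/

section OppositeRelation

variable {W : CWeights} {t : ℂ} {c : Fin 4 → ℂ}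

/-- Instance `VWE`: faces `[(0, 0), (0, 1), (-1, 1), (-1, 0), (-1, -1), (0, -1)]`, root = the `E` side of `(0,0)`, relation at `(0,0)`
(the opposite excursion `N ⇝ S` seen from `E`); 14 walks end on a side of `(0,0)`. [folklore] -/
private theorem inst_VWE (hrel : ExactPlaquetteVertexRelation W t c) (ht : t ≠ 0) :
    c 0 * t ^ 4 + c 1 * W.u₂ * t ^ 3 + c 2 * W.u₁ * W.u₂ ^ 3 * t ^ 6 + c 3 * W.u₁ * W.u₂ ^ 2 * W.w₂ * t ^ 5 + c 3 * W.u₁ ^ 2 * W.u₂ ^ 3 * W.v * t ^ 7 + c 2 * W.u₁ ^ 2 * W.u₂ ^ 2 * W.v * W.w₂ * t ^ 8 + c 2 * W.v * t ^ 4 + c 1 * W.u₁ * W.u₂ ^ 2 * W.v * t + c 3 * W.u₁ ^ 2 * W.u₂ * W.v * t ^ 7 + c 3 * W.u₁ * t ^ 5 + c 2 * W.u₁ ^ 3 * W.u₂ * t ^ 2 + c 1 * W.u₁ ^ 2 * W.u₂ * W.w₁ * t ^ 3 + c 1 * W.u₁ ^ 3 * W.u₂ ^ 2 * W.v * t + c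 2 * W.u₁ ^ 2 * W.u₂ ^ 2 * W.v * W.w₁ = 0 := by
  have hT : termsN [(0, 0), (0, 1), (-1, 1), (-1, 0), (-1, -1), (0, -1)] (Face.side (0, 0) .E) (0, 0) (depth [(0, 0), (0, 1), (-1, 1), (-1, 0), (-1, -1), (0, -1)]) 4 =
      [⟨0, 0, 0, 0, 0, 0, 4⟩, ⟨1, 0, 1, 0, 0, 0, 3⟩, ⟨2, 1, 3, 0, 0, 0, 6⟩, ⟨3, 1, 2, 0, 0, 1, 5⟩, ⟨3, 2, 3, 1, 0, 0, 7⟩, ⟨2, 2, 2, 1, 0, 1, 8⟩, ⟨2, 0, 0, 1, 0, 0, 4⟩, ⟨1, 1, 2, 1, 0, 0, 1⟩, ⟨3, 2, 1, 1, 0, 0, 7⟩, ⟨3, 1, 0, 0, 0, 0, 5⟩, ⟨2, 3, 1, 0, 0, 0, 2⟩, ⟨1, 2, 1, 0, 1, 0, 3⟩, ⟨1, 3, 2, 1, 0, 0, 1⟩, ⟨2, 2, 2, 1, 1, 0, 0⟩] := by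
    decide
  have hrow := vertexFunctional_mul_pow_eq_rowSumN W ht c [(0, 0), (0, 1), (-1, 1), (-1, 0), (-1, -1), (0, -1)] (Face.side (0, 0) .E) (0, 0) 4
    (by decide)
  rw [hrel _ _ _ (by decide) (by decide), zero_mul, hT] at hrow
  simp only [rowSumN, List.map_cons, List.map_nil, List.sum_cons, List.sum_nil, CWeights.mono, pow_zero,
    pow_one, mul_one, one_mul] at hrow
  linear_combination -hrow

/-- Instance `VEW`: faces `[(0, 0), (0, 1), (1, 1), (1, 0), (1, -1), (0, -1)]`, root = the `W` side of `(0,0)`, relation at `(0,0)`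
(the opposite excursion `N ⇝ S` seen from `W`); 14 walks end on a side of `(0,0)`. [folklore] -/
private theorem inst_VEW (hrel : ExactPlaquetteVertexRelation W t c) (ht : t ≠ 0) :
    c 2 * t ^ 4 + c 1 * W.u₁ * t ^ 5 + c 0 * W.u₁ ^ 3 * W.u₂ * t ^ 2 + c 3 * W.u₁ ^ 2 * W.u₂ * W.w₁ * t ^ 3 + c 3 * W.u₁ ^ 3 * W.u₂ ^ 2 * W.v * t + c 0 * W.u₁ ^ 2 * W.u₂ ^ 2 * W.v * W.w₁ + c 0 * W.v * t ^ 4 + c 1 * W.u₁ ^ 2 * W.u₂ * W.v * t ^ 7 + c 3 * W.u₁ * W.u₂ ^ 2 * W.v * t + c 3 * W.u₂ * t ^ 3 + c 0 * W.u₁ * W.u₂ ^ 3 * t ^ 6 + c 1 * W.u₁ * W.u₂ ^ 2 * W.w₂ * t ^ 5 + c 1 * W.u₁ ^ 2 * W.u₂ ^ 3 * W.v * t ^ 7 + c 0 * W.u₁ ^ 2 * W.u₂ ^ 2 * W.v * W.w₂ * t ^ 8 = 0 := by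
  have hT : termsN [(0, 0), (0, 1), (1, 1), (1, 0), (1, -1), (0, -1)] (Face.side (0, 0) .W) (0, 0) (depth [(0, 0), (0, 1), (1, 1), (1, 0), (1, -1), (0, -1)]) 4 =
      [⟨2, 0, 0, 0, 0, 0, 4⟩, ⟨1, 1, 0, 0, 0, 0, 5⟩, ⟨0, 3, 1, 0, 0, 0, 2⟩, ⟨3, 2, 1, 0, 1, 0, 3⟩, ⟨3, 3, 2, 1, 0, 0, 1⟩, ⟨0, 2, 2, 1, 1, 0, 0⟩, ⟨0, 0, 0, 1, 0, 0, 4⟩, ⟨1, 2, 1, 1, 0, 0, 7⟩, ⟨3, 1, 2, 1, 0, 0, 1⟩, ⟨3, 0, 1, 0, 0, 0, 3⟩, ⟨0, 1, 3, 0, 0, 0, 6⟩, ⟨1, 1, 2, 0, 0, 1, 5⟩, ⟨1, 2, 3, 1, 0, 0, 7⟩, ⟨0, 2, 2, 1, 0, 1, 8⟩] := by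
    decide
  have hrow := vertexFunctional_mul_pow_eq_rowSumN W ht c [(0, 0), (0, 1), (1, 1), (1, 0), (1, -1), (0, -1)] (Face.side (0, 0) .W) (0, 0) 4
    (by decide)
  rw [hrel _ _ _ (by decide) (by decide), zero_mul, hT] at hrow
  simp only [rowSumN, List.map_cons, List.map_nil, List.sum_cons, List.sum_nil, CWeights.mono, pow_zero,
    pow_one, mul_one, one_mul] at hrow
  linear_combination -hrow

/-- Adjugate certificate for the opposite quadruple `[E;NS], [N;EW], [W;NS], [S;EW]`. [folklore] -/
private theorem detO_eq_zero (hc : c ≠ 0)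
    (fD1 : W.u₁ * t * c 1 + (W.w₁ + W.w₂ * t ^ 8) * c 2 + W.u₂ * t ^ 7 * c 3 = 0)
    (fD2 : W.u₁ * t ^ 7 * c 0 + W.u₂ * t * c 2 + (W.w₂ + W.w₁ * t ^ 8) * c 3 = 0)
    (fD1p : (W.w₁ + W.w₂ * t ^ 8) * c 0 + W.u₂ * t ^ 7 * c 1 + W.u₁ * t * c 3 = 0)
    (fD2p : W.u₂ * t * c 0 + (W.w₂ + W.w₁ * t ^ 8) * c 1 + W.u₁ * t ^ 7 * c 2 = 0) :
    W.w₂ ^ 4 * t ^ 16 + 2 * W.w₁ * W.w₂ ^ 3 * t ^ 8 + 2 * W.w₁ * W.w₂ ^ 3 * t ^ 24 + W.w₁ ^ 2 * W.w₂ ^ 2 + 4 * W.w₁ ^ 2 * W.w₂ ^ 2 * t ^ 16 + W.w₁ ^ 2 * W.w₂ ^ 2 * t ^ 32 + 2 * W.w₁ ^ 3 * W.w₂ * t ^ 8 + 2 * W.w₁ ^ 3 * W.w₂ * t ^ 24 + W.w₁ ^ 4 * t ^ 16 + -2 * W.u₂ ^ 2 * W.w₂ ^ 2 * t ^ 16 +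 -2 * W.u₂ ^ 2 * W.w₁ * W.w₂ * t ^ 8 + -2 * W.u₂ ^ 2 * W.w₁ * W.w₂ * t ^ 24 + -2 * W.u₂ ^ 2 * W.w₁ ^ 2 * t ^ 16 + W.u₂ ^ 4 * t ^ 16 + -2 * W.u₁ ^ 2 * W.w₂ ^ 2 * t ^ 16 + -2 * W.u₁ ^ 2 * W.w₁ * W.w₂ * t ^ 8 + -2 * W.u₁ ^ 2 * W.w₁ * W.w₂ * t ^ 24 + -2 * W.u₁ ^ 2 * W.w₁ ^ 2 * t ^ 16 - (W.u₁ ^ 2 * W.u₂ ^ 2 * t ^ 4) - (W.u₁ ^ 2 * W.u₂ ^ 2 * t ^ 28) + W.u₁ ^ 4 * t ^ 16 = 0 := by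
  have kO0 : (W.w₂ ^ 4 * t ^ 16 + 2 * W.w₁ * W.w₂ ^ 3 * t ^ 8 + 2 * W.w₁ * W.w₂ ^ 3 * t ^ 24 + W.w₁ ^ 2 * W.w₂ ^ 2 + 4 * W.w₁ ^ 2 * W.w₂ ^ 2 * t ^ 16 + W.w₁ ^ 2 * W.w₂ ^ 2 * t ^ 32 + 2 * W.w₁ ^ 3 * W.w₂ * t ^ 8 + 2 * W.w₁ ^ 3 * W.w₂ * t ^ 24 + W.w₁ ^ 4 * t ^ 16 + -2 * W.u₂ ^ 2 * W.w₂ ^ 2 * t ^ 16 + -2 * W.u₂ ^ 2 * W.w₁ * W.w₂ * t ^ 8 + -2 * W.u₂ ^ 2 * W.w₁ * W.w₂ * t ^ 24 + -2 * W.u₂ ^ 2 * W.w₁ ^ 2 * t ^ 16 + W.u₂ ^ 4 * t ^ 16 + -2 * W.u₁ ^ 2 * W.w₂ ^ 2 * t ^ 16 + -2 * W.u₁ ^ 2 * W.w₁ * W.w₂ * t ^ 8 + -2 * W.u₁ ^ 2 * W.w₁ * W.w₂ * t ^ 24 + -2 * W.u₁ ^ 2 * W.w₁ ^ 2 * t ^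 16 - (W.u₁ ^ 2 * W.u₂ ^ 2 * t ^ 4) - (W.u₁ ^ 2 * W.u₂ ^ 2 * t ^ 28) + W.u₁ ^ 4 * t ^ 16) * c 0 = 0 := by
    linear_combination (W.u₁ * W.u₂ * W.w₂ * t ^ 2 + W.u₁ * W.u₂ * W.w₂ * t ^ 14 + W.u₁ * W.u₂ * W.w₁ * t ^ 10 + W.u₁ * W.u₂ * W.w₁ * t ^ 22) * fD1 + (-(W.u₁ * W.w₂ ^ 2 * t ^ 9) - (W.u₁ * W.w₁ * W.w₂ * t) - (W.u₁ * W.w₁ * W.w₂ * t ^ 17) - (W.u₁ * W.w₁ ^ 2 * t ^ 9) - (W.u₁ * W.u₂ ^ 2 * t ^ 21) + W.u₁ ^ 3 * t ^ 9) * fD2 + (W.w₂ ^ 3 * t ^ 8 + W.w₁ * W.w₂ ^ 2 + 2 * W.w₁ * W.w₂ ^ 2 * t ^ 16 + 2 * W.w₁ ^ 2 * W.w₂ * t ^ 8 + W.w₁ ^ 2 * W.w₂ * t ^ 24 + W.w₁ ^ 3 * t ^ 16 - (W.u₂ ^ 2 * W.w₂ * t ^ 8) - (W.u₂ ^ 2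 * W.w₁ * t ^ 16) - (W.u₁ ^ 2 * W.w₂ * t ^ 8) - (W.u₁ ^ 2 * W.w₁ * t ^ 16)) * fD1p + (-(W.u₂ * W.w₂ ^ 2 * t ^ 15) - (W.u₂ * W.w₁ * W.w₂ * t ^ 7) - (W.u₂ * W.w₁ * W.w₂ * t ^ 23) - (W.u₂ * W.w₁ ^ 2 * t ^ 15) + W.u₂ ^ 3 * t ^ 15 - (W.u₁ ^ 2 * W.u₂ * t ^ 3)) * fD2p
  have kO1 : (W.w₂ ^ 4 * t ^ 16 + 2 * W.w₁ * W.w₂ ^ 3 * t ^ 8 + 2 * W.w₁ * W.w₂ ^ 3 * t ^ 24 + W.w₁ ^ 2 * W.w₂ ^ 2 + 4 * W.w₁ ^ 2 * W.w₂ ^ 2 * t ^ 16 + W.w₁ ^ 2 * W.w₂ ^ 2 * t ^ 32 + 2 * W.w₁ ^ 3 * W.w₂ * t ^ 8 + 2 * W.w₁ ^ 3 * W.w₂ * t ^ 24 + W.w₁ ^ 4 * t ^ 16 + -2 * W.u₂ ^ 2 * W.w₂ ^ 2 * t ^ 16 + -2 * W.u₂ ^ 2 * W.w₁ * W.w₂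 * t ^ 8 + -2 * W.u₂ ^ 2 * W.w₁ * W.w₂ * t ^ 24 + -2 * W.u₂ ^ 2 * W.w₁ ^ 2 * t ^ 16 + W.u₂ ^ 4 * t ^ 16 + -2 * W.u₁ ^ 2 * W.w₂ ^ 2 * t ^ 16 + -2 * W.u₁ ^ 2 * W.w₁ * W.w₂ * t ^ 8 + -2 * W.u₁ ^ 2 * W.w₁ * W.w₂ * t ^ 24 + -2 * W.u₁ ^ 2 * W.w₁ ^ 2 * t ^ 16 - (W.u₁ ^ 2 * W.u₂ ^ 2 * t ^ 4) - (W.u₁ ^ 2 * W.u₂ ^ 2 * t ^ 28) + W.u₁ ^ 4 * t ^ 16) * c 1 = 0 := by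
    linear_combination (-(W.u₁ * W.w₂ ^ 2 * t ^ 15) - (W.u₁ * W.w₁ * W.w₂ * t ^ 7) - (W.u₁ * W.w₁ * W.w₂ * t ^ 23) - (W.u₁ * W.w₁ ^ 2 * t ^ 15) - (W.u₁ * W.u₂ ^ 2 * t ^ 3) + W.u₁ ^ 3 * t ^ 15) * fD1 + (W.u₁ * W.u₂ * W.w₂ * t ^ 10 + W.u₁ * W.u₂ * W.w₂ * t ^ 22 + W.u₁ * W.u₂ * W.w₁ * t ^ 2 + W.u₁ * W.u₂ * W.w₁ * t ^ 14) * fD2 + (-(W.u₂ * W.w₂ ^ 2 * t ^ 9) - (W.u₂ * W.w₁ * W.w₂ * t) - (W.u₂ * W.w₁ * W.w₂ * t ^ 17) - (W.u₂ * W.w₁ ^ 2 * t ^ 9) + W.u₂ ^ 3 * t ^ 9 - (W.u₁ ^ 2 * W.u₂ * t ^ 21)) * fD1p + (W.w₂ ^ 3 * t ^ 16 + 2 * W.w₁ * W.w₂ ^ 2 * t ^ 8 + W.w₁ * W.w₂ ^ 2 * t ^ 24 + W.w₁ ^ 2 * W.w₂ + 2 * W.w₁ ^ 2 * W.w₂ *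 t ^ 16 + W.w₁ ^ 3 * t ^ 8 - (W.u₂ ^ 2 * W.w₂ * t ^ 16) - (W.u₂ ^ 2 * W.w₁ * t ^ 8) - (W.u₁ ^ 2 * W.w₂ * t ^ 16) - (W.u₁ ^ 2 * W.w₁ * t ^ 8)) * fD2p
  have kO2 : (W.w₂ ^ 4 * t ^ 16 + 2 * W.w₁ * W.w₂ ^ 3 * t ^ 8 + 2 * W.w₁ * W.w₂ ^ 3 * t ^ 24 + W.w₁ ^ 2 * W.w₂ ^ 2 + 4 * W.w₁ ^ 2 * W.w₂ ^ 2 * t ^ 16 + W.w₁ ^ 2 * W.w₂ ^ 2 * t ^ 32 + 2 * W.w₁ ^ 3 * W.w₂ * t ^ 8 + 2 * W.w₁ ^ 3 * W.w₂ * t ^ 24 + W.w₁ ^ 4 * t ^ 16 + -2 * W.u₂ ^ 2 * W.w₂ ^ 2 * t ^ 16 + -2 * W.u₂ ^ 2 * W.w₁ * W.w₂ * t ^ 8 + -2 * W.u₂ ^ 2 * W.w₁ * W.w₂ * t ^ 24 + -2 * W.u₂ ^ 2 * W.w₁ ^ 2 * t ^ 16 + W.u₂ ^ 4 * t ^ 16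 + -2 * W.u₁ ^ 2 * W.w₂ ^ 2 * t ^ 16 + -2 * W.u₁ ^ 2 * W.w₁ * W.w₂ * t ^ 8 + -2 * W.u₁ ^ 2 * W.w₁ * W.w₂ * t ^ 24 + -2 * W.u₁ ^ 2 * W.w₁ ^ 2 * t ^ 16 - (W.u₁ ^ 2 * W.u₂ ^ 2 * t ^ 4) - (W.u₁ ^ 2 * W.u₂ ^ 2 * t ^ 28) + W.u₁ ^ 4 * t ^ 16) * c 2 = 0 := by
    linear_combination (W.w₂ ^ 3 * t ^ 8 + W.w₁ * W.w₂ ^ 2 + 2 * W.w₁ * W.w₂ ^ 2 * t ^ 16 + 2 * W.w₁ ^ 2 * W.w₂ * t ^ 8 + W.w₁ ^ 2 * W.w₂ * t ^ 24 + W.w₁ ^ 3 * t ^ 16 - (W.u₂ ^ 2 * W.w₂ * t ^ 8) - (W.u₂ ^ 2 * W.w₁ * t ^ 16) - (W.u₁ ^ 2 * W.w₂ * t ^ 8) - (W.u₁ ^ 2 * W.w₁ * t ^ 16)) * fD1 + (-(W.u₂ * W.w₂ ^ 2 * t ^ 15) - (W.u₂ * W.w₁ * W.w₂ * t ^ 7)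 - (W.u₂ * W.w₁ * W.w₂ * t ^ 23) - (W.u₂ * W.w₁ ^ 2 * t ^ 15) + W.u₂ ^ 3 * t ^ 15 - (W.u₁ ^ 2 * W.u₂ * t ^ 3)) * fD2 + (W.u₁ * W.u₂ * W.w₂ * t ^ 2 + W.u₁ * W.u₂ * W.w₂ * t ^ 14 + W.u₁ * W.u₂ * W.w₁ * t ^ 10 + W.u₁ * W.u₂ * W.w₁ * t ^ 22) * fD1p + (-(W.u₁ * W.w₂ ^ 2 * t ^ 9) - (W.u₁ * W.w₁ * W.w₂ * t) - (W.u₁ * W.w₁ * W.w₂ * t ^ 17) - (W.u₁ * W.w₁ ^ 2 * t ^ 9) - (W.u₁ * W.u₂ ^ 2 * t ^ 21) + W.u₁ ^ 3 * t ^ 9) * fD2p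
  have kO3 : (W.w₂ ^ 4 * t ^ 16 + 2 * W.w₁ * W.w₂ ^ 3 * t ^ 8 + 2 * W.w₁ * W.w₂ ^ 3 * t ^ 24 + W.w₁ ^ 2 * W.w₂ ^ 2 + 4 * W.w₁ ^ 2 * W.w₂ ^ 2 * t ^ 16 + W.w₁ ^ 2 * W.w₂ ^ 2 * t ^ 32 + 2 * W.w₁ ^ 3 * W.w₂ * t ^ 8 + 2 * W.w₁ ^ 3 * W.w₂ * t ^ 24 + W.w₁ ^ 4 * t ^ 16 + -2 * W.u₂ ^ 2 * W.w₂ ^ 2 * t ^ 16 + -2 * W.u₂ ^ 2 * W.w₁ * W.w₂ * t ^ 8 + -2 * W.u₂ ^ 2 * W.w₁ * W.w₂ * t ^ 24 + -2 * W.u₂ ^ 2 * W.w₁ ^ 2 * t ^ 16 + W.u₂ ^ 4 * t ^ 16 + -2 * W.u₁ ^ 2 * W.w₂ ^ 2 * t ^ 16 + -2 * W.u₁ ^ 2 * W.w₁ * W.w₂ * t ^ 8 + -2 * W.u₁ ^ 2 * W.w₁ * W.w₂ * t ^ 24 + -2 * W.u₁ ^ 2 * W.w₁ ^ 2 * t ^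 16 - (W.u₁ ^ 2 * W.u₂ ^ 2 * t ^ 4) - (W.u₁ ^ 2 * W.u₂ ^ 2 * t ^ 28) + W.u₁ ^ 4 * t ^ 16) * c 3 = 0 := by
    linear_combination (-(W.u₂ * W.w₂ ^ 2 * t ^ 9) - (W.u₂ * W.w₁ * W.w₂ * t) - (W.u₂ * W.w₁ * W.w₂ * t ^ 17) - (W.u₂ * W.w₁ ^ 2 * t ^ 9) + W.u₂ ^ 3 * t ^ 9 - (W.u₁ ^ 2 * W.u₂ * t ^ 21)) * fD1 + (W.w₂ ^ 3 * t ^ 16 + 2 * W.w₁ * W.w₂ ^ 2 * t ^ 8 + W.w₁ * W.w₂ ^ 2 * t ^ 24 + W.w₁ ^ 2 * W.w₂ + 2 * W.w₁ ^ 2 * W.w₂ * t ^ 16 + W.w₁ ^ 3 * t ^ 8 - (W.u₂ ^ 2 * W.w₂ * t ^ 16) - (W.u₂ ^ 2 * W.w₁ * t ^ 8) - (W.u₁ ^ 2 * W.w₂ * t ^ 16) - (W.u₁ ^ 2 * W.w₁ * t ^ 8)) * fD2 + (-(W.u₁ * W.w₂ ^ 2 * t ^ 15) - (W.u₁ * W.w₁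 * W.w₂ * t ^ 7) - (W.u₁ * W.w₁ * W.w₂ * t ^ 23) - (W.u₁ * W.w₁ ^ 2 * t ^ 15) - (W.u₁ * W.u₂ ^ 2 * t ^ 3) + W.u₁ ^ 3 * t ^ 15) * fD1p + (W.u₁ * W.u₂ * W.w₂ * t ^ 10 + W.u₁ * W.u₂ * W.w₂ * t ^ 22 + W.u₁ * W.u₂ * W.w₁ * t ^ 2 + W.u₁ * W.u₂ * W.w₁ * t ^ 14) * fD2p
  by_contra hdet
  apply hc
  funext j
  fin_cases j
  · exact (mul_eq_zero.1 kO0).resolve_left hdet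
  · exact (mul_eq_zero.1 kO1).resolve_left hdet
  · exact (mul_eq_zero.1 kO2).resolve_left hdet
  · exact (mul_eq_zero.1 kO3).resolve_left hdet

/-- **The opposite-excursion weight relation**: for `u₁ u₂ v ≠ 0`, an exact vertex relation with
`c ≠ 0` forces the vanishing of the determinant of the four opposite-excursion forms
`[E;NS] = (0, u₁t, w₁ + w₂t⁸, u₂t⁷)` and its rotations — a relation among `u₁, u₂, w₁, w₂, t` only.
[cite: Glazman2015WeightedSAW, Lemma 3.1 (proof: the local linear system)] [cite: IkhlefCardy2009, §3 (eqs. (3.1)–(3.4))] -/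
theorem opposite_weight_relation (hrel : ExactPlaquetteVertexRelation W t c) (ht : t ≠ 0)
    (h1 : W.u₁ ≠ 0) (h2 : W.u₂ ≠ 0) (hv : W.v ≠ 0) (hc : c ≠ 0) :
    W.w₂ ^ 4 * t ^ 16 + 2 * W.w₁ * W.w₂ ^ 3 * t ^ 8 + 2 * W.w₁ * W.w₂ ^ 3 * t ^ 24 + W.w₁ ^ 2 * W.w₂ ^ 2 + 4 * W.w₁ ^ 2 * W.w₂ ^ 2 * t ^ 16 + W.w₁ ^ 2 * W.w₂ ^ 2 * t ^ 32 + 2 * W.w₁ ^ 3 * W.w₂ * t ^ 8 + 2 * W.w₁ ^ 3 * W.w₂ * t ^ 24 + W.w₁ ^ 4 * t ^ 16 + -2 * W.u₂ ^ 2 * W.w₂ ^ 2 * t ^ 16 + -2 * W.u₂ ^ 2 * W.w₁ * W.w₂ * t ^ 8 + -2 * W.u₂ ^ 2 * W.w₁ * W.w₂ * t ^ 24 + -2 * W.u₂ ^ 2 * W.w₁ ^ 2 * t ^ 16 + W.u₂ ^ 4 * t ^ 16 + -2 * W.u₁ ^ 2 * W.w₂ ^ 2 * t ^ 16 + -2 *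 W.u₁ ^ 2 * W.w₁ * W.w₂ * t ^ 8 + -2 * W.u₁ ^ 2 * W.w₁ * W.w₂ * t ^ 24 + -2 * W.u₁ ^ 2 * W.w₁ ^ 2 * t ^ 16 - (W.u₁ ^ 2 * W.u₂ ^ 2 * t ^ 4) - (W.u₁ ^ 2 * W.u₂ ^ 2 * t ^ 28) + W.u₁ ^ 4 * t ^ 16 = 0 := by
  obtain ⟨-, -, -, -, fD2, fD2'⟩ := forms hrel ht h1 h2 hv
  have hIE := inst_IE hrel ht
  have hIW := inst_IW hrel ht
  have hBNWE := inst_BNWE hrel ht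
  have hBSWE := inst_BSWE hrel ht
  have hBNEW := inst_BNEW hrel ht
  have hBSEW := inst_BSEW hrel ht
  have hVWE := inst_VWE hrel ht
  have hVEW := inst_VEW hrel ht
  have m221 : W.u₁ ^ 2 * W.u₂ ^ 2 * W.v ≠ 0 :=
    mul_ne_zero (mul_ne_zero (pow_ne_zero _ h1) (pow_ne_zero _ h2)) hv
  have fD1 : W.u₁ * t * c 1 + (W.w₁ + W.w₂ * t ^ 8) * c 2 + W.u₂ * t ^ 7 * c 3 = 0 := by
    have h : W.u₁ ^ 2 * W.u₂ ^ 2 * W.v *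
        (W.u₁ * t * c 1 + (W.w₁ + W.w₂ * t ^ 8) * c 2 + W.u₂ * t ^ 7 * c 3) = 0 := by
      linear_combination hVWE - t * hBNWE - t ^ 2 * hBSWE + t ^ 3 * hIE
    exact (mul_eq_zero.1 h).resolve_left m221
  have fD1' : (W.w₁ + W.w₂ * t ^ 8) * c 0 + W.u₂ * t ^ 7 * c 1 + W.u₁ * t * c 3 = 0 := by
    have h : W.u₁ ^ 2 * W.u₂ ^ 2 * W.v *
        ((W.w₁ + W.w₂ * t ^ 8) * c 0 + W.u₂ * t ^ 7 * c 1 + W.u₁ * t * c 3) = 0 := by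
      linear_combination hVEW - t ^ 2 * hBNEW - t * hBSEW + t ^ 3 * hIW
    exact (mul_eq_zero.1 h).resolve_left m221
  exact detO_eq_zero hc fD1 fD2 fD1' fD2'

/-- **At the forced spins** (`t¹⁶ = −1`, so `t⁻¹² = −t⁴` and `(t⁶ + t⁻⁶)² = (t¹²+1)²/t¹²`): the
opposite relation becomes `t¹² (u₁² + u₂² − w₁² − w₂²)² = (t¹² + 1)² u₁² u₂²`, i.e.
`u₁² + u₂² − w₁² − w₂² = ± (t⁶ + t⁻⁶) u₁ u₂` — at `σ = 5/8`, `t⁶ + t⁻⁶ = 2cos(π/8) = 1/x_c`, satisfied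
by the printed weights (`2(u² − w²) = 2cos(π/8)·u²` at `θ = π/2`). [cite: Glazman2015WeightedSAW, Lemma 3.1 (the weights (1.1)–(1.5))] [cite: IkhlefCardy2009, §3 (eq. (3.7))] -/
theorem opposite_weight_relation_forced (hrel : ExactPlaquetteVertexRelation W t c) (ht : t ≠ 0)
    (h1 : W.u₁ ≠ 0) (h2 : W.u₂ ≠ 0) (hv : W.v ≠ 0) (hc : c ≠ 0) :
    t ^ 12 * (W.u₁ ^ 2 + W.u₂ ^ 2 - W.w₁ ^ 2 - W.w₂ ^ 2) ^ 2 = (t ^ 12 + 1) ^ 2 * W.u₁ ^ 2 * W.u₂ ^ 2 := by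
  have h16 := t_pow_sixteen_of_exactPlaquetteVertexRelation hrel ht h1 h2 hv hc
  have hO := opposite_weight_relation hrel ht h1 h2 hv hc
  linear_combination (-t ^ 12) * hO + (W.w₂ ^ 4 * t ^ 12 + 2 * W.w₁ * W.w₂ ^ 3 * t ^ 20 + 3 * W.w₁ ^ 2 * W.w₂ ^ 2 * t ^ 12 + W.w₁ ^ 2 * W.w₂ ^ 2 * t ^ 28 + 2 * W.w₁ ^ 3 * W.w₂ * t ^ 20 + W.w₁ ^ 4 * t ^ 12 + -2 * W.u₂ ^ 2 * W.w₂ ^ 2 * t ^ 12 + -2 * W.u₂ ^ 2 * W.w₁ * W.w₂ * t ^ 20 + -2 * W.u₂ ^ 2 * W.w₁ ^ 2 * t ^ 12 + W.u₂ ^ 4 * t ^ 12 + -2 * W.u₁ ^ 2 * W.w₂ ^ 2 * t ^ 12 + -2 * W.u₁ ^ 2 * W.w₁ * W.w₂ * t ^ 20 + -2 * W.u₁ ^ 2 * W.w₁ ^ 2 * t ^ 12 - (W.u₁ ^ 2 * W.u₂ ^ 2) - (W.u₁ ^ 2 * W.u₂ ^ 2 * t ^ 24) + W.u₁ ^ 4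 * t ^ 12) * h16

end OppositeRelation

/-! ### Appended: weight rigidity — the local forms determine the five weights from the coefficients
(«YB completeness», algebraic form)

Glazman's Lemma 3.1 says that at `σ = ℓ/8`, `ℓ` odd, the plaquette weights solving the rhombus
half-Cauchy–Riemann system are UNIQUE (Nienhuis' weights); Ikhlef–Cardy §3 solve the corresponding
linear system for the Boltzmann weights. Here is the square-lattice, free-coefficient counterpart,
proved NECESSARY for arbitrary complex weights and arbitrary coefficient vectors: decompose `c` under
the half-turn `ρ²`, `(c_E, c_N, c_W, c_S) ↦ (c_W, c_S, c_E, c_N)`; some eigencomponent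
`(a, b) = (c_E + ε c_W, c_N + ε c_S)`, `ε = ±1`, is nonzero, and the group-one forms together with the
adjacent-excursion forms `[E;NW] ± [W;ES]`, `[E;WS] ± [W;EN]`, `[N;ES] ± [S;NW]`, `[N;WS] ± [S;EN]`
give six linear equations in `(a, b)`; eliminating yields `a ≠ 0`, `b ≠ 0`, the discriminant
`D = t⁶(a⁴ + b⁴) − (1 + t¹²)a²b² ≠ 0` (because `t¹⁶ = −1`), and the TRIANGULAR system
`v·D = −ε(t⁶(a⁴ + b⁴) − (t⁴ + t⁸)a²b²)`, `ε u₁ a b (t⁴ − 1) = t(1 + εv)(b² − t²a²)`,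
`u₂ t² a = −ε u₁ a − t(1 + εv) b`, `w₁ t⁴ a = −ε v a − ε u₁ t⁵ b`, `w₂ t a = −ε v t⁵ a − u₂ b`
(`weight_rigidity`, `weight_rigidityInt`): the five weights are RATIONAL functions of the single
ratio `r = b/a` (`ybCurve ε t r`; `weights_eq_ybCurve`, `weights_eq_ybCurveInt`, the named statement
`PlaquetteWalkWeightRigidity`). In particular an exact vertex identity of the plaquette walk on `ℤ²`
with `u₁u₂v ≠ 0` lies on one of the `2 × 16` rational curves `{ybCurve ε t r : r}` (`ε = ±1`,
`t¹⁶ = −1`), and two weight systems carrying identities with the same `(ε, t, r)` coincide. Not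
proved here (checked numerically to `10⁻¹⁵` at `θ/π ∈ {1/3, 0.45, 1/2, 0.6, 2/3}` by the lane, and the
existence half is the companion file `YangBaxterSAWSquareLattice` on Glazman–Manolescu rectangles):
for `ε = −1`, `t = e^{−5iπ/16}`, `r = e^{i(3θ/8 + 5π/16)}` the point `ybCurve ε t r` is the printed
Yang–Baxter weight system `W(θ)` of Glazman–Manolescu's eq. (1). -/

section WeightRigidity

variable {W : CWeights} {t : ℂ} {c : Fin 4 → ℂ}

/-- A nonzero coefficient vector has a nonzero `ρ²`-eigencomponent: for `ε = 1` or `ε = -1` the pair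
`(c_E + ε c_W, c_N + ε c_S)` is nonzero. [folklore] -/
private theorem exists_eps_component_ne_zero (hc : c ≠ 0) :
    ∃ ε : ℂ, (ε = 1 ∨ ε = -1) ∧ (c 0 + ε * c 2 ≠ 0 ∨ c 1 + ε * c 3 ≠ 0) := by
  by_cases h : c 0 + c 2 ≠ 0 ∨ c 1 + c 3 ≠ 0
  · exact ⟨1, Or.inl rfl, by simpa using h⟩
  · push Not at h
    refine ⟨-1, Or.inr rfl, ?_⟩
    by_contra h'
    push Not at h'
    apply hc
    have h0 : c 0 = 0 := by linear_combination (h.1 + h'.1) / 2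
    have h1 : c 1 = 0 := by linear_combination (h.2 + h'.2) / 2
    have h2 : c 2 = 0 := by linear_combination h.1 - h0
    have h3 : c 3 = 0 := by linear_combination h.2 - h1
    funext i
    fin_cases i <;> assumption

/-- **The algebraic core of weight rigidity.** From the group-one forms and six adjacent-excursion
forms (as polynomial identities), for an `ε`-eigencomponent `(a, b) = (c_E + ε c_W, c_N + ε c_S) ≠ 0`
(`ε = ±1`) and `u₁ u₂ v ≠ 0`, `t¹⁶ = -1`: `a ≠ 0`, `b ≠ 0`, the discriminant
`D = t⁶(a⁴ + b⁴) − (1 + t¹²) a² b² ≠ 0`, and the five weights satisfy the triangular system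
`v·D = −ε (t⁶(a⁴+b⁴) − (t⁴+t⁸)a²b²)`, `ε u₁ a b (t⁴−1) = t(1+εv)(b² − t²a²)`,
`u₂ t² a = −ε u₁ a − t(1+εv) b`, `w₁ t⁴ a = −ε v a − ε u₁ t⁵ b`, `w₂ t a = −ε v t⁵ a − u₂ b`.
[folklore] -/
private theorem rigidity_of_forms (ht : t ≠ 0) (h2 : W.u₂ ≠ 0) (h16 : t ^ 16 = -1)
    (gE : c 0 * t + c 2 * W.v * t + c 3 * W.u₁ * t ^ 2 + c 1 * W.u₂ = 0)
    (gN : c 1 * t + c 2 * W.u₁ + c 0 * W.u₂ * t ^ 2 + c 3 * W.v * t = 0)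
    (gW : c 2 * t + c 0 * W.v * t + c 3 * W.u₂ + c 1 * W.u₁ * t ^ 2 = 0)
    (gS : c 3 * t + c 2 * W.u₂ * t ^ 2 + c 0 * W.u₁ + c 1 * W.v * t = 0)
    (fA1 : W.v * c 1 + W.u₂ * t ^ 5 * c 2 + W.w₂ * t ^ 4 * c 3 = 0)
    (fA1' : W.u₂ * t ^ 5 * c 0 + W.w₂ * t ^ 4 * c 1 + W.v * c 3 = 0)
    (fB1 : W.w₁ * t * c 1 + W.u₁ * c 2 + W.v * t ^ 5 * c 3 = 0)
    (fB1' : W.u₁ * c 0 + W.v * t ^ 5 * c 1 + W.w₁ * t * c 3 = 0)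
    (fC1 : W.v * t ^ 5 * c 0 + W.w₂ * t * c 2 + W.u₂ * c 3 = 0)
    (fC1' : W.w₂ * t * c 0 + W.u₂ * c 1 + W.v * t ^ 5 * c 2 = 0)
    (fE1 : W.w₁ * t ^ 4 * c 0 + W.v * c 2 + W.u₁ * t ^ 5 * c 3 = 0)
    (fE1' : W.v * c 0 + W.u₁ * t ^ 5 * c 1 + W.w₁ * t ^ 4 * c 2 = 0)
    {ε : ℂ} (hε : ε = 1 ∨ ε = -1) (hab : c 0 + ε * c 2 ≠ 0 ∨ c 1 + ε * c 3 ≠ 0) :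
    (c 0 + ε * c 2) ≠ 0 ∧ (c 1 + ε * c 3) ≠ 0 ∧
    t ^ 6 * ((c 0 + ε * c 2) ^ 4 + (c 1 + ε * c 3) ^ 4)
        - (1 + t ^ 12) * (c 0 + ε * c 2) ^ 2 * (c 1 + ε * c 3) ^ 2 ≠ 0 ∧
    W.v * (t ^ 6 * ((c 0 + ε * c 2) ^ 4 + (c 1 + ε * c 3) ^ 4)
        - (1 + t ^ 12) * (c 0 + ε * c 2) ^ 2 * (c 1 + ε * c 3) ^ 2) =
      -ε * (t ^ 6 * ((c 0 + ε * c 2) ^ 4 + (c 1 + ε * c 3) ^ 4)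
        - (t ^ 4 + t ^ 8) * (c 0 + ε * c 2) ^ 2 * (c 1 + ε * c 3) ^ 2) ∧
    ε * W.u₁ * (c 0 + ε * c 2) * (c 1 + ε * c 3) * (t ^ 4 - 1) =
      t * (1 + ε * W.v) * ((c 1 + ε * c 3) ^ 2 - t ^ 2 * (c 0 + ε * c 2) ^ 2) ∧
    W.u₂ * t ^ 2 * (c 0 + ε * c 2) = -ε * W.u₁ * (c 0 + ε * c 2) - t * (1 + ε * W.v) * (c 1 + ε * c 3) ∧
    W.w₁ * t ^ 4 * (c 0 + ε * c 2) = -ε * W.v * (c 0 + ε * c 2) - ε * W.u₁ * t ^ 5 * (c 1 + ε * c 3) ∧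
    W.w₂ * t * (c 0 + ε * c 2) = -ε * W.v * t ^ 5 * (c 0 + ε * c 2) - W.u₂ * (c 1 + ε * c 3) := by
  set a := c 0 + ε * c 2 with ha_def
  set b := c 1 + ε * c 3 with hb_def
  have hε2 : ε ^ 2 = 1 := by rcases hε with rfl | rfl <;> norm_num
  -- the reduced forms
  have hL1 : t * (1 + ε * W.v) * a + (W.u₂ + ε * W.u₁ * t ^ 2) * b = 0 := by
    rw [ha_def, hb_def]; linear_combination gE + ε * gW + (W.v * t * c 2 + W.u₁ * t ^ 2 * c 3) * hε2
  have hL2 : (W.u₂ * t ^ 2 + ε * W.u₁) * a + t * (1 + ε * W.v) * b = 0 := by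
    rw [ha_def, hb_def]; linear_combination gN + ε * gS + (W.u₁ * c 2 + W.v * t * c 3) * hε2
  have hL3 : ε * W.u₂ * t ^ 5 * a + (W.v + ε * W.w₂ * t ^ 4) * b = 0 := by
    rw [ha_def, hb_def]; linear_combination fA1 + ε * fA1' + (W.u₂ * t ^ 5 * c 2 + W.w₂ * t ^ 4 * c 3) * hε2
  have hL4 : ε * W.u₁ * a + (W.w₁ * t + ε * W.v * t ^ 5) * b = 0 := by
    rw [ha_def, hb_def]; linear_combination fB1 + ε * fB1' + (W.u₁ * c 2 + W.v * t ^ 5 * c 3) * hε2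
  have hL6 : (W.v * t ^ 5 + ε * W.w₂ * t) * a + ε * W.u₂ * b = 0 := by
    rw [ha_def, hb_def]; linear_combination fC1 + ε * fC1' + (W.w₂ * t * c 2 + W.u₂ * c 3) * hε2
  have hL7 : (W.w₁ * t ^ 4 + ε * W.v) * a + ε * W.u₁ * t ^ 5 * b = 0 := by
    rw [ha_def, hb_def]; linear_combination fE1 + ε * fE1' + (W.v * c 2 + W.u₁ * t ^ 5 * c 3) * hε2
  have hεne : ε ≠ 0 := by rcases hε with rfl | rfl <;> norm_num
  -- a ≠ 0 and b ≠ 0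
  have ha : a ≠ 0 := by
    intro ha0
    have hb0 : b = 0 := by
      have h : ε * W.u₂ * b = 0 := by
        have := hL6; rw [ha0] at this; linear_combination this
      rcases mul_eq_zero.1 h with h | h
      · exact absurd h (mul_ne_zero hεne h2)
      · exact h
    rcases hab with h | h
    · exact h ha0
    · exact h hb0
  have hb : b ≠ 0 := by
    intro hb0
    have h : ε * W.u₂ * t ^ 5 * a = 0 := by
      have := hL3; rw [hb0] at this; linear_combination this
    rcases mul_eq_zero.1 h with h | h
    · rcases mul_eq_zero.1 h with h | h
      · exact mul_ne_zero hεne h2 h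
      · exact pow_ne_zero _ ht h
    · exact ha h
  -- the triangular system
  have hR1 : W.w₂ * t * a = -ε * W.v * t ^ 5 * a - W.u₂ * b := by
    linear_combination ε * hL6 - (W.w₂ * t * a + W.u₂ * b) * hε2
  have hR2 : W.w₁ * t ^ 4 * a = -ε * W.v * a - ε * W.u₁ * t ^ 5 * b := by
    linear_combination hL7
  have hR3 : W.u₂ * t ^ 2 * a = -ε * W.u₁ * a - t * (1 + ε * W.v) * b := by
    linear_combination hL2
  have hR4 : ε * W.u₁ * a * b * (t ^ 4 - 1) = t * (1 + ε * W.v) * (b ^ 2 - t ^ 2 * a ^ 2) := by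
    linear_combination t ^ 2 * a * hL1 - b * hL2
  have key : t * ((t ^ 6 * (a ^ 4 + b ^ 4) - (t ^ 4 + t ^ 8) * a ^ 2 * b ^ 2)
      + ε * W.v * (t ^ 6 * (a ^ 4 + b ^ 4) - (1 + t ^ 12) * a ^ 2 * b ^ 2)) = 0 := by
    linear_combination (t ^ 4 * a ^ 2 - t ^ 6 * b ^ 2) * hR4 - a * b * (t ^ 4 - 1) * (t ^ 4 * a) * hL4
      + a * b * (t ^ 4 - 1) * (t * b) * hL7
      + (0 : ℂ) * hε2
  have hR5 : W.v * (t ^ 6 * (a ^ 4 + b ^ 4) - (1 + t ^ 12) * a ^ 2 * b ^ 2) =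
      -ε * (t ^ 6 * (a ^ 4 + b ^ 4) - (t ^ 4 + t ^ 8) * a ^ 2 * b ^ 2) := by
    have key' := (mul_eq_zero.1 key).resolve_left ht
    linear_combination ε * key' - (W.v * (t ^ 6 * (a ^ 4 + b ^ 4) - (1 + t ^ 12) * a ^ 2 * b ^ 2)) * hε2
  -- nondegeneracy of the discriminant
  have hD : t ^ 6 * (a ^ 4 + b ^ 4) - (1 + t ^ 12) * a ^ 2 * b ^ 2 ≠ 0 := by
    intro hD
    have hN : t ^ 6 * (a ^ 4 + b ^ 4) - (t ^ 4 + t ^ 8) * a ^ 2 * b ^ 2 = 0 := by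
      have h := hR5
      rw [hD, mul_zero] at h
      have : ε * (t ^ 6 * (a ^ 4 + b ^ 4) - (t ^ 4 + t ^ 8) * a ^ 2 * b ^ 2) = 0 := by
        linear_combination h
      exact (mul_eq_zero.1 this).resolve_left hεne
    have hfac : a ^ 2 * b ^ 2 * ((t ^ 4 - 1) * (1 - t ^ 8)) = 0 := by
      linear_combination hD - hN
    have hfac' : (t ^ 4 - 1) * (1 - t ^ 8) = 0 :=
      (mul_eq_zero.1 hfac).resolve_left (mul_ne_zero (pow_ne_zero _ ha) (pow_ne_zero _ hb))
    rcases mul_eq_zero.1 hfac' with h4 | h8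
    · have : t ^ 16 = 1 := by
        have h4' : t ^ 4 = 1 := by linear_combination h4
        calc t ^ 16 = (t ^ 4) ^ 4 := by ring
          _ = 1 := by rw [h4']; norm_num
      rw [h16] at this
      norm_num at this
    · have : t ^ 16 = 1 := by
        have h8' : t ^ 8 = 1 := by linear_combination -h8
        calc t ^ 16 = (t ^ 8) ^ 2 := by ring
          _ = 1 := by rw [h8']; norm_num
      rw [h16] at this
      norm_num at this
  exact ⟨ha, hb, hD, hR5, hR4, hR3, hR2, hR1⟩


/-- `t¹⁶ = −1` excludes `t⁴ = 1`. [folklore] -/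
private theorem t_pow_four_ne_one (h16 : t ^ 16 = -1) : t ^ 4 ≠ 1 := by
  intro h4
  have : t ^ 16 = 1 := by
    calc t ^ 16 = (t ^ 4) ^ 4 := by ring
      _ = 1 := by rw [h4]; norm_num
  rw [h16] at this
  norm_num at this


/-- The four remaining adjacent-excursion forms `[N;ES]`, `[S;NW]`, `[N;WS]`, `[S;EN]` (box instances
minus the group-one rows, divided by `u₁u₂²` resp. `u₁²u₂`). [folklore] -/
private theorem forms_adj (hrel : ExactPlaquetteVertexRelation W t c) (ht : t ≠ 0) (h1 : W.u₁ ≠ 0)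
    (h2 : W.u₂ ≠ 0) :
    (W.v * t ^ 5 * c 0 + W.w₂ * t * c 2 + W.u₂ * c 3 = 0) ∧
    (W.w₂ * t * c 0 + W.u₂ * c 1 + W.v * t ^ 5 * c 2 = 0) ∧
    (W.w₁ * t ^ 4 * c 0 + W.v * c 2 + W.u₁ * t ^ 5 * c 3 = 0) ∧
    (W.v * c 0 + W.u₁ * t ^ 5 * c 1 + W.w₁ * t ^ 4 * c 2 = 0) := by
  have hIN := inst_IN hrel ht
  have hIS := inst_IS hrel ht
  have hBSEN := inst_BSEN hrel ht
  have hBNWS := inst_BNWS hrel ht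
  have hBSWN := inst_BSWN hrel ht
  have hBNES := inst_BNES hrel ht
  have m12 : W.u₁ * W.u₂ ^ 2 ≠ 0 := mul_ne_zero h1 (pow_ne_zero _ h2)
  have m21 : W.u₁ ^ 2 * W.u₂ ≠ 0 := mul_ne_zero (pow_ne_zero _ h1) h2
  refine ⟨?_, ?_, ?_, ?_⟩
  · have h : W.u₁ * W.u₂ ^ 2 * (W.v * t ^ 5 * c 0 + W.w₂ * t * c 2 + W.u₂ * c 3) = 0 := by
      linear_combination hBSEN - t * hIN
    exact (mul_eq_zero.1 h).resolve_left m12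
  · have h : W.u₁ * W.u₂ ^ 2 * (W.w₂ * t * c 0 + W.u₂ * c 1 + W.v * t ^ 5 * c 2) = 0 := by
      linear_combination hBNWS - t * hIS
    exact (mul_eq_zero.1 h).resolve_left m12
  · have h : W.u₁ ^ 2 * W.u₂ * (W.w₁ * t ^ 4 * c 0 + W.v * c 2 + W.u₁ * t ^ 5 * c 3) = 0 := by
      linear_combination hBSWN - t ^ 2 * hIN
    exact (mul_eq_zero.1 h).resolve_left m21
  · have h : W.u₁ ^ 2 * W.u₂ * (W.v * c 0 + W.u₁ * t ^ 5 * c 1 + W.w₁ * t ^ 4 * c 2) = 0 := by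
      linear_combination hBNES - t ^ 2 * hIS
    exact (mul_eq_zero.1 h).resolve_left m21

/-- The four remaining adjacent-excursion forms from the INTERIOR-faces class. [folklore] -/
private theorem forms_adjInt (hrel : ExactPlaquetteVertexRelationInt W t c) (ht : t ≠ 0)
    (h1 : W.u₁ ≠ 0) (h2 : W.u₂ ≠ 0) (hv : W.v ≠ 0) :
    (W.v * t ^ 5 * c 0 + W.w₂ * t * c 2 + W.u₂ * c 3 = 0) ∧
    (W.w₂ * t * c 0 + W.u₂ * c 1 + W.v * t ^ 5 * c 2 = 0) ∧
    (W.w₁ * t ^ 4 * c 0 + W.v * c 2 + W.u₁ * t ^ 5 * c 3 = 0) ∧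
    (W.v * c 0 + W.u₁ * t ^ 5 * c 1 + W.w₁ * t ^ 4 * c 2 = 0) := by
  have hIN := inst_JN hrel ht hv
  have hIS := inst_JS hrel ht hv
  have hBSEN := inst_CSEN hrel ht hv
  have hBNWS := inst_CNWS hrel ht hv
  have hBSWN := inst_CSWN hrel ht hv
  have hBNES := inst_CNES hrel ht hv
  have m12 : W.u₁ * W.u₂ ^ 2 ≠ 0 := mul_ne_zero h1 (pow_ne_zero _ h2)
  have m21 : W.u₁ ^ 2 * W.u₂ ≠ 0 := mul_ne_zero (pow_ne_zero _ h1) h2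
  refine ⟨?_, ?_, ?_, ?_⟩
  · have h : W.u₁ * W.u₂ ^ 2 * (W.v * t ^ 5 * c 0 + W.w₂ * t * c 2 + W.u₂ * c 3) = 0 := by
      linear_combination hBSEN - t * hIN
    exact (mul_eq_zero.1 h).resolve_left m12
  · have h : W.u₁ * W.u₂ ^ 2 * (W.w₂ * t * c 0 + W.u₂ * c 1 + W.v * t ^ 5 * c 2) = 0 := by
      linear_combination hBNWS - t * hIS
    exact (mul_eq_zero.1 h).resolve_left m12
  · have h : W.u₁ ^ 2 * W.u₂ * (W.w₁ * t ^ 4 * c 0 + W.v * c 2 + W.u₁ * t ^ 5 * c 3) = 0 := by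
      linear_combination hBSWN - t ^ 2 * hIN
    exact (mul_eq_zero.1 h).resolve_left m21
  · have h : W.u₁ ^ 2 * W.u₂ * (W.v * c 0 + W.u₁ * t ^ 5 * c 1 + W.w₁ * t ^ 4 * c 2) = 0 := by
      linear_combination hBNES - t ^ 2 * hIS
    exact (mul_eq_zero.1 h).resolve_left m21

/-- **Weight rigidity.** If the plaquette walk with weights `u₁ u₂ v ≠ 0` and phase `t ≠ 0` satisfies an
exact vertex relation with a nonzero coefficient vector `c` on every finite domain, then for a sign
`ε = ±1` the `ρ²`-eigencomponent `(a, b) = (c_E + ε c_W, c_N + ε c_S)` has `a ≠ 0`, `b ≠ 0`,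
`t⁶(a⁴ + b⁴) − (1 + t¹²) a² b² ≠ 0`, and the weights satisfy the triangular system
`v (t⁶(a⁴+b⁴) − (1+t¹²)a²b²) = −ε (t⁶(a⁴+b⁴) − (t⁴+t⁸)a²b²)`, `ε u₁ a b (t⁴−1) = t(1+εv)(b² − t²a²)`,
`u₂ t² a = −ε u₁ a − t(1+εv) b`, `w₁ t⁴ a = −ε v a − ε u₁ t⁵ b`, `w₂ t a = −ε v t⁵ a − u₂ b` —
so `v, u₁, u₂, w₁, w₂` are successively DETERMINED by `(ε, t, a : b)` (cf. `weights_eq_ybCurve`).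
The square-lattice, free-coefficient form of the uniqueness clause of Glazman's Lemma 3.1, for
arbitrary complex weights. [cite: Glazman2015WeightedSAW, Lemma 3.1 (uniqueness of the weights at σ = ℓ/8: Nienhuis' weights)] [cite: IkhlefCardy2009, §3 (the linear system for the Boltzmann weights and its solution)] -/
theorem weight_rigidity (hrel : ExactPlaquetteVertexRelation W t c) (ht : t ≠ 0) (h1 : W.u₁ ≠ 0)
    (h2 : W.u₂ ≠ 0) (hv : W.v ≠ 0) (hc : c ≠ 0) :
    ∃ ε : ℂ, (ε = 1 ∨ ε = -1) ∧
      (c 0 + ε * c 2) ≠ 0 ∧ (c 1 + ε * c 3) ≠ 0 ∧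
      t ^ 6 * ((c 0 + ε * c 2) ^ 4 + (c 1 + ε * c 3) ^ 4)
          - (1 + t ^ 12) * (c 0 + ε * c 2) ^ 2 * (c 1 + ε * c 3) ^ 2 ≠ 0 ∧
      W.v * (t ^ 6 * ((c 0 + ε * c 2) ^ 4 + (c 1 + ε * c 3) ^ 4)
          - (1 + t ^ 12) * (c 0 + ε * c 2) ^ 2 * (c 1 + ε * c 3) ^ 2) =
        -ε * (t ^ 6 * ((c 0 + ε * c 2) ^ 4 + (c 1 + ε * c 3) ^ 4)
          - (t ^ 4 + t ^ 8) * (c 0 + ε * c 2) ^ 2 * (c 1 + ε * c 3) ^ 2) ∧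
      ε * W.u₁ * (c 0 + ε * c 2) * (c 1 + ε * c 3) * (t ^ 4 - 1) =
        t * (1 + ε * W.v) * ((c 1 + ε * c 3) ^ 2 - t ^ 2 * (c 0 + ε * c 2) ^ 2) ∧
      W.u₂ * t ^ 2 * (c 0 + ε * c 2) =
        -ε * W.u₁ * (c 0 + ε * c 2) - t * (1 + ε * W.v) * (c 1 + ε * c 3) ∧
      W.w₁ * t ^ 4 * (c 0 + ε * c 2) =
        -ε * W.v * (c 0 + ε * c 2) - ε * W.u₁ * t ^ 5 * (c 1 + ε * c 3) ∧
      W.w₂ * t * (c 0 + ε * c 2) = -ε * W.v * t ^ 5 * (c 0 + ε * c 2) - W.u₂ * (c 1 + ε * c 3) := by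
  have h16 := t_pow_sixteen_of_exactPlaquetteVertexRelation hrel ht h1 h2 hv hc
  obtain ⟨fA1, fA1', fB1, fB1', -, -⟩ := forms hrel ht h1 h2 hv
  obtain ⟨fC1, fC1', fE1, fE1'⟩ := forms_adj hrel ht h1 h2
  obtain ⟨ε, hε, hab⟩ := exists_eps_component_ne_zero hc
  exact ⟨ε, hε, rigidity_of_forms ht h2 h16 (inst_IE hrel ht) (inst_IN hrel ht) (inst_IW hrel ht)
    (inst_IS hrel ht) fA1 fA1' fB1 fB1' fC1 fC1' fE1 fE1' hε hab⟩

/-- **Weight rigidity from the interior-faces class** (Duminil-Copin–Smirnov's quantifier): the same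
conclusion as `weight_rigidity` when the relation is assumed only at interior faces.
[cite: Glazman2015WeightedSAW, Lemma 3.1 (uniqueness of the weights at σ = ℓ/8)] [cite: DuminilCopinSmirnov2012, Lemma 1 (shape of the relation)] -/
theorem weight_rigidityInt (hrel : ExactPlaquetteVertexRelationInt W t c) (ht : t ≠ 0) (h1 : W.u₁ ≠ 0)
    (h2 : W.u₂ ≠ 0) (hv : W.v ≠ 0) (hc : c ≠ 0) :
    ∃ ε : ℂ, (ε = 1 ∨ ε = -1) ∧
      (c 0 + ε * c 2) ≠ 0 ∧ (c 1 + ε * c 3) ≠ 0 ∧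
      t ^ 6 * ((c 0 + ε * c 2) ^ 4 + (c 1 + ε * c 3) ^ 4)
          - (1 + t ^ 12) * (c 0 + ε * c 2) ^ 2 * (c 1 + ε * c 3) ^ 2 ≠ 0 ∧
      W.v * (t ^ 6 * ((c 0 + ε * c 2) ^ 4 + (c 1 + ε * c 3) ^ 4)
          - (1 + t ^ 12) * (c 0 + ε * c 2) ^ 2 * (c 1 + ε * c 3) ^ 2) =
        -ε * (t ^ 6 * ((c 0 + ε * c 2) ^ 4 + (c 1 + ε * c 3) ^ 4)
          - (t ^ 4 + t ^ 8) * (c 0 + ε * c 2) ^ 2 * (c 1 + ε * c 3) ^ 2) ∧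
      ε * W.u₁ * (c 0 + ε * c 2) * (c 1 + ε * c 3) * (t ^ 4 - 1) =
        t * (1 + ε * W.v) * ((c 1 + ε * c 3) ^ 2 - t ^ 2 * (c 0 + ε * c 2) ^ 2) ∧
      W.u₂ * t ^ 2 * (c 0 + ε * c 2) =
        -ε * W.u₁ * (c 0 + ε * c 2) - t * (1 + ε * W.v) * (c 1 + ε * c 3) ∧
      W.w₁ * t ^ 4 * (c 0 + ε * c 2) =
        -ε * W.v * (c 0 + ε * c 2) - ε * W.u₁ * t ^ 5 * (c 1 + ε * c 3) ∧
      W.w₂ * t * (c 0 + ε * c 2) = -ε * W.v * t ^ 5 * (c 0 + ε * c 2) - W.u₂ * (c 1 + ε * c 3) := by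
  have h16 := t_pow_sixteen_of_exactPlaquetteVertexRelationInt hrel ht h1 h2 hv hc
  obtain ⟨fA1, fA1', fB1, fB1', -, -⟩ := formsInt hrel ht h1 h2 hv
  obtain ⟨fC1, fC1', fE1, fE1'⟩ := forms_adjInt hrel ht h1 h2 hv
  obtain ⟨ε, hε, hab⟩ := exists_eps_component_ne_zero hc
  exact ⟨ε, hε, rigidity_of_forms ht h2 h16 (inst_JE hrel ht hv) (inst_JN hrel ht hv) (inst_JW hrel ht hv)
    (inst_JS hrel ht hv) fA1 fA1' fB1 fB1' fC1 fC1' fE1 fE1' hε hab⟩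

/-- **The Yang–Baxter curve in coefficient coordinates**, straight-arc weight: for a sign `ε = ±1`, a
phase `t` and the coefficient ratio `r = (c_N + ε c_S)/(c_E + ε c_W)`,
`v = −ε (t⁶(1 + r⁴) − (t⁴ + t⁸) r²) / (t⁶(1 + r⁴) − (1 + t¹²) r²)`. [folklore] -/
def ybV (ε t r : ℂ) : ℂ :=
  -ε * (t ^ 6 * (1 + r ^ 4) - (t ^ 4 + t ^ 8) * r ^ 2) / (t ^ 6 * (1 + r ^ 4) - (1 + t ^ 12) * r ^ 2)

/-- The Yang–Baxter curve in coefficient coordinates, corner weight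
`u₁ = t (1 + ε v)(r² − t²) / (ε r (t⁴ − 1))`. [folklore] -/
def ybU1 (ε t r : ℂ) : ℂ := t * (1 + ε * ybV ε t r) * (r ^ 2 - t ^ 2) / (ε * r * (t ^ 4 - 1))

/-- The Yang–Baxter curve in coefficient coordinates, co-corner weight
`u₂ = (−ε u₁ − t(1 + ε v) r) / t²`. [folklore] -/
def ybU2 (ε t r : ℂ) : ℂ := (-ε * ybU1 ε t r - t * (1 + ε * ybV ε t r) * r) / t ^ 2

/-- The Yang–Baxter curve in coefficient coordinates, two-corner weight
`w₁ = (−ε v − ε u₁ t⁵ r) / t⁴`. [folklore] -/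
def ybW1 (ε t r : ℂ) : ℂ := (-ε * ybV ε t r - ε * ybU1 ε t r * t ^ 5 * r) / t ^ 4

/-- The Yang–Baxter curve in coefficient coordinates, two-co-corner weight
`w₂ = (−ε v t⁵ − u₂ r) / t`. [folklore] -/
def ybW2 (ε t r : ℂ) : ℂ := (-ε * ybV ε t r * t ^ 5 - ybU2 ε t r * r) / t

/-- **The Yang–Baxter curve in coefficient coordinates**: the weight system
`(u₁, u₂, v, w₁, w₂)(ε, t, r)`. [folklore] -/
def ybCurve (ε t r : ℂ) : CWeights := ⟨ybU1 ε t r, ybU2 ε t r, ybV ε t r, ybW1 ε t r, ybW2 ε t r⟩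

/-- From the triangular system to the closed form: the weights ARE the point `ybCurve ε t (b/a)`.
[folklore] -/
private theorem eq_ybCurve_of_system {ε a b : ℂ} (ht : t ≠ 0) (ht4 : t ^ 4 ≠ 1) (hε : ε ≠ 0)
    (ha : a ≠ 0) (hb : b ≠ 0)
    (hD : t ^ 6 * (a ^ 4 + b ^ 4) - (1 + t ^ 12) * a ^ 2 * b ^ 2 ≠ 0)
    (hR5 : W.v * (t ^ 6 * (a ^ 4 + b ^ 4) - (1 + t ^ 12) * a ^ 2 * b ^ 2) =
      -ε * (t ^ 6 * (a ^ 4 + b ^ 4) - (t ^ 4 + t ^ 8) * a ^ 2 * b ^ 2))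
    (hR4 : ε * W.u₁ * a * b * (t ^ 4 - 1) = t * (1 + ε * W.v) * (b ^ 2 - t ^ 2 * a ^ 2))
    (hR3 : W.u₂ * t ^ 2 * a = -ε * W.u₁ * a - t * (1 + ε * W.v) * b)
    (hR2 : W.w₁ * t ^ 4 * a = -ε * W.v * a - ε * W.u₁ * t ^ 5 * b)
    (hR1 : W.w₂ * t * a = -ε * W.v * t ^ 5 * a - W.u₂ * b) :
    W = ybCurve ε t (b / a) := by
  set r := b / a with hr
  have hbr : b = r * a := by rw [hr]; field_simp
  have hrne : r ≠ 0 := div_ne_zero hb ha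
  have ht41 : t ^ 4 - 1 ≠ 0 := sub_ne_zero.2 ht4
  have hD1 : t ^ 6 * (1 + r ^ 4) - (1 + t ^ 12) * r ^ 2 ≠ 0 := by
    intro h0
    apply hD
    have : t ^ 6 * (a ^ 4 + b ^ 4) - (1 + t ^ 12) * a ^ 2 * b ^ 2 =
        a ^ 4 * (t ^ 6 * (1 + r ^ 4) - (1 + t ^ 12) * r ^ 2) := by rw [hbr]; ring
    rw [this, h0, mul_zero]
  have hv : W.v = ybV ε t r := by
    unfold ybV
    rw [eq_div_iff hD1]
    have ha4 : a ^ 4 ≠ 0 := pow_ne_zero _ ha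
    apply mul_left_cancel₀ ha4
    rw [hbr] at hR5
    linear_combination hR5
  have hu1 : W.u₁ = ybU1 ε t r := by
    unfold ybU1
    rw [← hv, eq_div_iff (mul_ne_zero (mul_ne_zero hε hrne) ht41)]
    have ha2 : a ^ 2 ≠ 0 := pow_ne_zero _ ha
    apply mul_left_cancel₀ ha2
    rw [hbr] at hR4
    linear_combination hR4
  have hu2 : W.u₂ = ybU2 ε t r := by
    unfold ybU2
    rw [← hv, ← hu1, eq_div_iff (pow_ne_zero _ ht)]
    apply mul_left_cancel₀ ha
    rw [hbr] at hR3
    linear_combination hR3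
  have hw1 : W.w₁ = ybW1 ε t r := by
    unfold ybW1
    rw [← hv, ← hu1, eq_div_iff (pow_ne_zero _ ht)]
    apply mul_left_cancel₀ ha
    rw [hbr] at hR2
    linear_combination hR2
  have hw2 : W.w₂ = ybW2 ε t r := by
    unfold ybW2
    rw [← hv, ← hu2, eq_div_iff ht]
    apply mul_left_cancel₀ ha
    rw [hbr] at hR1
    linear_combination hR1
  obtain ⟨u1, u2, v, w1, w2⟩ := W
  simp only at hv hu1 hu2 hw1 hw2
  rw [ybCurve, hu1, hu2, hv, hw1, hw2]


/-- **The weights lie on the Yang–Baxter curve in coefficient coordinates**: under the hypotheses of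
`weight_rigidity`, `W = ybCurve ε t r` with `ε = ±1` and `r = (c_N + ε c_S)/(c_E + ε c_W)`.
[cite: Glazman2015WeightedSAW, Lemma 3.1 (uniqueness of the weights at σ = ℓ/8)] [cite: GlazmanManolescu2019, eq. (1) (the Yang–Baxter weights)] -/
theorem weights_eq_ybCurve (hrel : ExactPlaquetteVertexRelation W t c) (ht : t ≠ 0) (h1 : W.u₁ ≠ 0)
    (h2 : W.u₂ ≠ 0) (hv : W.v ≠ 0) (hc : c ≠ 0) :
    ∃ ε : ℂ, (ε = 1 ∨ ε = -1) ∧ c 0 + ε * c 2 ≠ 0 ∧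
      W = ybCurve ε t ((c 1 + ε * c 3) / (c 0 + ε * c 2)) := by
  have h16 := t_pow_sixteen_of_exactPlaquetteVertexRelation hrel ht h1 h2 hv hc
  obtain ⟨ε, hε, ha, hb, hD, hR5, hR4, hR3, hR2, hR1⟩ := weight_rigidity hrel ht h1 h2 hv hc
  have hεne : ε ≠ 0 := by rcases hε with rfl | rfl <;> norm_num
  exact ⟨ε, hε, ha, eq_ybCurve_of_system ht (t_pow_four_ne_one h16) hεne ha hb hD hR5 hR4 hR3 hR2 hR1⟩

/-- **The weights lie on the Yang–Baxter curve** (interior-faces class). [cite: Glazman2015WeightedSAW, Lemma 3.1 (uniqueness of the weights at σ = ℓ/8)] [cite: DuminilCopinSmirnov2012, Lemma 1 (shape of the relation)] -/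
theorem weights_eq_ybCurveInt (hrel : ExactPlaquetteVertexRelationInt W t c) (ht : t ≠ 0)
    (h1 : W.u₁ ≠ 0) (h2 : W.u₂ ≠ 0) (hv : W.v ≠ 0) (hc : c ≠ 0) :
    ∃ ε : ℂ, (ε = 1 ∨ ε = -1) ∧ c 0 + ε * c 2 ≠ 0 ∧
      W = ybCurve ε t ((c 1 + ε * c 3) / (c 0 + ε * c 2)) := by
  have h16 := t_pow_sixteen_of_exactPlaquetteVertexRelationInt hrel ht h1 h2 hv hc
  obtain ⟨ε, hε, ha, hb, hD, hR5, hR4, hR3, hR2, hR1⟩ := weight_rigidityInt hrel ht h1 h2 hv hc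
  have hεne : ε ≠ 0 := by rcases hε with rfl | rfl <;> norm_num
  exact ⟨ε, hε, ha, eq_ybCurve_of_system ht (t_pow_four_ne_one h16) hεne ha hb hD hR5 hR4 hR3 hR2 hR1⟩


/-- **Barrier `PlaquetteWalkWeightRigidity`** («YB completeness», algebraic form; Duminil-Copin–Smirnov's
interior-faces quantifier). For the five-weight plaquette walk on `ℤ²` with complex weights
`u₁ u₂ v ≠ 0` and phase `t ≠ 0` per left quarter turn: if some nonzero vertex-independent coefficient
vector `c` gives an exact vertex relation at the interior faces of every finite domain, then for a sign
`ε = ±1` with `c_E + ε c_W ≠ 0` the weight system IS the point `ybCurve ε t r`,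
`r = (c_N + ε c_S)/(c_E + ε c_W)`, of an explicit rational curve — the weights are determined by the
coefficients (and `t¹⁶ = −1` by `PlaquetteWalkSpinRigidityInt`).

BARRIER (structured block, D-0021):
- technique_class: discrete-holomorphicity parafermionic-observable exact-local-relation plaquette-walk free-weights — `ExactPlaquetteVertexRelationInt W t c` with `u₁u₂v ≠ 0`, `c ≠ 0`
- blocks: any exact vertex identity for a square-lattice `O(0)`-type walk whose weights are NOT on one of the `2 × 16` rational curves `{ybCurve ε t r}` (`ε = ±1`, `t¹⁶ = −1`); in particular any second, independent identity at given `(ε, t, r)`, and any continuous deformation of the weights at fixed coefficients [cite: Glazman2015WeightedSAW, Lemma 3.1] [cite: IkhlefCardy2009, §3]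
- because: printed: at `σ = ℓ/8` the weights solving the local linear system are unique (Nienhuis' weights) [cite: Glazman2015WeightedSAW, Lemma 3.1]; the local linear system and its solution [cite: IkhlefCardy2009, §3]; this file: fourteen (+ fourteen interior) kernel-certified instances give the group-one rows and eight adjacent-excursion forms with free weights; on a `ρ²`-eigencomponent `(a, b)` they reduce to six linear equations whose elimination is the triangular system of `weight_rigidityInt` with non-vanishing discriminant (`t¹⁶ = −1` excludes `t⁴ = 1`, `t⁸ = 1`) [cite: Glazman2015WeightedSAW, Lemma 3.1 (proof: the local linear system)]
- evasions_known: `v = 0` (Glazman's degenerate family, Ikhlef–Cardy's `n = 1` / `s = −1` classes) [cite: Glazman2015WeightedSAW, Lemma 3.1] [cite: IkhlefCardy2009, §3]; `u₁ = 0` or `u₂ = 0`; position-dependent weights/coefficients (column-dependent `θ_k`) [cite: IkhlefWestonWheelerZinnJustin2013, §4.2.1]; remainder terms and multi-face stencils (not treated)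
- scope_caveats: (a) NECESSITY only: which points of the curves carry identities on ALL domains is not decided here — the printed Yang–Baxter family `W(θ)` (`ε = −1`, `t = e^{−5iπ/16}`, `r = e^{i(3θ/8+5π/16)}`; identification checked numerically by the lane, not formalised) carries them on Glazman–Manolescu rectangles (`YangBaxterSAWSquareLattice.sqParafermion_relation`); (b) complex weights and coefficients, no positivity; (c) the sixteen local forms are consequences of the relation on fourteen explicit domains of ≤ 6 faces — nothing is claimed about larger stencils; (d) a coefficient vector with both `ρ²`-components nonzero puts the weights on two curves at once (not excluded, not observed)
- status: established — `PlaquetteWalkWeightRigidity_holds` (this file, axioms standard); printed counterpart (uniqueness at `σ = ℓ/8`, rhombic frame) [cite: Glazman2015WeightedSAW, Lemma 3.1]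

[cite: Glazman2015WeightedSAW, Lemma 3.1] [cite: DuminilCopinSmirnov2012, Lemma 1 (shape of the relation)] -/
def _root_.Literature.Barriers.CriticalPhenomena.PlaquetteWalkWeightRigidity : Prop :=
  ∀ (W : CWeights) (t : ℂ) (c : Fin 4 → ℂ), t ≠ 0 → W.u₁ ≠ 0 → W.u₂ ≠ 0 → W.v ≠ 0 → c ≠ 0 →
    ExactPlaquetteVertexRelationInt W t c →
      ∃ ε : ℂ, (ε = 1 ∨ ε = -1) ∧ c 0 + ε * c 2 ≠ 0 ∧
        W = ybCurve ε t ((c 1 + ε * c 3) / (c 0 + ε * c 2))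

/-- Discharge of the barrier statement `PlaquetteWalkWeightRigidity`. [cite: Glazman2015WeightedSAW, Lemma 3.1] -/
theorem _root_.Literature.Barriers.CriticalPhenomena.PlaquetteWalkWeightRigidity_holds :
    PlaquetteWalkWeightRigidity :=
  fun _ _ _ ht h1 h2 hv hc hrel => weights_eq_ybCurveInt hrel ht h1 h2 hv hc

end WeightRigidity

/-! ### Appended: the `v = 0` branch — Glazman's degenerate family (the other half of the dichotomy)

Glazman's Lemma 3.1 is a DICHOTOMY: "either `v = 0` or `σ = ℓ/8`"; for `σ = 1` (so `v = 0`) the weights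
form the degenerate family `u₁ + u₂ = 1`, `w₁ = u₁`, `w₂ = u₂`; Ikhlef–Cardy §3 lists the `v = 0`
classes. `PlaquetteWalkSpinRigidity` / `PlaquetteWalkWeightRigidity` treat `v ≠ 0`; this section treats
`v = 0` (with `u₁u₂ ≠ 0`) for the all-faces class: the group-one rows and the adjacent-excursion forms
(which need no division by `v`) force, on a nonzero `ρ²`-eigencomponent `(a, b)`, `a ≠ 0`, `b ≠ 0`,
**`t⁴ = 1`** (`σ ∈ ℤ`), **`b² = t²a²`**, and the LINE `u₂ t² a = −ε u₁ a − t b`, `w₁ a = −ε u₁ t b`,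
`w₂ t a = −u₂ b` (`degenerate_rigidity`): with `b = s t a`, `s = ±1`, this is `u₂ = −s − ε t² u₁`,
`w₁ = −ε s t² u₁`, `w₂ = −s u₂` — one free weight `u₁`; the member `s = −1`, `ε t² = 1` is the printed
family `u₁ + u₂ = 1`, `w₁ = u₁`, `w₂ = u₂`, the others its sign companions. Together with the `v ≠ 0`
half this gives `exactPlaquetteVertexRelation_dichotomy`. -/

section DegenerateBranch

variable {W : CWeights} {t : ℂ} {c : Fin 4 → ℂ}

/-- The four adjacent-excursion forms `[E;NW]`, `[W;ES]`, `[E;WS]`, `[W;EN]` without the hypothesis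
`v ≠ 0` (the proofs of `forms` for these four divide by `u₁u₂²`, `u₁²u₂` only). [folklore] -/
private theorem forms_adjE (hrel : ExactPlaquetteVertexRelation W t c) (ht : t ≠ 0) (h1 : W.u₁ ≠ 0)
    (h2 : W.u₂ ≠ 0) :
    (W.v * c 1 + W.u₂ * t ^ 5 * c 2 + W.w₂ * t ^ 4 * c 3 = 0) ∧
    (W.u₂ * t ^ 5 * c 0 + W.w₂ * t ^ 4 * c 1 + W.v * c 3 = 0) ∧
    (W.w₁ * t * c 1 + W.u₁ * c 2 + W.v * t ^ 5 * c 3 = 0) ∧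
    (W.u₁ * c 0 + W.v * t ^ 5 * c 1 + W.w₁ * t * c 3 = 0) := by
  have hIE := inst_IE hrel ht
  have hIW := inst_IW hrel ht
  have hBNWE := inst_BNWE hrel ht
  have hBSEW := inst_BSEW hrel ht
  have hBSWE := inst_BSWE hrel ht
  have hBNEW := inst_BNEW hrel ht
  have m12 : W.u₁ * W.u₂ ^ 2 ≠ 0 := mul_ne_zero h1 (pow_ne_zero _ h2)
  have m21 : W.u₁ ^ 2 * W.u₂ ≠ 0 := mul_ne_zero (pow_ne_zero _ h1) h2
  refine ⟨?_, ?_, ?_, ?_⟩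
  · have h : W.u₁ * W.u₂ ^ 2 * (W.v * c 1 + W.u₂ * t ^ 5 * c 2 + W.w₂ * t ^ 4 * c 3) = 0 := by
      linear_combination hBNWE - t ^ 2 * hIE
    exact (mul_eq_zero.1 h).resolve_left m12
  · have h : W.u₁ * W.u₂ ^ 2 * (W.u₂ * t ^ 5 * c 0 + W.w₂ * t ^ 4 * c 1 + W.v * c 3) = 0 := by
      linear_combination hBSEW - t ^ 2 * hIW
    exact (mul_eq_zero.1 h).resolve_left m12
  · have h : W.u₁ ^ 2 * W.u₂ * (W.w₁ * t * c 1 + W.u₁ * c 2 + W.v * t ^ 5 * c 3) = 0 := by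
      linear_combination hBSWE - t * hIE
    exact (mul_eq_zero.1 h).resolve_left m21
  · have h : W.u₁ ^ 2 * W.u₂ * (W.u₁ * c 0 + W.v * t ^ 5 * c 1 + W.w₁ * t * c 3) = 0 := by
      linear_combination hBNEW - t * hIW
    exact (mul_eq_zero.1 h).resolve_left m21

/-- **The algebraic core of the `v = 0` branch.** From the group-one rows and the six adjacent-excursion
forms with `v = 0`, for an `ε`-eigencomponent `(a, b) ≠ 0` and `u₁ u₂ ≠ 0`: `a ≠ 0`, `b ≠ 0`, `t⁴ = 1`,
`b² = t² a²`, and `u₂ t² a = −ε u₁ a − t b`, `w₁ a = −ε u₁ t b`, `w₂ t a = −u₂ b`. [folklore] -/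
private theorem degenerate_of_forms (ht : t ≠ 0) (h1 : W.u₁ ≠ 0) (h2 : W.u₂ ≠ 0) (hv : W.v = 0)
    (gN : c 1 * t + c 2 * W.u₁ + c 0 * W.u₂ * t ^ 2 + c 3 * W.v * t = 0)
    (gS : c 3 * t + c 2 * W.u₂ * t ^ 2 + c 0 * W.u₁ + c 1 * W.v * t = 0)
    (fA1 : W.v * c 1 + W.u₂ * t ^ 5 * c 2 + W.w₂ * t ^ 4 * c 3 = 0)
    (fA1' : W.u₂ * t ^ 5 * c 0 + W.w₂ * t ^ 4 * c 1 + W.v * c 3 = 0)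
    (fB1 : W.w₁ * t * c 1 + W.u₁ * c 2 + W.v * t ^ 5 * c 3 = 0)
    (fB1' : W.u₁ * c 0 + W.v * t ^ 5 * c 1 + W.w₁ * t * c 3 = 0)
    (fC1 : W.v * t ^ 5 * c 0 + W.w₂ * t * c 2 + W.u₂ * c 3 = 0)
    (fC1' : W.w₂ * t * c 0 + W.u₂ * c 1 + W.v * t ^ 5 * c 2 = 0)
    (fE1 : W.w₁ * t ^ 4 * c 0 + W.v * c 2 + W.u₁ * t ^ 5 * c 3 = 0)
    (fE1' : W.v * c 0 + W.u₁ * t ^ 5 * c 1 + W.w₁ * t ^ 4 * c 2 = 0)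
    {ε : ℂ} (hε : ε = 1 ∨ ε = -1) (hab : c 0 + ε * c 2 ≠ 0 ∨ c 1 + ε * c 3 ≠ 0) :
    (c 0 + ε * c 2) ≠ 0 ∧ (c 1 + ε * c 3) ≠ 0 ∧ t ^ 4 = 1 ∧
    (c 1 + ε * c 3) ^ 2 = t ^ 2 * (c 0 + ε * c 2) ^ 2 ∧
    W.u₂ * t ^ 2 * (c 0 + ε * c 2) = -ε * W.u₁ * (c 0 + ε * c 2) - t * (c 1 + ε * c 3) ∧
    W.w₁ * (c 0 + ε * c 2) = -ε * W.u₁ * t * (c 1 + ε * c 3) ∧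
    W.w₂ * t * (c 0 + ε * c 2) = -W.u₂ * (c 1 + ε * c 3) := by
  set a := c 0 + ε * c 2 with ha_def
  set b := c 1 + ε * c 3 with hb_def
  have hε2 : ε ^ 2 = 1 := by rcases hε with rfl | rfl <;> norm_num
  have hεne : ε ≠ 0 := by rcases hε with rfl | rfl <;> norm_num
  -- reduced forms with v = 0
  have hL2 : (W.u₂ * t ^ 2 + ε * W.u₁) * a + t * b = 0 := by
    rw [ha_def, hb_def]
    linear_combination gN + ε * gS + (W.u₁ * c 2) * hε2 - (c 3 * t + ε * (c 1 * t)) * hv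
  have hL3 : ε * W.u₂ * t ^ 5 * a + (ε * W.w₂ * t ^ 4) * b = 0 := by
    rw [ha_def, hb_def]
    linear_combination fA1 + ε * fA1' + (W.u₂ * t ^ 5 * c 2 + W.w₂ * t ^ 4 * c 3) * hε2 - (c 1 + ε * c 3) * hv
  have hL4 : ε * W.u₁ * a + (W.w₁ * t) * b = 0 := by
    rw [ha_def, hb_def]
    linear_combination fB1 + ε * fB1' + (W.u₁ * c 2) * hε2 - (t ^ 5 * c 3 + ε * (t ^ 5 * c 1)) * hv
  have hL6 : (ε * W.w₂ * t) * a + ε * W.u₂ * b = 0 := by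
    rw [ha_def, hb_def]
    linear_combination fC1 + ε * fC1' + (W.w₂ * t * c 2 + W.u₂ * c 3) * hε2 - (t ^ 5 * c 0 + ε * (t ^ 5 * c 2)) * hv
  have hL7 : (W.w₁ * t ^ 4) * a + ε * W.u₁ * t ^ 5 * b = 0 := by
    rw [ha_def, hb_def]
    linear_combination fE1 + ε * fE1' + (W.u₁ * t ^ 5 * c 3) * hε2 - (c 2 + ε * c 0) * hv
  -- a ≠ 0, b ≠ 0
  have ha : a ≠ 0 := by
    intro ha0
    have hb0 : b = 0 := by
      have h : ε * W.u₂ * b = 0 := by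
        have := hL6; rw [ha0] at this; linear_combination this
      rcases mul_eq_zero.1 h with h | h
      · exact absurd h (mul_ne_zero hεne h2)
      · exact h
    rcases hab with h | h
    · exact h ha0
    · exact h hb0
  have hb : b ≠ 0 := by
    intro hb0
    have h : ε * W.u₂ * t ^ 5 * a = 0 := by
      have := hL3; rw [hb0] at this; linear_combination this
    rcases mul_eq_zero.1 h with h | h
    · rcases mul_eq_zero.1 h with h | h
      · exact mul_ne_zero hεne h2 h
      · exact pow_ne_zero _ ht h
    · exact ha h
  -- the relations
  have hR1 : W.w₂ * t * a = -W.u₂ * b := by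
    linear_combination ε * hL6 - (W.w₂ * t * a + W.u₂ * b) * hε2
  have hR3 : W.u₂ * t ^ 2 * a = -ε * W.u₁ * a - t * b := by
    linear_combination hL2
  have hbt : b ^ 2 = t ^ 2 * a ^ 2 := by
    -- from L3 × a and L6 × t³ b: u₂ t³ (t² a² − b²) = 0
    have h : ε * W.u₂ * t ^ 3 * (t ^ 2 * a ^ 2 - b ^ 2) = 0 := by
      linear_combination a * hL3 - t ^ 3 * b * hL6
    have hne : ε * W.u₂ * t ^ 3 ≠ 0 := mul_ne_zero (mul_ne_zero hεne h2) (pow_ne_zero _ ht)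
    have := (mul_eq_zero.1 h).resolve_left hne
    linear_combination -this
  have ht4 : t ^ 4 = 1 := by
    -- from L4 × t³ a and L7 × b: u₁ t³ (a² − t² b²) = 0, then combine with b² = t² a²
    have h : ε * W.u₁ * t ^ 3 * (a ^ 2 - t ^ 2 * b ^ 2) = 0 := by
      linear_combination t ^ 3 * a * hL4 - b * hL7
    have hne : ε * W.u₁ * t ^ 3 ≠ 0 := mul_ne_zero (mul_ne_zero hεne h1) (pow_ne_zero _ ht)
    have h' := (mul_eq_zero.1 h).resolve_left hne
    have h'' : a ^ 2 * (1 - t ^ 4) = 0 := by linear_combination h' + t ^ 2 * hbt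
    have := (mul_eq_zero.1 h'').resolve_left (pow_ne_zero _ ha)
    linear_combination -this
  have hR2 : W.w₁ * a = -ε * W.u₁ * t * b := by
    -- L7: w₁ t⁴ a + ε u₁ t⁵ b = 0 with t⁴ = 1
    linear_combination hL7 + (-(W.w₁ * a) - ε * W.u₁ * t * b) * ht4
  exact ⟨ha, hb, ht4, hbt, hR3, hR2, hR1⟩


/-- **Degenerate (`v = 0`) rigidity.** If the plaquette walk with `v = 0` (no straight passages),
`u₁ u₂ ≠ 0` and phase `t ≠ 0` satisfies an exact vertex relation with a nonzero coefficient vector on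
every finite domain, then `t⁴ = 1` (integer spin) and, for a sign `ε = ±1` with nonzero `ρ²`-eigencomponent
`(a, b) = (c_E + ε c_W, c_N + ε c_S)`: `a ≠ 0`, `b ≠ 0`, `b² = t² a²`, and the weights lie on the line
`u₂ t² a = −ε u₁ a − t b`, `w₁ a = −ε u₁ t b`, `w₂ t a = −u₂ b` — Glazman's degenerate family
`u₁ + u₂ = 1`, `w₁ = u₁`, `w₂ = u₂` and its sign companions. [cite: Glazman2015WeightedSAW, Lemma 3.1 (σ = 1: the degenerate family u₁ + u₂ = 1, w₁ = u₁, w₂ = u₂)] [cite: IkhlefCardy2009, §3 (the v = 0 solution classes)] -/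
theorem degenerate_rigidity (hrel : ExactPlaquetteVertexRelation W t c) (ht : t ≠ 0) (h1 : W.u₁ ≠ 0)
    (h2 : W.u₂ ≠ 0) (hv : W.v = 0) (hc : c ≠ 0) :
    t ^ 4 = 1 ∧ ∃ ε : ℂ, (ε = 1 ∨ ε = -1) ∧
      (c 0 + ε * c 2) ≠ 0 ∧ (c 1 + ε * c 3) ≠ 0 ∧
      (c 1 + ε * c 3) ^ 2 = t ^ 2 * (c 0 + ε * c 2) ^ 2 ∧
      W.u₂ * t ^ 2 * (c 0 + ε * c 2) = -ε * W.u₁ * (c 0 + ε * c 2) - t * (c 1 + ε * c 3) ∧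
      W.w₁ * (c 0 + ε * c 2) = -ε * W.u₁ * t * (c 1 + ε * c 3) ∧
      W.w₂ * t * (c 0 + ε * c 2) = -W.u₂ * (c 1 + ε * c 3) := by
  obtain ⟨fA1, fA1', fB1, fB1'⟩ := forms_adjE hrel ht h1 h2
  obtain ⟨fC1, fC1', fE1, fE1'⟩ := forms_adj hrel ht h1 h2
  obtain ⟨ε, hε, hab⟩ := exists_eps_component_ne_zero hc
  obtain ⟨ha, hb, ht4, hbt, hR3, hR2, hR1⟩ := degenerate_of_forms ht h1 h2 hv (inst_IN hrel ht)
    (inst_IS hrel ht) fA1 fA1' fB1 fB1' fC1 fC1' fE1 fE1' hε hab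
  exact ⟨ht4, ε, hε, ha, hb, hbt, hR3, hR2, hR1⟩

/-- **Integer spin on the `v = 0` branch**: a relation with `v = 0`, `u₁u₂ ≠ 0`, `c ≠ 0` forces
`t⁴ = 1`, i.e. `σ ∈ ℤ` — the `v = 0` alternative of Glazman's "either `v = 0` or `σ = ℓ/8`", made
quantitative. [cite: Glazman2015WeightedSAW, Lemma 3.1 (σ = 1 degenerate family)] -/
theorem t_pow_four_of_exactPlaquetteVertexRelation_of_v_eq_zero (hrel : ExactPlaquetteVertexRelation W t c)
    (ht : t ≠ 0) (h1 : W.u₁ ≠ 0) (h2 : W.u₂ ≠ 0) (hv : W.v = 0) (hc : c ≠ 0) : t ^ 4 = 1 :=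
  (degenerate_rigidity hrel ht h1 h2 hv hc).1

/-- **The dichotomy** (Glazman's Lemma 3.1 shape, necessity, any complex weights with `u₁u₂ ≠ 0`, any
`t ≠ 0`, any `c ≠ 0`): an exact vertex relation on every finite domain forces EITHER `v ≠ 0`, `t¹⁶ = −1`
(`σ ∈ (2ℤ+1)/8`) and the weights on a Yang–Baxter curve `ybCurve ε t r`, OR `v = 0`, `t⁴ = 1` (`σ ∈ ℤ`)
and the weights on the degenerate line of `degenerate_rigidity`.
[cite: Glazman2015WeightedSAW, Lemma 3.1 ("either v = 0 or σ = ℓ/8"; Nienhuis' weights / the degenerate family)] [cite: IkhlefCardy2009, §3] -/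
theorem exactPlaquetteVertexRelation_dichotomy (hrel : ExactPlaquetteVertexRelation W t c) (ht : t ≠ 0)
    (h1 : W.u₁ ≠ 0) (h2 : W.u₂ ≠ 0) (hc : c ≠ 0) :
    (W.v ≠ 0 ∧ t ^ 16 = -1 ∧ ∃ ε : ℂ, (ε = 1 ∨ ε = -1) ∧ c 0 + ε * c 2 ≠ 0 ∧
        W = ybCurve ε t ((c 1 + ε * c 3) / (c 0 + ε * c 2))) ∨
    (W.v = 0 ∧ t ^ 4 = 1 ∧ ∃ ε : ℂ, (ε = 1 ∨ ε = -1) ∧ (c 0 + ε * c 2) ≠ 0 ∧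
        (c 1 + ε * c 3) ^ 2 = t ^ 2 * (c 0 + ε * c 2) ^ 2 ∧
        W.u₂ * t ^ 2 * (c 0 + ε * c 2) = -ε * W.u₁ * (c 0 + ε * c 2) - t * (c 1 + ε * c 3) ∧
        W.w₁ * (c 0 + ε * c 2) = -ε * W.u₁ * t * (c 1 + ε * c 3) ∧
        W.w₂ * t * (c 0 + ε * c 2) = -W.u₂ * (c 1 + ε * c 3)) := by
  by_cases hv : W.v = 0
  · right
    obtain ⟨ht4, ε, hε, ha, -, hbt, hR3, hR2, hR1⟩ := degenerate_rigidity hrel ht h1 h2 hv hc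
    exact ⟨hv, ht4, ε, hε, ha, hbt, hR3, hR2, hR1⟩
  · left
    exact ⟨hv, t_pow_sixteen_of_exactPlaquetteVertexRelation hrel ht h1 h2 hv hc,
      weights_eq_ybCurve hrel ht h1 h2 hv hc⟩

/-- **Barrier `PlaquetteWalkDichotomy`**: for the five-weight plaquette walk on `ℤ²` with complex weights
`u₁u₂ ≠ 0` and phase `t ≠ 0`, an exact vertex relation with a nonzero vertex-independent coefficient
vector on every finite domain forces: `v ≠ 0 ∧ t¹⁶ = −1 ∧ W` on a Yang–Baxter curve, or
`v = 0 ∧ t⁴ = 1 ∧ W` on the degenerate line — the kernel form of the printed dichotomy.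
[cite: Glazman2015WeightedSAW, Lemma 3.1] [cite: IkhlefCardy2009, §3] -/
def _root_.Literature.Barriers.CriticalPhenomena.PlaquetteWalkDichotomy : Prop :=
  ∀ (W : CWeights) (t : ℂ) (c : Fin 4 → ℂ), t ≠ 0 → W.u₁ ≠ 0 → W.u₂ ≠ 0 → c ≠ 0 →
    ExactPlaquetteVertexRelation W t c →
      (W.v ≠ 0 ∧ t ^ 16 = -1 ∧ ∃ ε : ℂ, (ε = 1 ∨ ε = -1) ∧ c 0 + ε * c 2 ≠ 0 ∧
          W = ybCurve ε t ((c 1 + ε * c 3) / (c 0 + ε * c 2))) ∨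
      (W.v = 0 ∧ t ^ 4 = 1 ∧ ∃ ε : ℂ, (ε = 1 ∨ ε = -1) ∧ (c 0 + ε * c 2) ≠ 0 ∧
          (c 1 + ε * c 3) ^ 2 = t ^ 2 * (c 0 + ε * c 2) ^ 2 ∧
          W.u₂ * t ^ 2 * (c 0 + ε * c 2) = -ε * W.u₁ * (c 0 + ε * c 2) - t * (c 1 + ε * c 3) ∧
          W.w₁ * (c 0 + ε * c 2) = -ε * W.u₁ * t * (c 1 + ε * c 3) ∧
          W.w₂ * t * (c 0 + ε * c 2) = -W.u₂ * (c 1 + ε * c 3))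

/-- Discharge of `PlaquetteWalkDichotomy`. [cite: Glazman2015WeightedSAW, Lemma 3.1] -/
theorem _root_.Literature.Barriers.CriticalPhenomena.PlaquetteWalkDichotomy_holds : PlaquetteWalkDichotomy :=
  fun _ _ _ ht h1 h2 hc hrel => exactPlaquetteVertexRelation_dichotomy hrel ht h1 h2 hc

end DegenerateBranch

/-! ### Appended: the no-touch faces for the INTERIOR-faces class -/

section NoTouchInt

variable {W : CWeights} {t : ℂ} {c : Fin 4 → ℂ}

/-- **The `w₂ = 0` face, interior-faces class** (`v ≠ 0`): off the quadric `v² = u₂²` there is no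
exact vertex relation at interior faces (`c = 0`). [cite: Glazman2015WeightedSAW, Lemma 3.1 (no holomorphic weights with w₁ = w₂ = 0)] [cite: DuminilCopinSmirnov2012, Lemma 1 (shape of the relation)] -/
theorem eq_zero_of_exactPlaquetteVertexRelationInt_of_w₂_eq_zero
    (hrel : ExactPlaquetteVertexRelationInt W t c) (ht : t ≠ 0) (h1 : W.u₁ ≠ 0) (h2 : W.u₂ ≠ 0)
    (hv : W.v ≠ 0) (hw2 : W.w₂ = 0) (hne : W.v ^ 2 ≠ W.u₂ ^ 2) : c = 0 := by
  have hIE := inst_JE hrel ht hv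
  have hIN := inst_JN hrel ht hv
  have hIW := inst_JW hrel ht hv
  have hIS := inst_JS hrel ht hv
  have hBNWE := inst_CNWE hrel ht hv
  have hBSEW := inst_CSEW hrel ht hv
  have hBNWS := inst_CNWS hrel ht hv
  have hBSEN := inst_CSEN hrel ht hv
  have m12 : W.u₁ * W.u₂ ^ 2 ≠ 0 := mul_ne_zero h1 (pow_ne_zero _ h2)
  have fA1 : W.v * c 1 + W.u₂ * t ^ 5 * c 2 = 0 := by
    have h : W.u₁ * W.u₂ ^ 2 * (W.v * c 1 + W.u₂ * t ^ 5 * c 2) = 0 := by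
      linear_combination hBNWE - t ^ 2 * hIE - W.u₁ * W.u₂ ^ 2 * t ^ 4 * c 3 * hw2
    exact (mul_eq_zero.1 h).resolve_left m12
  have fA2 : W.u₂ * c 1 + W.v * t ^ 5 * c 2 = 0 := by
    have h : W.u₁ * W.u₂ ^ 2 * (W.u₂ * c 1 + W.v * t ^ 5 * c 2) = 0 := by
      linear_combination hBNWS - t * hIS - W.u₁ * W.u₂ ^ 2 * t * c 0 * hw2
    exact (mul_eq_zero.1 h).resolve_left m12
  have fA1' : W.u₂ * t ^ 5 * c 0 + W.v * c 3 = 0 := by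
    have h : W.u₁ * W.u₂ ^ 2 * (W.u₂ * t ^ 5 * c 0 + W.v * c 3) = 0 := by
      linear_combination hBSEW - t ^ 2 * hIW - W.u₁ * W.u₂ ^ 2 * t ^ 4 * c 1 * hw2
    exact (mul_eq_zero.1 h).resolve_left m12
  have fA2' : W.v * t ^ 5 * c 0 + W.u₂ * c 3 = 0 := by
    have h : W.u₁ * W.u₂ ^ 2 * (W.v * t ^ 5 * c 0 + W.u₂ * c 3) = 0 := by
      linear_combination hBSEN - t * hIN - W.u₁ * W.u₂ ^ 2 * t * c 2 * hw2
    exact (mul_eq_zero.1 h).resolve_left m12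
  have hdet0 : W.v ^ 2 - W.u₂ ^ 2 ≠ 0 := sub_ne_zero.2 hne
  have hdet5 : (W.v ^ 2 - W.u₂ ^ 2) * t ^ 5 ≠ 0 := mul_ne_zero hdet0 (pow_ne_zero _ ht)
  have k1 : (W.v ^ 2 - W.u₂ ^ 2) * c 1 = 0 := by linear_combination W.v * fA1 - W.u₂ * fA2
  have k2 : (W.v ^ 2 - W.u₂ ^ 2) * t ^ 5 * c 2 = 0 := by linear_combination W.v * fA2 - W.u₂ * fA1
  have k0 : (W.v ^ 2 - W.u₂ ^ 2) * t ^ 5 * c 0 = 0 := by linear_combination W.v * fA2' - W.u₂ * fA1'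
  have k3 : (W.v ^ 2 - W.u₂ ^ 2) * c 3 = 0 := by linear_combination W.v * fA1' - W.u₂ * fA2'
  funext i
  fin_cases i
  · exact (mul_eq_zero.1 k0).resolve_left hdet5
  · exact (mul_eq_zero.1 k1).resolve_left hdet0
  · exact (mul_eq_zero.1 k2).resolve_left hdet5
  · exact (mul_eq_zero.1 k3).resolve_left hdet0

/-- **The `w₁ = 0` face, interior-faces class** (`v ≠ 0`): off the quadric `v² = u₁²` there is no
exact vertex relation at interior faces. [cite: Glazman2015WeightedSAW, Lemma 3.1 (no holomorphic weights with w₁ = w₂ = 0)] [cite: DuminilCopinSmirnov2012, Lemma 1 (shape of the relation)] -/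
theorem eq_zero_of_exactPlaquetteVertexRelationInt_of_w₁_eq_zero
    (hrel : ExactPlaquetteVertexRelationInt W t c) (ht : t ≠ 0) (h1 : W.u₁ ≠ 0) (h2 : W.u₂ ≠ 0)
    (hv : W.v ≠ 0) (hw1 : W.w₁ = 0) (hne : W.v ^ 2 ≠ W.u₁ ^ 2) : c = 0 := by
  have hIE := inst_JE hrel ht hv
  have hIN := inst_JN hrel ht hv
  have hIW := inst_JW hrel ht hv
  have hIS := inst_JS hrel ht hv
  have hBSWE := inst_CSWE hrel ht hv
  have hBSWN := inst_CSWN hrel ht hv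
  have hBNEW := inst_CNEW hrel ht hv
  have hBNES := inst_CNES hrel ht hv
  have m21 : W.u₁ ^ 2 * W.u₂ ≠ 0 := mul_ne_zero (pow_ne_zero _ h1) h2
  have fB1 : W.u₁ * c 2 + W.v * t ^ 5 * c 3 = 0 := by
    have h : W.u₁ ^ 2 * W.u₂ * (W.u₁ * c 2 + W.v * t ^ 5 * c 3) = 0 := by
      linear_combination hBSWE - t * hIE - W.u₁ ^ 2 * W.u₂ * t * c 1 * hw1
    exact (mul_eq_zero.1 h).resolve_left m21
  have fB2 : W.v * c 2 + W.u₁ * t ^ 5 * c 3 = 0 := by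
    have h : W.u₁ ^ 2 * W.u₂ * (W.v * c 2 + W.u₁ * t ^ 5 * c 3) = 0 := by
      linear_combination hBSWN - t ^ 2 * hIN - W.u₁ ^ 2 * W.u₂ * t ^ 4 * c 0 * hw1
    exact (mul_eq_zero.1 h).resolve_left m21
  have fB1' : W.u₁ * c 0 + W.v * t ^ 5 * c 1 = 0 := by
    have h : W.u₁ ^ 2 * W.u₂ * (W.u₁ * c 0 + W.v * t ^ 5 * c 1) = 0 := by
      linear_combination hBNEW - t * hIW - W.u₁ ^ 2 * W.u₂ * t * c 3 * hw1
    exact (mul_eq_zero.1 h).resolve_left m21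
  have fB2' : W.v * c 0 + W.u₁ * t ^ 5 * c 1 = 0 := by
    have h : W.u₁ ^ 2 * W.u₂ * (W.v * c 0 + W.u₁ * t ^ 5 * c 1) = 0 := by
      linear_combination hBNES - t ^ 2 * hIS - W.u₁ ^ 2 * W.u₂ * t ^ 4 * c 2 * hw1
    exact (mul_eq_zero.1 h).resolve_left m21
  have hdet0 : W.v ^ 2 - W.u₁ ^ 2 ≠ 0 := sub_ne_zero.2 hne
  have hdet5 : (W.v ^ 2 - W.u₁ ^ 2) * t ^ 5 ≠ 0 := mul_ne_zero hdet0 (pow_ne_zero _ ht)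
  have k2 : (W.v ^ 2 - W.u₁ ^ 2) * c 2 = 0 := by linear_combination W.v * fB2 - W.u₁ * fB1
  have k3 : (W.v ^ 2 - W.u₁ ^ 2) * t ^ 5 * c 3 = 0 := by linear_combination W.v * fB1 - W.u₁ * fB2
  have k0 : (W.v ^ 2 - W.u₁ ^ 2) * c 0 = 0 := by linear_combination W.v * fB2' - W.u₁ * fB1'
  have k1 : (W.v ^ 2 - W.u₁ ^ 2) * t ^ 5 * c 1 = 0 := by linear_combination W.v * fB1' - W.u₁ * fB2'
  funext i
  fin_cases i
  · exact (mul_eq_zero.1 k0).resolve_left hdet0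
  · exact (mul_eq_zero.1 k1).resolve_left hdet5
  · exact (mul_eq_zero.1 k2).resolve_left hdet0
  · exact (mul_eq_zero.1 k3).resolve_left hdet5

/-- **No-touch faces, interior class**: `w₁ = w₂ = 0`, `u₁u₂v ≠ 0`, a relation with `c ≠ 0` at the
interior faces of every finite domain ⇒ `v² = u₁² = u₂²` and `t¹⁶ = −1`.
[cite: Glazman2015WeightedSAW, Lemma 3.1 (no holomorphic weights with w₁ = w₂ = 0)] [cite: DuminilCopinSmirnov2012, Lemma 1 (shape of the relation)] -/
theorem sq_eq_and_sq_eq_of_exactPlaquetteVertexRelationInt_noTouch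
    (hrel : ExactPlaquetteVertexRelationInt W t c) (ht : t ≠ 0) (h1 : W.u₁ ≠ 0) (h2 : W.u₂ ≠ 0)
    (hv : W.v ≠ 0) (hw1 : W.w₁ = 0) (hw2 : W.w₂ = 0) (hc : c ≠ 0) :
    W.v ^ 2 = W.u₁ ^ 2 ∧ W.v ^ 2 = W.u₂ ^ 2 ∧ t ^ 16 = -1 := by
  refine ⟨?_, ?_, t_pow_sixteen_of_exactPlaquetteVertexRelationInt hrel ht h1 h2 hv hc⟩
  · by_contra hne
    exact hc (eq_zero_of_exactPlaquetteVertexRelationInt_of_w₁_eq_zero hrel ht h1 h2 hv hw1 hne)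
  · by_contra hne
    exact hc (eq_zero_of_exactPlaquetteVertexRelationInt_of_w₂_eq_zero hrel ht h1 h2 hv hw2 hne)

end NoTouchInt

end PlaquetteWalk

end Literature.Barriers.CriticalPhenomena
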